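import Summits.BirchSwinnertonDyer.BirchSwinnertonDyer.Theorems.EdixhovenFibreFiveSevenStarredOptimalManinUnitFiveSevenAssembly
import Summits.BirchSwinnertonDyer.BirchSwinnertonDyer.Theorems.AdditiveKolyvaginRoadManinFrameResidueProperRTameTwistLegendre
import Summits.BirchSwinnertonDyer.BirchSwinnertonDyer.Theorems.AdditiveKolyvaginRoadManinFrameResidueProperRTameTwistSymbols
import Summits.BirchSwinnertonDyer.BirchSwinnertonDyer.Theorems.AdditiveKolyvaginRoadManinFrameResidueProperRTameTwistSymbols57
import Summits.BirchSwinnertonDyer.BirchSwinnertonDyer.Theorems.AdditiveKolyvaginRoadManinFrameResidueProperRTameTwistSplitL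
import Summits.BirchSwinnertonDyer.BirchSwinnertonDyer.Theorems.AdditiveKolyvaginRoadManinFrameResidueProperRTameTwistSplit4
import Literature.NumberTheory.EllipticCurves.ModularCurveRealPeriodProofs
import Literature.NumberTheory.EllipticCurves.ModularCurveManinSemistableBridgeProofs
import Literature.NumberTheory.EllipticCurves.ComplexMultiplicationBurungaleFlachProofs
import Literature.NumberTheory.EllipticCurves.ModularFormsGamma0Genus
import Literature.NumberTheory.EllipticCurves.ModularSymbols
import Literature.NumberTheory.EllipticCurves.Isogeny
import Literature.NumberTheory.EllipticCurves.ModularCurve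
import Literature.NumberTheory.EllipticCurves.ModularCurveNeronLatticeProofs
import Literature.NumberTheory.EllipticCurves.KatoAdditiveTwistedValueNeronIntegrality
import Literature.NumberTheory.EllipticCurves.BSDQuadraticDescentArchimedeanProofs
import Literature.NumberTheory.EllipticCurves.ImaginaryPeriod
import Literature.NumberTheory.EllipticCurves.RealLatticePeriodDiscrProofs
import Literature.NumberTheory.EllipticCurves.EichlerShimuraConstructionLatticeProofs
import Literature.NumberTheory.EllipticCurves.NeronIsogenyScalingHoldsProofs
import Literature.NumberTheory.EllipticCurves.SkinnerUrban2014.PAdicUnitPeriodRatioAnyPrimeProofs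
import Literature.NumberTheory.EllipticCurves.SkinnerUrban2014.PAdicUnitImaginaryPeriodRatioProofs
import Literature.NumberTheory.EllipticCurves.CuspFormLFunctionLevelConductorProofs
import Literature.NumberTheory.EllipticCurves.NonEisensteinPrimeOfSurjective
import Literature.NumberTheory.EllipticCurves.KrausOesterle1992.TorsionCongruenceCriterionHasseWeilProofs
import Literature.NumberTheory.EllipticCurves.ModularDegreeQuadraticTwistProofs
import Literature.NumberTheory.EllipticCurves.KatzPrimePowerEisensteinTorsionProofs
import Literature.NumberTheory.EllipticCurves.EisensteinCongruenceRationalTorsionProofs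
import Literature.NumberTheory.EllipticCurves.BSDWave0
import Literature.NumberTheory.EllipticCurves.VariableChangePoints
import Literature.NumberTheory.EllipticCurves.GlobalMinimalModelProofs
import Literature.NumberTheory.EllipticCurves.IsogenyVariableChangeProofs
import Literature.NumberTheory.EllipticCurves.IsogenyCompProofs
import Literature.NumberTheory.EllipticCurves.CyclicIsogenyCharacterFrobeniusProofs
import Literature.NumberTheory.EllipticCurves.StableCyclicSubgroupTransportProofs
import Literature.NumberTheory.EllipticCurves.DivisionFieldRamificationDividesProofs
import Literature.NumberTheory.EllipticCurves.DeligneSerreWeightOneIrreducibleKroneckerWeberProofs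
import Literature.NumberTheory.EllipticCurves.GaloisActionProofs
import Literature.NumberTheory.EllipticCurves.LFunctionPrimeCoeff
import Literature.NumberTheory.GaloisRepresentations.KroneckerWeberTheorem
import Literature.NumberTheory.GaloisRepresentations.ModNCyclotomicCharacter
import Literature.NumberTheory.GaloisRepresentations.FramedRepTwistEulerFactorProofs
import Literature.NumberTheory.GaloisRepresentations.IntegralGaloisActionProofs
import Literature.NumberTheory.GaloisRepresentations.DirichletCharacterOfGaloisCharacter
import Literature.NumberTheory.EllipticCurves.OpenImageMazurTwistProofs
import Literature.NumberTheory.EllipticCurves.RootNumberTwistProofs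
import Literature.NumberTheory.EllipticCurves.HidaFamilyMembersProofs
import Literature.NumberTheory.EllipticCurves.OpenImageMazurCharacterProofs

/-!
# Two-parity Kato member lever — sketch rev 8 (bsd-idea-19 g13, lens dual; crux idea `two-parity-member-lever` on
# stmt-22969, bearing on stmt-25138 `TwistFamilyManinDescent.EisensteinAdditiveManinResidual` = R)

**Rev 8 (g13) DISCHARGES the last cite-level input (E0b″) in the kernel — no new fact, no conductor theory.**  The even
lever never needed LEVEL CONTROL `M ∣ N`: it needs the congruence `a_{d′} ≡ φ(d′) + d′φ(d′)⁻¹` only at the primes `d′`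
produced by `exists_admissiblePrime`, and `φ(d_γ)` to be a HOMOMORPHISM on the group carrying the admissible class.  Both
hold on the smaller group `Γ₀(N′)`, `N′ = lcm(N, m)` (`m` = the level of THE primitive isogeny character of §12): the
rev-3 argument run verbatim on `Γ₀(N′) ≤ Γ₀(N)` (bsd-wall's splitting `exists_eq_mul_adjustableL/57` is level-generic)
gives `p ∣ m(γ)` for `γ ∈ Γ₀(N′)`, and the new `p′`-TRANSFER — every `κ ∈ Γ₀(N)` has a power `κ^k ∈ Γ₀(N′)` with
`p ∤ k` — carries it to all of `Γ₀(N)` by additivity `m(κ^k) = k·m(κ)` (`evenMemberLever_coreT`).  The transfer is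
elementary matrix arithmetic (`pow_entry10_climb`: `ℓ^j ∣ c_γ`, `j ≥ 1` ⟹ `ℓ^{j+1} ∣ (γ^{(ℓ−1)ℓ})₁₀`) and is available
because the primes `ℓ` with `v_ℓ(m) > v_ℓ(N)` satisfy (i) `ℓ ≠ p` (tameness `p² ∤ m`, §12, vs `p² ∣ N`), (ii) `ℓ ∣ N`
(support control (E0a″): `ℓ` is additive, and `N`/`N_E` have the same support, `IsNewformOf.dvd_level_iff_dvd_conductorNorm`),
(iii) `ℓ² ∣ m`, whence — THE ORDER LEMMA (L1) `prime_dvd_sub_one_of_sq_dvd_of_isPrimitive`: a primitive `𝔽_pˣ`-valued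
character of level divisible by `ℓ²` has `ℓ ∣ p − 1` (the kernel of `(ℤ/m)ˣ → (ℤ/(m/ℓ))ˣ` is killed by `ℓ`, and by `p − 1`)
— `ℓ < p`, so `p ∤ (ℓ−1)ℓ`.  NET (§13): `residualOffWalls_of_standingFacts : hT₂ → hP → hDR → hP1 → (∀ V, mazur_torsion V)
→ ResidualOffWalls` — `R` off its two walls from the four standing facts of the Kato road and Mazur's torsion theorem
ALONE; every Prop of this file other than those five hypotheses is a theorem ((E0-T) `EisensteinCongruenceTOfReducibleMin`,
`EvenMemberLeverT`, `OddMemberLever`, (E1), P-1, P-2, assembly).  (E0b″) `IsogenyCharacterLevelBound` stays stated (true,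
Serre 1987/Carayol 1986) but is OFF the proof path.  Statements of rev ≤ 7 are unchanged (new decls only); linter hygiene of
V#23c paid.  BSD is not proved; R is not proved (the two walls and the standing facts remain).**

MAP.  §0 walls / admissible class / the Props (E0) `EisensteinCongruence`, (E0-T) `EisensteinCongruenceT`, (E1)
`NonAnomalousPrime`, `NonAnomalousOfReceptacle`; `exists_admissiblePrime` · §1 P-1 the member value law, PROVED
(`katoNeronMemberTwistedValues_of_sl2NeronValues`) · §2 the levers `OddMemberLever`, `EvenMemberLever`, `EvenMemberLeverT`
and the kernel target `KatoMemberTwoParity` · §3 P-2 `cyclicKernelPeriodDichotomy_holds` · §4 `ResidualOffWalls`, `Assembly`,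
`assembly_holds`, `residualOffWalls_of_katoMemberTwoParity` · §5–§6 even identities, Mazur relation, antisymmetric
elimination · §6½ the `p′`-transfer lemmas · §7 `evenMemberLever_coreT` / `evenMemberLever_core` / `evenMemberLever_holds` /
`evenMemberLeverT_holds` · §8 the odd lever `oddMemberLever_holds` · §9 (E1) `nonAnomalousOfReceptacle_of_mazur` (Katz 1981
tree theorem + `mazur_torsion`) · §10 (E0-min) Props of record · §11 support control, THE isogeny character as a primitive
Dirichlet character (`exists_isogenyCharacter_dirichlet`) · §12 (E0a″) `exists_isogenyCharacter_dirichlet_additive`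
(multiplicative-unramified, tame at `p`), (E0b″) `IsogenyCharacterLevelBound` (stated; OFF-path since rev 8) · §13 (L1),
`eisensteinCongruenceT_of_reducible`, `katoMemberTwoParity_of_leversT`, NET `residualOffWalls_of_standingFacts`.

REMOVED in rev 8 (the 200 kB workfile cap; all superseded by §12–§13 and kept in git at rev 7 @7a4368ad6190): the
intermediate nets `residualOffWalls_of_levers/_of_oddLever/_of_facts/_of_facts_mazur/_levelControl/_exponentControl/
_levelBound`, `katoMemberTwoParity_of_levers[_min]`, and the scaffolding Props (E0a) `EisensteinCongruenceSomeLevel`, (E0a′)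
`EisensteinCongruenceBadLevel`, (E0b) `EisensteinLevelControl`, (E0b′) `EisensteinExponentControl` with their reductions
(incl. `eisensteinCongruenceOfReducibleMin_of_levelBound`).  Every def of record of rev ≤ 7 that a verdict names
(`EisensteinCongruence`, `EisensteinCongruenceOfReducible[Min]`, `NonAnomalousOfReceptacle`, `OddMemberLever`, `EvenMemberLever`,
`KatoMemberTwoParity`, `CyclicKernelPeriodDichotomy`, `ResidualOffWalls`, `Assembly`, `IsogenyCharacterLevelBound`) is UNCHANGED.
The history of revs 2–7 (prices P-1…P-4 of V#21h, (i)–(iii) of V#21i/j, V#23a/c) is in the memo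
`Lines/two-parity-member-even.md` (§History) and in the docstrings below.

Nothing here is registered as a skeleton (W-79); nothing is a route (W-71).  BSD is not proved by any of this; R is not
proved by any of this.
-/

set_option autoImplicit false
set_option linter.dupNamespace false

noncomputable section

open scoped MatrixGroups ModularForm Classical NumberField TensorProduct
open CongruenceSubgroup WeierstrassCurve IsDedekindDomain NumberField
open Literature.NumberTheory.GaloisRepresentations
open Literature.NumberTheory.EllipticCurves Literature.NumberTheory.EllipticCurves.ModularForms
open Literature.NumberTheory.EllipticCurves.Kato2004 Literature.NumberTheory.EllipticCurves.Kato2004.EulerSystemValues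
open Literature.NumberTheory.EllipticCurves.Rank1Residual
open Summit.BirchSwinnertonDyer.BirchSwinnertonDyer.Theorems
open Summit.BirchSwinnertonDyer.BirchSwinnertonDyer.Theorems.SemiLocalDescent
open Summit.BirchSwinnertonDyer.BirchSwinnertonDyer.Theorems.KatoNeronIsogenyTransport
open Summit.BirchSwinnertonDyer.BirchSwinnertonDyer.Theorems.KatoAssemblySocket
open Summit.BirchSwinnertonDyer.BirchSwinnertonDyer.Theorems.StarredOptimalManinUnitFiveSevenValueExit

namespace Summit.BirchSwinnertonDyer.BirchSwinnertonDyer.Cruxes.ManinPrimeToAdditiveFiveLe.TwoParityMemberLever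

/-! ## §0  Walls, the admissible class, the two elementary consequences of reducibility -/

/-- Receptacle at the member (Kim–Nakamura Cor. 2.4 / Kosters–Pannekoek): automatic for `p > 7`; at
`p ∈ {5,7}` no globally minimal member of the isogeny class has a `ℚ_p`-point of order `p`
(row-decidable: holds whenever the tame index `e_p ≠ p − 1`, in particular on every K15a/K15b row). -/
def MemberReceptacle (W : WeierstrassCurve ℚ) [W.IsElliptic] (p : ℕ) [Fact p.Prime] : Prop :=
  7 < p ∨ ∀ (W' : WeierstrassCurve ℚ) [W'.IsElliptic] [W'.IsGloballyMinimal],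
    WeierstrassCurve.IsIsogenous W W' →
      ∀ P : (W'.baseChange ℚ_[p]).toAffine.Point, p • P = 0 → P = 0

/-- **P-4.** On the `p = 13` and `163`-corner rows of R the member receptacle is the trivial disjunct. -/
theorem memberReceptacle_of_seven_lt (W : WeierstrassCurve ℚ) [W.IsElliptic] (p : ℕ) [Fact p.Prime]
    (hp : 7 < p) : MemberReceptacle W p :=
  Or.inl hp

theorem memberReceptacle_thirteen (W : WeierstrassCurve ℚ) [W.IsElliptic] [Fact (Nat.Prime 13)] :
    MemberReceptacle W 13 :=
  memberReceptacle_of_seven_lt W 13 (by norm_num)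

theorem memberReceptacle_163 (W : WeierstrassCurve ℚ) [W.IsElliptic] [Fact (Nat.Prime 163)] :
    MemberReceptacle W 163 :=
  memberReceptacle_of_seven_lt W 163 (by norm_num)

/-- The ONE even resonance wall: no multiplicative prime `ℓ ∥ N` with `ℓ ≡ a_ℓ (mod p)`.  (For an admissible
auxiliary prime `d′ ≡ 3 (4)`, `d′ ≢ 1 (r)` for odd `r ∣ p − 1`, every EVEN character mod `d′` has odd order
coprime to `p − 1`, so `χ(ℓ) ∉ {−1} ∪ {nontrivial roots of unity reducing into 𝔽_p}`: the Euler factor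
`(ℓ − a_ℓχ(ℓ))(ℓ − a_ℓχ̄(ℓ))`, `a_ℓ = ±1`, is a `𝔭`-unit unless `χ(ℓ) = 1`-resonance `ℓ ≡ a_ℓ`.) -/
def EvenNonResonant (W : WeierstrassCurve ℚ) (p N : ℕ) : Prop :=
  ∀ ℓ ∈ N.primeFactors, ¬ ℓ ^ 2 ∣ N → (ℓ : ZMod p) ≠ (W.LFunction ℓ : ZMod p)

/-- **(E0) Eisenstein congruence** — the elementary face of "`W[p]` reducible": `a_q ≡ φ(q) + q·φ(q)⁻¹ (mod p)`
for all primes `q ∤ N`, for a Dirichlet character `φ` with values in `(ℤ/p)ˣ` of modulus `M ∣ N` (`W[p]^{ss} =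
φ ⊕ ωφ⁻¹`; prime-to-`p` conductor of `φ` squared divides `N`, `p`-part `≤ p` since `φ` is tame, and one of
`φ, ωφ⁻¹` is unramified at `p` unless `p² ∣ N`).  [cite: SerreProprietes1972, §5] [cite: MazurEisenstein1977, Prop. 5.1 / §5] -/
def EisensteinCongruence (W : WeierstrassCurve ℚ) (p N : ℕ) : Prop :=
  ∃ (M : ℕ) (φ : DirichletCharacter (ZMod p) M), M ∣ N ∧
    ∀ q : ℕ, q.Prime → ¬ q ∣ N →
      (W.LFunction q : ZMod p) = φ (q : ZMod M) + (q : ZMod p) * (φ (q : ZMod M))⁻¹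

/-- **(E0-T) Eisenstein congruence WITH `p′`-TRANSFER (rev 8)** — what the even lever really consumes: a Dirichlet
character `φ` of modulus `M` and an auxiliary level `N'` with `N ∣ N'`, `M ∣ N'`, the congruence
`a_q ≡ φ(q) + qφ(q)⁻¹ (mod p)` at the primes `q > N'`, and the TRANSFER property «every `κ ∈ Γ₀(N)` has a power
`κ^k ∈ Γ₀(N')` with `p ∤ k`».  (E0) `EisensteinCongruence W p N` gives it with `N' = N`, `k = 1`
(`eisensteinCongruenceT_of_eisensteinCongruence`); the primitive isogeny character gives it UNCONDITIONALLY for reducible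
`W[p]` in global minimal form, `p ≥ 5`, `p² ∣ N` (§13 `eisensteinCongruenceT_of_reducible`, `N' = lcm(N, m)`).
[cite: SerreProprietes1972, §5] [cite: MazurEisenstein1977, Prop. 5.1 / §5] -/
def EisensteinCongruenceT (W : WeierstrassCurve ℚ) (p N : ℕ) : Prop :=
  ∃ (N' M : ℕ) (_ : NeZero N') (φ : DirichletCharacter (ZMod p) M), N ∣ N' ∧ M ∣ N' ∧
    (∀ κ : Gamma0 N, ∃ k : ℕ, ¬ p ∣ k ∧ (N' : ℤ) ∣ ((κ ^ k : Gamma0 N) : SL(2, ℤ)) 1 0) ∧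
    ∀ q : ℕ, q.Prime → N' < q →
      (W.LFunction q : ZMod p) = φ (q : ZMod M) + (q : ZMod p) * (φ (q : ZMod M))⁻¹


/-- **(E1) one non-anomalous prime**: `p ∤ #W(𝔽_q) = q + 1 − a_q` for some prime `q ∤ N`.  By Katz 1981 Thm. 2 its
failure forces a rational `p`-torsion point on some `ℚ`-isogenous curve, excluded by Mazur's torsion theorem at
`p ≥ 11` and by the member receptacle at `p ∈ {5, 7}`.  Its role in the even lever: `(q + 1 − a_q){∞,0}_f ∈ Λ_f`
(Hecke/Mazur), so `{∞,0}_f ∈ ℤ_(p)·Ω_f⁺/2`.  [cite: KatzGaloisTorsion1981, Thm. 2] [cite: MazurEisenstein1977, Thm. 8]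
[cite: Manin1972, Thm. 1.6] -/
def NonAnomalousPrime (W : WeierstrassCurve ℚ) (p N : ℕ) : Prop :=
  ∃ q : ℕ, q.Prime ∧ ¬ q ∣ N ∧ ((q : ZMod p) + 1 - (W.LFunction q : ZMod p)) ≠ 0

/-- Provenance of (E0): reducible `W[p]` ⟹ Eisenstein congruence (support, Literature-level). -/
def EisensteinCongruenceOfReducible : Prop :=
  ∀ (W : WeierstrassCurve ℚ) [W.IsElliptic] {N : ℕ} [NeZero N] (f : CuspForm (Gamma0 N) 2)
    (p : ℕ) [Fact p.Prime], IsNewformOf W f → 5 ≤ p → ¬ W.HasIrreducibleModPGaloisRep p →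
    EisensteinCongruence W p N

/-- Provenance of (E1): the member receptacle (trivial at `p > 7`) ⟹ a non-anomalous prime (support; Katz 1981
Thm. 2 + Mazur 1977 Thm. 8). -/
def NonAnomalousOfReceptacle : Prop :=
  ∀ (W : WeierstrassCurve ℚ) [W.IsElliptic] (p : ℕ) [Fact p.Prime] (N : ℕ), N ≠ 0 → 5 ≤ p →
    MemberReceptacle W p → NonAnomalousPrime W p N

/-- **The admissible class of the even lever (P-3)** = bsd-wall's L-adjustable class of `γ = (a b; c d) ∈ Γ₀(N)`:
`c ≠ 0`; (a1) `d ≢ 1 (mod p)` — all characters mod `d′` have order prime to `p`, and `d̄ − 1` is invertible in the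
valuation argument; (a2) `p ≤ 7 ⇒ −d` is a square mod `p` — with (a4) this makes `p` a square mod `d′`, so
`ord_{d′}(p)` is odd; (a3) `r ∣ c ⇒ d ≢ 1 (mod r)` for odd primes `r ∣ p − 1` — `gcd(d′ − 1, p − 1) = 2`;
(a4) `4 ∣ c ⇒ d ≡ 3 (mod 4)` — even characters mod `d′` have ODD order.  No quadratic-residue prescription at the
multiplicative primes is needed for EVEN characters (contrast bsd-wall's `hγB` for odd ones). -/
def EvenAdmissible (p : ℕ) {N : ℕ} (γ : Gamma0 N) : Prop :=
  (γ : SL(2, ℤ)) 1 0 ≠ 0 ∧ ¬ (p : ℤ) ∣ (γ : SL(2, ℤ)) 1 1 - 1 ∧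
    (7 < p ∨ IsSquare (-((((γ : SL(2, ℤ)) 1 1 : ℤ)) : ZMod p))) ∧
    (∀ r : ℕ, r.Prime → r ≠ 2 → r ∣ p - 1 → (r : ℤ) ∣ (γ : SL(2, ℤ)) 1 0 →
      ¬ (r : ℤ) ∣ (γ : SL(2, ℤ)) 1 1 - 1) ∧
    ((4 : ℤ) ∣ (γ : SL(2, ℤ)) 1 0 → (4 : ℤ) ∣ (γ : SL(2, ℤ)) 1 1 - 3)

/-- **Admissible auxiliary primes exist (Dirichlet), with the Kosters–Pannekoek square.**  For an admissible `γ`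
there are a prime `d′ > N`, `d′ = d_γ + k c_γ`, with `p ∤ d′ − 1`, `r ∤ d′ − 1` (odd `r ∣ p − 1`), `4 ∤ d′ − 1`,
and `p` a square mod `d′` unless `p > 7` — bsd-wall's `exists_prime_eq_add_mul_of_adjustableL` with `B = {p}`.
Infinitely many: rerun with `N` replaced by any bound (the lemma gives `d′ > N`; the class is a union of
arithmetic progressions). -/
theorem exists_admissiblePrime {N : ℕ} [NeZero N] {p : ℕ} (hp : p.Prime) (hp2 : p ≠ 2) (hpN : p ∣ N)
    (γ : Gamma0 N) (hγ : EvenAdmissible p γ) :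
    ∃ (k : ℤ) (d' : ℕ), d'.Prime ∧ N < d' ∧ ((d' : ℤ) = (γ : SL(2, ℤ)) 1 1 + k * (γ : SL(2, ℤ)) 1 0) ∧
      ¬ p ∣ d' - 1 ∧ (∀ r : ℕ, r.Prime → r ≠ 2 → r ∣ p - 1 → ¬ r ∣ d' - 1) ∧ ¬ 4 ∣ d' - 1 ∧
      (7 < p ∨ IsSquare ((p : ZMod d'))) := by
  obtain ⟨hc, hdp, hγp, hdr, h4γ⟩ := hγ
  obtain ⟨k, d', hd', hNd', hd'eq, hpd', hrd', h4d', hsq⟩ :=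
    ManinFrameResidueProperRTameTwist.exists_prime_eq_add_mul_of_adjustableL hp hpN γ hc hdp hdr h4γ {p}
      (fun ℓ hℓ ↦ by rw [Finset.mem_singleton] at hℓ; subst hℓ; exact ⟨hp, hp2, hpN⟩)
  refine ⟨k, d', hd', hNd', hd'eq, hpd', hrd', h4d', ?_⟩
  rcases hγp with h | h
  · exact Or.inl h
  · exact Or.inr ((hsq p (Finset.mem_singleton_self p)).1 h)

/-! ## §1  P-1: the named lambda and «F″ at the member», irreducibility-free (PROVED) -/

/-- **H″ — the SL₂(ℤ)-type Néron value law at Kato's member WITH semi-local integrality** (the hypothesis of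
`KatoCarayolFree.kato_neron_five_le_of_integralSL2NeronValues'`, verbatim, now NAMED). For every `W/ℚ` and
prime `p` there is a globally minimal member `W′ ∼ W` — Kato's `E•` — carrying, for every newform `f` of `W`,
Manin-symbol coordinates `n ξ ±` (a `p`-unit one at each sign for `p ≠ 2`), and at every tame level `m` an
embedding `ι`, a `ℤ_p`-linear functional `Λ` on `H¹(ℚ(ζ_m), T_p W′)`, the `p`-adic tensor decomposition `Ψ`,
the SEMI-LOCAL INTEGRALITY of `Λ` (under `5 ≤ p`, additive, `m ⊥ pN`, receptacle clause) and Kato's value law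
(8.1.3) at `c ≡ d ≡ 1 (N)`, `gcd(cd, 6pm) = 1`, both parities, periods `Ω⁺(W′)`, `i·Ω⁻(W′)`.
[cite: Kato2004Asterisque, (8.1.3) (p. 180), §8.3 (p. 181), Thm. 9.7 (p. 189), Thm. 13.6 (p. 227)] -/
def MemberSL2NeronValueLaw : Prop :=
  ∀ (W : WeierstrassCurve ℚ) [W.IsElliptic] (p : ℕ) [Fact p.Prime],
      ∃ (W' : WeierstrassCurve ℚ) (_ : W'.IsElliptic) (_ : W'.IsGloballyMinimal), IsIsogenous W W' ∧
      ∀ [ContinuousSMul ℤ_[p] (W'.tateModule p)] [Module.Free ℤ_[p] (W'.tateModule p)]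
        [Module.Finite ℤ_[p] (W'.tateModule p)],
      ∀ {N : ℕ} [NeZero N] (f : CuspForm (Gamma0 N) 2), IsNewformOf W f →
      ∃ n : SL(2, ℤ) → Bool → ℚ,
        (p ≠ 2 → ∀ b : Bool, ∃ ξ : SL(2, ℤ), n ξ b ≠ 0 ∧ padicValRat p (n ξ b) = 0) ∧
        ∀ (m : ℕ) [NeZero m],
          ∃ (ι : CyclotomicField m ℚ →+* ℂ)
            (Λ : H1 (tateRep W' p) (rootsOfUnityFixer ℚ m) →ₗ[ℤ_[p]] ℚ_[p] ⊗[ℚ] CyclotomicField m ℚ)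
            (Ψ : ℚ_[p] ⊗[ℚ] CyclotomicField m ℚ ≃ₐ[ℚ]
              (Π w : ((Rat.HeightOneSpectrum.primesEquiv (R := 𝓞 ℚ)).symm ⟨p, Fact.out⟩).Extension
                (𝓞 (CyclotomicField m ℚ)), w.1.adicCompletion (CyclotomicField m ℚ))),
            (∀ (s : ℚ_[p]) (x : CyclotomicField m ℚ)
              (w : ((Rat.HeightOneSpectrum.primesEquiv (R := 𝓞 ℚ)).symm ⟨p, Fact.out⟩).Extension
                (𝓞 (CyclotomicField m ℚ))),
              Ψ (s ⊗ₜ[ℚ] x) w =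
                algebraMap (CyclotomicField m ℚ) (w.1.adicCompletion (CyclotomicField m ℚ)) x *
                algebraMap (((Rat.HeightOneSpectrum.primesEquiv (R := 𝓞 ℚ)).symm ⟨p, Fact.out⟩).adicCompletion ℚ)
                  (w.1.adicCompletion (CyclotomicField m ℚ)) ((Padic.adicCompletionEquiv (𝓞 ℚ) ⟨p, Fact.out⟩) s)) ∧
            (5 ≤ p → ¬ W'.HasGoodReductionAtPrime p → ¬ W'.HasMultiplicativeReductionAtPrime p →
              m.Coprime (p * N) →
              (7 < p ∨ (Nat.Coprime (orderOf (p : ZMod m)) (p - 1) ∧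
                ∀ P : (W'.baseChange ℚ_[p]).toAffine.Point, p • P = 0 → P = 0)) →
              ∀ (y : H1 (tateRep W' p) (rootsOfUnityFixer ℚ m))
                (w : ((Rat.HeightOneSpectrum.primesEquiv (R := 𝓞 ℚ)).symm ⟨p, Fact.out⟩).Extension
                  (𝓞 (CyclotomicField m ℚ))),
                Ψ (Λ y) w ∈ w.1.adicCompletionIntegers (CyclotomicField m ℚ)) ∧
            ∀ (c d : ℤ) (ξ : SL(2, ℤ)), c ≡ 1 [ZMOD (N : ℤ)] → d ≡ 1 [ZMOD (N : ℤ)] →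
              Int.gcd (c * d) (6 * p * m) = 1 →
              ∃ (z : H1 (tateRep W' p) (rootsOfUnityFixer ℚ m)) (x : CyclotomicField m ℚ),
                Λ z = (1 : ℚ_[p]) ⊗ₜ[ℚ] x ∧
                ∀ (χ : DirichletCharacter ℂ m) (Lχ : ℂ → ℂ), IsDepletedTwistedL f m (p * N) χ Lχ →
                  (χ (-1) = 1 →
                    charSum m ι χ x =
                      (((c : ℂ) ^ 2 - (c : ℂ) * χ (c : ZMod m)) * ((d : ℂ) ^ 2 - (d : ℂ) * (χ (d : ZMod m))⁻¹)) *
                        ((n ξ true : ℚ) : ℂ) * (Lχ 1 / (W'.realPeriodRat : ℂ))) ∧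
                  (χ (-1) = -1 →
                    charSum m ι χ x =
                      (((c : ℂ) ^ 2 - (c : ℂ) * χ (c : ZMod m)) * ((d : ℂ) ^ 2 - (d : ℂ) * (χ (d : ZMod m))⁻¹)) *
                        ((n ξ false : ℚ) : ℂ) * (Lχ 1 / (Complex.I * (W'.imaginaryPeriodRat : ℂ))))

set_option backward.isDefEq.respectTransparency false in
/-- ★ **P-1 (V#21h): the NAMED lambda `hT₂ → hP → hDR → hP1 → H″`.** This is exactly the anonymous function
inside `KatoAssemblySocket.kato_neron_five_le_of_sl2NeronValues`, extracted: Kato's member and P1's data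
`(d₀, PIN, n, ι, Λ)`, the `p`-adic tensor decomposition `Ψ` (`exists_padicTensorAlgEquiv`), and the semi-local
integrality `semilocal_mem_adicCompletionIntegers_of_pin_of_semi` (P2/P3/P4-coh under `hT₂ hP hDR`). No
irreducibility, no Carayol, no modularity anywhere in this term.
[cite: Kato2004Asterisque, §8.3 (p. 181), Thm. 9.7 (p. 189), Thm. 13.6 (p. 227)] -/
theorem memberNeronIntegrality_of_sl2NeronValues
    (hT₂ : Literature.NumberTheory.PAdicHodge.exists_smul_range_expStarCoord_tower_iff_trace_log)
    (hP : Literature.NumberTheory.PAdicHodge.cupLogInjective_and_hasDualExp_of_isDeRham)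
    (hDR : Literature.NumberTheory.PAdicHodge.isDeRham_restrictedRationalTateRep)
    (hP1 : exists_member_sl2ZetaElement_neron_values) : MemberSL2NeronValueLaw := by
  intro W _ p _
  obtain ⟨W', hE, hM, hiso, h⟩ := hP1 W p
  refine ⟨W', hE, hM, hiso, ?_⟩
  intro _ _ _ N _ f hf
  obtain ⟨d₀, hPIN, n, hN, hm⟩ := h f hf
  refine ⟨n, hN, fun m _ ↦ ?_⟩
  obtain ⟨ι, Λ, hSEMI, hVAL⟩ := hm m
  obtain ⟨Ψ, hΨ⟩ := Literature.NumberTheory.AdelicBaseChange.exists_padicTensorAlgEquiv (CyclotomicField m ℚ) p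
  refine ⟨ι, Λ, Ψ, hΨ, fun hp5 hg hmu hcop hcl y w ↦ ?_, hVAL⟩
  exact SemiLocalIntegrality.semilocal_mem_adicCompletionIntegers_of_pin_of_semi p hT₂ hP hDR W' hp5 ⟨hg, hmu⟩ d₀
    hPIN m (not_dvd_of_coprime_mul hcop) hcl Λ Ψ (hSEMI Ψ hΨ) y w

/-- Sanity: the named H″ feeds the tree's F″ socket unchanged (`kato_neron_five_le_of_integralSL2NeronValues'`). -/
theorem kato_neron_five_le_of_memberSL2NeronValueLaw (h : MemberSL2NeronValueLaw) :
    kato_neron_isIntegral_twistedSymbolSum_of_additive_five_le :=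
  KatoCarayolFree.kato_neron_five_le_of_integralSL2NeronValues' h

/-- **F″ AT THE MEMBER, NIV currency, IRREDUCIBILITY-FREE** (P-1's M piece, statement). For every `W/ℚ` and `p`
there is a globally minimal member `W′ ∼ W` (Kato's `E•`, depending on `(W, p)` only) such that for every newform
`f` of `W` (level `N`), `5 ≤ p`, `W` ADDITIVE at `p`, every `m ⊥ pN` satisfying the receptacle clause AT THE MEMBER
`7 < p ∨ (gcd(ord_m p, p−1) = 1 ∧ W′(ℚ_p)[p] = 0)`, every primitive `χ ≠ 1 (mod m)` of order prime to `p`, and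
every entire continuation `L` of the `(m·pN)`-depleted series of `χ̄`: `L(1)/Ω⁺(W′)` (χ even), `L(1)/(i·Ω⁻(W′))`
(χ odd) is `p`-integral up to a prime-to-`p` natural factor. NO `HasIrreducibleModPGaloisRep` binder.
[cite: Kato2004Asterisque, (8.1.3) (p. 180), §8.3 (p. 181), Thm. 6.6 (1) (p. 163)] -/
def KatoNeronMemberDepletedValues : Prop :=
  ∀ (W : WeierstrassCurve ℚ) [W.IsElliptic] (p : ℕ) [Fact p.Prime],
    ∃ (W' : WeierstrassCurve ℚ) (_ : W'.IsElliptic) (_ : W'.IsGloballyMinimal), IsIsogenous W W' ∧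
      ∀ {N : ℕ} [NeZero N] (f : CuspForm (Gamma0 N) 2), IsNewformOf W f → 5 ≤ p →
        ¬ W.HasGoodReductionAtPrime p → ¬ W.HasMultiplicativeReductionAtPrime p →
        ∀ (m : ℕ) [NeZero m], m.Coprime (p * N) →
          (7 < p ∨ (Nat.Coprime (orderOf (p : ZMod m)) (p - 1) ∧
            ∀ P : (W'.baseChange ℚ_[p]).toAffine.Point, p • P = 0 → P = 0)) →
          ∀ (χ : DirichletCharacter ℂ m), χ.IsPrimitive → χ ≠ 1 → ¬ p ∣ orderOf χ →
          ∀ (L : ℂ → ℂ), IsDepletedTwistedL f m (p * N) χ⁻¹ L →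
            (χ.Even → ∃ s : ℕ, ¬ p ∣ s ∧ IsIntegral ℤ ((s : ℂ) * (L 1 / (W'.realPeriodRat : ℂ)))) ∧
            (χ.Odd → ∃ s : ℕ, ¬ p ∣ s ∧
              IsIntegral ℤ ((s : ℂ) * (L 1 / (Complex.I * (W'.imaginaryPeriodRat : ℂ)))))

/-- F″'s EVEN clause AT A GIVEN CURVE `W_K` (all tame conductors `m ⊥ pN` passing the receptacle clause at `W_K`),
`(ϖ, r)` currency: `ϖ Ω⁺(W_K) = Ω_f⁺`, `E_N(χ)·Σ_a χ(a){∞,a/m}_f = r Ω_f⁺` ⟹ `ϖ r` is `p`-integral. -/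
def MemberEvenClause (W_K : WeierstrassCurve ℚ) [W_K.IsElliptic] {N : ℕ} [NeZero N]
    (f : CuspForm (Gamma0 N) 2) (p : ℕ) [Fact p.Prime] : Prop :=
  ∀ (m : ℕ) [NeZero m], m.Coprime (p * N) →
    (7 < p ∨ (Nat.Coprime (orderOf (p : ZMod m)) (p - 1) ∧
      ∀ P : (W_K.baseChange ℚ_[p]).toAffine.Point, p • P = 0 → P = 0)) →
    ∀ (χ : DirichletCharacter ℂ m), χ.IsPrimitive → χ ≠ 1 → ¬ p ∣ orderOf χ →
    ∀ (ϖ : ℚ) (r : ℂ), χ.Even → (ϖ : ℝ) * W_K.realPeriodRat = plusPeriod f →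
      (∏ ℓ ∈ N.primeFactors with ¬ ℓ ^ 2 ∣ N,
          (((ℓ : ℂ) - (W_K.LFunction ℓ : ℂ) * χ (ℓ : ZMod m)) *
            ((ℓ : ℂ) - (W_K.LFunction ℓ : ℂ) * (χ (ℓ : ZMod m))⁻¹))) * twistedSymbolSum f χ =
        r * (plusPeriod f : ℂ) →
      ∃ s : ℕ, ¬ p ∣ s ∧ IsIntegral ℤ ((s : ℂ) * ϖ * r)

/-- F″'s ODD clause AT A GIVEN CURVE `W_K`: `ϖ Ω⁻(W_K) = Ω_f⁻`, `E_N(χ)·Σ_a χ(a){∞,a/m}_f = r Ω_f⁻ i` ⟹ `ϖ r` is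
`p`-integral. -/
def MemberOddClause (W_K : WeierstrassCurve ℚ) [W_K.IsElliptic] {N : ℕ} [NeZero N]
    (f : CuspForm (Gamma0 N) 2) (p : ℕ) [Fact p.Prime] : Prop :=
  ∀ (m : ℕ) [NeZero m], m.Coprime (p * N) →
    (7 < p ∨ (Nat.Coprime (orderOf (p : ZMod m)) (p - 1) ∧
      ∀ P : (W_K.baseChange ℚ_[p]).toAffine.Point, p • P = 0 → P = 0)) →
    ∀ (χ : DirichletCharacter ℂ m), χ.IsPrimitive → χ ≠ 1 → ¬ p ∣ orderOf χ →
    ∀ (ϖ : ℚ) (r : ℂ), χ.Odd → (ϖ : ℝ) * W_K.imaginaryPeriodRat = minusPeriod f →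
      (∏ ℓ ∈ N.primeFactors with ¬ ℓ ^ 2 ∣ N,
          (((ℓ : ℂ) - (W_K.LFunction ℓ : ℂ) * χ (ℓ : ZMod m)) *
            ((ℓ : ℂ) - (W_K.LFunction ℓ : ℂ) * (χ (ℓ : ZMod m))⁻¹))) * twistedSymbolSum f χ =
        r * (minusPeriod f : ℂ) * Complex.I →
      ∃ s : ℕ, ¬ p ∣ s ∧ IsIntegral ℤ ((s : ℂ) * ϖ * r)

/-- **F″ AT THE MEMBER, `(ϖ, r)` currency, IRREDUCIBILITY-FREE** (rev 3: the two clauses bundled per `(W, p)`;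
hypotheses — newform, additive at `p` — at the GIVEN curve `W`, receptacle clause and periods at the member `W′`).
[cite: Kato2004Asterisque, (8.1.3) (p. 180), §8.3 (p. 181), Thm. 6.6 (1) (p. 163)] [cite: MazurTateTeitelbaum1986, §I.8 (8.6)] -/
def KatoNeronMemberTwistedValues : Prop :=
  ∀ (W : WeierstrassCurve ℚ) [W.IsElliptic] (p : ℕ) [Fact p.Prime],
    ∃ (W' : WeierstrassCurve ℚ) (_ : W'.IsElliptic) (_ : W'.IsGloballyMinimal), IsIsogenous W W' ∧
      ∀ {N : ℕ} [NeZero N] (f : CuspForm (Gamma0 N) 2), IsNewformOf W f → 5 ≤ p →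
        ¬ W.HasGoodReductionAtPrime p → ¬ W.HasMultiplicativeReductionAtPrime p →
        MemberEvenClause W' f p ∧ MemberOddClause W' f p

set_option backward.isDefEq.respectTransparency false in
/-- ★ **P-1, M piece, step 1: H″ ⟹ F″ at the member in NIV currency, Irr-free.** The proof of
`KatoCarayolFree.memberValueLaw_of_integralSL2NeronValues` with its (unused) irreducibility binders deleted, the
additive reduction moved to the member by `X2.addv_iff_of_isIsogenous` (Serre–Tate, Irr-free), then the unit-choice
descent `depletedValueIntegral_of_memberValueLaw`. [cite: Kato2004Asterisque, (8.1.3) (p. 180), Thm. 13.6 (p. 227)]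
[cite: CasselsFrohlichANT1967, Ch. II §10 Theorem (10.2)] -/
theorem katoNeronMemberDepletedValues_of_memberSL2NeronValueLaw (H : MemberSL2NeronValueLaw) :
    KatoNeronMemberDepletedValues := by
  intro V _ p _
  obtain ⟨W', hW'E, hW'M, hiso, hW'⟩ := H V p
  letI : ContinuousSMul ℤ_[p] (W'.tateModule p) := TateModule.continuousSMul_padicInt
  haveI : Module.Free ℤ_[p] (W'.tateModule p) := W'.module_free_tateModule_holds p
  haveI : Module.Finite ℤ_[p] (W'.tateModule p) := W'.module_finite_tateModule_holds p
  refine ⟨W', hW'E, hW'M, hiso, ?_⟩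
  intro N _ f hf hp5 hgood hmult m _ hm htorsW χ hχ hχ1 hord L₀ hL₀
  obtain ⟨n, hn, hlevel⟩ := hW' f hf
  obtain ⟨ι, Λ, Ψ, hΨ, hint, hval⟩ := hlevel m
  have haddW : Addv W' p :=
    (Summit.BirchSwinnertonDyer.Rank1Residual.X2.addv_iff_of_isIsogenous (p := p) hiso).mp ⟨hgood, hmult⟩
  have hint' := hint hp5 haddW.1 haddW.2 hm htorsW
  have hp2 : p ≠ 2 := by omega
  refine depletedValueIntegral_of_memberValueLaw W' f hm χ hχ1 hord (fun L hL c d hc hd ↦ ?_) L₀ hL₀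
  obtain ⟨-, hcN, -, -, hccop, -, -⟩ := hc
  obtain ⟨-, hdN, -, -, hdcop, -, -⟩ := hd
  have hcZ : (c : ℤ) ≡ 1 [ZMOD (N : ℤ)] := intModEq_one_of_natModEq_one hcN
  have hdZ : (d : ℤ) ≡ 1 [ZMOD (N : ℤ)] := intModEq_one_of_natModEq_one hdN
  have hgcd : Int.gcd ((c : ℤ) * (d : ℤ)) (6 * (p : ℤ) * (m : ℤ)) = 1 := int_gcd_mul_eq_one_of_coprime hccop hdcop
  by_cases hev : χ.Even
  · obtain ⟨ξ, hnξ0, hnξv⟩ := hn hp2 true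
    obtain ⟨z, x, hΛz, hlaw⟩ := hval (c : ℤ) (d : ℤ) ξ hcZ hdZ hgcd
    obtain ⟨hlawE, -⟩ := hlaw χ⁻¹ L hL
    have hE : χ⁻¹ (-1) = 1 := (inv_apply_neg_one_eq_one_iff χ).2 hev
    have hlawE' := hlawE hE
    refine ⟨n ξ true, charSum m ι χ⁻¹ x, χ⁻¹ (c : ZMod m), χ (d : ZMod m),
      not_dvd_num_of_padicValRat_eq_zero hnξ0 hnξv,
      exists_not_dvd_isIntegral_charSum_of_forall_semilocal_mem m p Ψ hΨ x (Λ z) hΛz (hint' z) ι χ⁻¹,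
      Or.inr rfl, Or.inl rfl, fun _ ↦ ?_, fun hod ↦ ?_⟩
    · rw [hlawE', katoFactor_inv_reading]
      push_cast
      ring
    · exfalso
      have h1 : χ (-1) = 1 := hev
      have h2 : χ (-1) = -1 := hod
      rw [h1] at h2
      norm_num at h2
  · obtain ⟨ξ, hnξ0, hnξv⟩ := hn hp2 false
    obtain ⟨z, x, hΛz, hlaw⟩ := hval (c : ℤ) (d : ℤ) ξ hcZ hdZ hgcd
    obtain ⟨-, hlawO⟩ := hlaw χ⁻¹ L hL
    refine ⟨n ξ false, charSum m ι χ⁻¹ x, χ⁻¹ (c : ZMod m), χ (d : ZMod m),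
      not_dvd_num_of_padicValRat_eq_zero hnξ0 hnξv,
      exists_not_dvd_isIntegral_charSum_of_forall_semilocal_mem m p Ψ hΨ x (Λ z) hΛz (hint' z) ι χ⁻¹,
      Or.inr rfl, Or.inl rfl, fun hev' ↦ absurd hev' hev, fun hod ↦ ?_⟩
    have hO : χ⁻¹ (-1) = -1 := (inv_apply_neg_one_eq_neg_one_iff χ).2 hod
    rw [hlawO hO, katoFactor_inv_reading]
    push_cast
    ring

/-- ★ **P-1, M piece, step 2: NIV at the member ⟹ F″'s two `(ϖ, r)` clauses at the member, Irr-free.** The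
Carayol-free value exit (`katoNeron_{even,odd}_of_depletedValue`, level facts `p ∣ N`, `a_ℓ = 0 (ℓ² ∣ N)` from the
Fourier coefficients of the newform, now of the MEMBER: `IsNewformOf.of_isIsogenous`).
[cite: Kato2004Asterisque, Thm. 6.6 (1) (p. 163)] [cite: MazurTateTeitelbaum1986, §I.8 (8.6)] [cite: AtkinLehner1970, Thm. 3] -/
theorem katoNeronMemberTwistedValues_of_memberDepletedValues (H : KatoNeronMemberDepletedValues) :
    KatoNeronMemberTwistedValues := by
  intro V _ p _
  obtain ⟨W', hW'E, hW'M, hiso, hW'⟩ := H V p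
  refine ⟨W', hW'E, hW'M, hiso, ?_⟩
  intro N _ f hf hp5 hgood hmult
  -- the member's newform is `f`; additive at `p` transports (Serre–Tate)
  have hfW : IsNewformOf W' f := hf.of_isIsogenous hiso.symm_of_charZero
  have haddW : Addv W' p :=
    (Summit.BirchSwinnertonDyer.Rank1Residual.X2.addv_iff_of_isIsogenous (p := p) hiso).mp ⟨hgood, hmult⟩
  have hpN : p ∣ N := KatoCarayolFree.dvd_level_of_isNewformOf_of_not_good_of_not_mult W' hfW haddW.1 haddW.2
  have hsq := KatoCarayolFree.forall_lFunction_eq_zero_of_sq_dvd_level W' hfW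
  refine ⟨fun m _ hm htorsW χ hχ hχ1 hord ϖ r hev hϖ hr ↦ ?_, fun m _ hm htorsW χ hχ hχ1 hord ϖ r hod hϖ hr ↦ ?_⟩
  · have hNIV := hW' f hf hp5 hgood hmult m hm htorsW χ hχ hχ1 hord
    haveI : NeZero (m * (p * N)) :=
      ⟨mul_ne_zero (NeZero.ne m) (mul_ne_zero (Fact.out : p.Prime).ne_zero (NeZero.ne N))⟩
    obtain ⟨L, hLd, hLs⟩ := exists_differentiable_eq_twistedLSeries_holds f
      (DirichletCharacter.changeLevel (dvd_mul_right m (p * N)) χ⁻¹)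
    have hL : IsDepletedTwistedL f m (p * N) χ⁻¹ L := ⟨hLd, hLs⟩
    exact katoNeron_even_of_depletedValue W' hfW hpN hsq hm hχ hL ((hNIV L hL).1 hev) hϖ hr
  · have hNIV := hW' f hf hp5 hgood hmult m hm htorsW χ hχ hχ1 hord
    haveI : NeZero (m * (p * N)) :=
      ⟨mul_ne_zero (NeZero.ne m) (mul_ne_zero (Fact.out : p.Prime).ne_zero (NeZero.ne N))⟩
    obtain ⟨L, hLd, hLs⟩ := exists_differentiable_eq_twistedLSeries_holds f
      (DirichletCharacter.changeLevel (dvd_mul_right m (p * N)) χ⁻¹)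
    have hL : IsDepletedTwistedL f m (p * N) χ⁻¹ L := ⟨hLd, hLs⟩
    exact katoNeron_odd_of_depletedValue W' hfW hpN hsq hm hχ hL ((hNIV L hL).2 hod) hϖ hr

/-- ★ **P-1 assembled: `hT₂ → hP → hDR → hP1 →` F″ at the member (both parities), Irr-free.** -/
theorem katoNeronMemberTwistedValues_of_sl2NeronValues
    (hT₂ : Literature.NumberTheory.PAdicHodge.exists_smul_range_expStarCoord_tower_iff_trace_log)
    (hP : Literature.NumberTheory.PAdicHodge.cupLogInjective_and_hasDualExp_of_isDeRham)
    (hDR : Literature.NumberTheory.PAdicHodge.isDeRham_restrictedRationalTateRep)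
    (hP1 : exists_member_sl2ZetaElement_neron_values) : KatoNeronMemberTwistedValues :=
  katoNeronMemberTwistedValues_of_memberDepletedValues
    (katoNeronMemberDepletedValues_of_memberSL2NeronValueLaw
      (memberNeronIntegrality_of_sl2NeronValues hT₂ hP hDR hP1))

/-! ## §2  The two levers (statements) and the kernel target `KatoMemberTwoParity` -/

/-- **ODD LEVER at the member** (bsd-wall's orthogonality/Legendre/splitting machine `pint_im_cuspSymbolL` /
`pint_im_cuspSymbol57`, with `(hK, hirr, hadd)` replaced by the local hypothesis «F″-odd at `W_K`»): the period
scalar `ϖ⁻ = Ω_f⁻/Ω⁻(W_K)` is `p`-integral.  No resonance wall (odd characters dodge `ℓ ≡ ±a_ℓ` by residue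
prescriptions).  [cite: Manin1972, Prop. 1.4 / Thm. 1.6] [cite: MazurTateTeitelbaum1986, §I.8 (8.6)] -/
def OddMemberLever : Prop :=
  ∀ (W W_K : WeierstrassCurve ℚ) [W.IsElliptic] [W_K.IsElliptic] [W_K.IsGloballyMinimal]
    {N : ℕ} [NeZero N] (f : CuspForm (Gamma0 N) 2) (p : ℕ) [Fact p.Prime],
    IsNewformOf W f → IsIsogenous W W_K → 5 ≤ p → p ^ 2 ∣ N →
    (p ≤ 7 → ∀ P : (W_K.baseChange ℚ_[p]).toAffine.Point, p • P = 0 → P = 0) →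
    MemberOddClause W_K f p →
    ∀ ϖ : ℚ, (ϖ : ℝ) * W_K.imaginaryPeriodRat = minusPeriod f → 0 ≤ padicValRat p ϖ

/-- **EVEN LEVER at the member (P-3, the new parity).**  Inputs: F″-even at `W_K` on admissible auxiliary primes;
the Eisenstein congruence (E0) and one non-anomalous prime (E1); the even non-resonance wall.  Mechanism
(`Lines/two-parity-member-even.md`): even orthogonality + Hecke `T_{d′}{∞,0} = a_{d′}{∞,0}` give
`(d′−1)·re{∞,γ∞} + (1+d′−a_{d′})·{∞,0} = Σ_{χ even ≠ 1} χ̄(b′)·S_χ`, whose right side is `p`-integral in units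
of `Ω⁺(W_K)/2`; with `m_γ := re{∞,γ∞}/(Ω_f⁺/2) ∈ ℤ`, `t := {∞,0}/(Ω_f⁺/2) ∈ ℤ_(p)` (E1) and `ν(γ) := 1+d′−a_{d′}
mod p` a function of `d_γ mod pM` (E0), `v_p(ϖ⁺) < 0` would force the homomorphism `m̄ : Γ₀(N) → 𝔽_p` to agree
on the admissible class with a function of `d_γ mod F`, `F = lcm(pM, 4·∏ r)`, hence to vanish (the class and the
function are `p′`-determined) — contradicting `gcd(m_γ) = 1`.  Conclusion: `ϖ⁺ = Ω_f⁺/Ω⁺(W_K)` is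
`p`-integral.  [cite: Manin1972, Thm. 1.6] [cite: MazurEisenstein1977, §5] [cite: KatzGaloisTorsion1981, Thm. 2] -/
def EvenMemberLever : Prop :=
  ∀ (W W_K : WeierstrassCurve ℚ) [W.IsElliptic] [W_K.IsElliptic] [W_K.IsGloballyMinimal]
    {N : ℕ} [NeZero N] (f : CuspForm (Gamma0 N) 2) (p : ℕ) [Fact p.Prime],
    IsNewformOf W f → IsIsogenous W W_K → 5 ≤ p → p ^ 2 ∣ N →
    EisensteinCongruence W p N → NonAnomalousPrime W p N → EvenNonResonant W p N →
    (p ≤ 7 → ∀ P : (W_K.baseChange ℚ_[p]).toAffine.Point, p • P = 0 → P = 0) →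
    MemberEvenClause W_K f p →
    ∀ ϖ : ℚ, (ϖ : ℝ) * W_K.realPeriodRat = plusPeriod f → 0 ≤ padicValRat p ϖ

/-- **EVEN LEVER, transfer form (rev 8)** — `EvenMemberLever` with (E0) `EisensteinCongruence` replaced by the weaker
(E0-T) `EisensteinCongruenceT` (congruence at the primes `q > N'` for a character of modulus `M ∣ N'`, `N ∣ N'`, plus
the `p′`-transfer `Γ₀(N) ⇝ Γ₀(N')`).  PROVED (`evenMemberLeverT_holds`); implies `EvenMemberLever`
(`evenMemberLever_of_evenMemberLeverT`). -/
def EvenMemberLeverT : Prop :=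
  ∀ (W W_K : WeierstrassCurve ℚ) [W.IsElliptic] [W_K.IsElliptic] [W_K.IsGloballyMinimal]
    {N : ℕ} [NeZero N] (f : CuspForm (Gamma0 N) 2) (p : ℕ) [Fact p.Prime],
    IsNewformOf W f → IsIsogenous W W_K → 5 ≤ p → p ^ 2 ∣ N →
    EisensteinCongruenceT W p N → NonAnomalousPrime W p N → EvenNonResonant W p N →
    (p ≤ 7 → ∀ P : (W_K.baseChange ℚ_[p]).toAffine.Point, p • P = 0 → P = 0) →
    MemberEvenClause W_K f p →
    ∀ ϖ : ℚ, (ϖ : ℝ) * W_K.realPeriodRat = plusPeriod f → 0 ≤ padicValRat p ϖ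


/-- **Kernel target of the lever (two parities at one member), rev 3 — valuation form.**  For `W` additive at
`p ≥ 5`, `p² ∣ N`, `W[p]` REDUCIBLE, with the member receptacle: some globally minimal member `W_K` has
`p`-integral odd period scalar `Ω_f⁻/Ω⁻(W_K)`, and — off the even wall — `p`-integral even scalar `Ω_f⁺/Ω⁺(W_K)`.
(Rev 2's symbol-level `Odd/EvenMemberIntegrality` follow: `re{∞,γ∞} ∈ ℤ·Ω_f⁺/2`, `im{∞,γ∞} ∈ ℤ·Ω_f⁻/2`.) -/
def KatoMemberTwoParity : Prop :=
  ∀ (W : WeierstrassCurve ℚ) [W.IsElliptic] [W.IsGloballyMinimal] {N : ℕ} [NeZero N]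
    (f : CuspForm (Gamma0 N) 2) (_ : IsNewformOf W f) (p : ℕ) [Fact p.Prime],
    5 ≤ p → p ^ 2 ∣ N → ¬ W.HasGoodReductionAtPrime p → ¬ W.HasMultiplicativeReductionAtPrime p →
    ¬ W.HasIrreducibleModPGaloisRep p → MemberReceptacle W p →
    ∃ (W_K : WeierstrassCurve ℚ) (_ : W_K.IsElliptic) (_ : W_K.IsGloballyMinimal),
      WeierstrassCurve.IsIsogenous W W_K ∧
        (∀ ϖ : ℚ, (ϖ : ℝ) * W_K.imaginaryPeriodRat = minusPeriod f → 0 ≤ padicValRat p ϖ) ∧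
        (EvenNonResonant W p N →
          ∀ ϖ : ℚ, (ϖ : ℝ) * W_K.realPeriodRat = plusPeriod f → 0 ≤ padicValRat p ϖ)

/-! ## §3  P-2: the cyclic-kernel period dichotomy (PROVED) -/

/-- **Cyclic-kernel period dichotomy (pure lattice algebra, `p` odd).**  If `z ↦ αz` maps the Néron lattice
of `W` into that of `W'` (a `ℚ`-isogeny) and is `p`-PRIMITIVE (`(α/p)Λ_W ⊄ Λ_{W'}`, i.e. the `p`-part of
the kernel is cyclic), then for at least ONE parity `s` the `s`-generator of `Λ_W` maps to a `p`-indivisible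
multiple of the `s`-generator of `Λ_{W'}`: `Ω^s(W)/Ω^s(W')` is a rational number of `p`-valuation
`−v_p(α) ≤ 0`. -/
def CyclicKernelPeriodDichotomy : Prop :=
  ∀ (W W' : WeierstrassCurve ℚ) [W.IsElliptic] [W.IsGloballyMinimal] [W'.IsElliptic]
    [W'.IsGloballyMinimal] (L L' : PeriodPair) (p : ℕ) [Fact p.Prime] (α : ℤ),
    IsNeronLatticeOf (W.baseChange ℂ) L → IsNeronLatticeOf (W'.baseChange ℂ) L' → p ≠ 2 →
    (∀ z ∈ L.lattice, (α : ℂ) * z ∈ L'.lattice) →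
    (∃ z ∈ L.lattice, ((α : ℂ) / p) * z ∉ L'.lattice) →
    (∃ q : ℚ, q ≠ 0 ∧ padicValRat p q ≤ 0 ∧ (q : ℝ) * W'.realPeriodRat = W.realPeriodRat) ∨
      (∃ q : ℚ, q ≠ 0 ∧ padicValRat p q ≤ 0 ∧ (q : ℝ) * W'.imaginaryPeriodRat = W.imaginaryPeriodRat)

section Dichotomy

open Complex

/-- `g₂` of a Néron lattice of `W ⊗ ℂ` is the real number `c₄(W ⊗ ℝ)/12`. -/
theorem g₂_eq_ofReal_of_isNeronLatticeOf {W : WeierstrassCurve ℚ} {L : PeriodPair}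
    (hL : IsNeronLatticeOf (W.baseChange ℂ) L) :
    L.g₂ = (((W.baseChange ℝ).c₄ / 12 : ℝ) : ℂ) := by
  rw [hL.1, WeierstrassCurve.baseChange, WeierstrassCurve.baseChange, WeierstrassCurve.map_c₄,
    WeierstrassCurve.map_c₄, eq_ratCast, eq_ratCast]
  push_cast
  ring

/-- `g₃` of a Néron lattice of `W ⊗ ℂ` is the real number `c₆(W ⊗ ℝ)/216`. -/
theorem g₃_eq_ofReal_of_isNeronLatticeOf {W : WeierstrassCurve ℚ} {L : PeriodPair}
    (hL : IsNeronLatticeOf (W.baseChange ℂ) L) :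
    L.g₃ = (((W.baseChange ℝ).c₆ / 216 : ℝ) : ℂ) := by
  rw [hL.2, WeierstrassCurve.baseChange, WeierstrassCurve.baseChange, WeierstrassCurve.map_c₆,
    WeierstrassCurve.map_c₆, eq_ratCast, eq_ratCast]
  push_cast
  ring

/-- `i·Ω₀(iΛ) ∈ Λ`: the least positive real period of the rotated lattice gives an imaginary period. -/
theorem I_mul_minRealPeriod_mulLeft_I_mem {L : PeriodPair} (h : L.IsReal) :
    I * ((L.mulLeft I I_ne_zero).minRealPeriod : ℂ) ∈ L.lattice := by
  have := h.mulLeft_I.minRealPeriod_mem_lattice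
  rwa [PeriodPair.mem_mulLeft_lattice, Complex.inv_I, neg_mul, neg_mem_iff] at this

/-- **Half-lattice generation.** For a real lattice `Λ` with real generator `Ω₀` and imaginary generator
`iΩ₀⁻`, every `z ∈ Λ` has `2z ∈ ℤΩ₀ + ℤ iΩ₀⁻`; hence if `βΩ₀, β·iΩ₀⁻ ∈ Λ'` and `p·βΛ ⊆ Λ'` with `p` odd,
then `βΛ ⊆ Λ'`. -/
theorem mul_mem_of_generators {L L' : PeriodPair} (hR : L.IsReal) {p : ℕ} (hp : Odd p) {β : ℂ}
    (hw : β * (L.minRealPeriod : ℂ) ∈ L'.lattice)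
    (hm : β * (I * ((L.mulLeft I I_ne_zero).minRealPeriod : ℂ)) ∈ L'.lattice)
    (hpz : ∀ z ∈ L.lattice, (p : ℂ) * (β * z) ∈ L'.lattice) :
    ∀ z ∈ L.lattice, β * z ∈ L'.lattice := by
  intro z hz
  -- `z + conj z = 2 re z ∈ Λ ∩ ℝ = ℤΩ₀`
  have hre : (((2 * z.re : ℝ)) : ℂ) ∈ L.lattice := by
    rw [← Complex.add_conj]
    exact add_mem hz (hR z hz)
  obtain ⟨k, hk⟩ := hR.exists_eq_int_mul hre
  -- `z - conj z = i · 2 im z ∈ Λ`, i.e. `2 im z` is a real period of `iΛ`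
  have him : (((2 * z.im : ℝ)) : ℂ) ∈ (L.mulLeft I I_ne_zero).lattice := by
    rw [PeriodPair.mem_mulLeft_lattice, Complex.inv_I, neg_mul, neg_mem_iff]
    have e : I * ((2 * z.im : ℝ) : ℂ) = z - starRingEnd ℂ z := by
      rw [Complex.sub_conj]; ring
    rw [e]
    exact sub_mem hz (hR z hz)
  obtain ⟨j, hj⟩ := hR.mulLeft_I.exists_eq_int_mul him
  -- `2z = k Ω₀ + j · iΩ₀⁻`
  have h2z : (2 : ℂ) * z = (k : ℂ) * (L.minRealPeriod : ℂ) +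
      (j : ℂ) * (I * ((L.mulLeft I I_ne_zero).minRealPeriod : ℂ)) := by
    have e : (2 : ℂ) * z = ((2 * z.re : ℝ) : ℂ) + ((2 * z.im : ℝ) : ℂ) * I := by
      rw [← Complex.add_conj, ← Complex.sub_conj]; ring
    rw [e, hk, hj]
    push_cast
    ring
  have h2 : β * ((2 : ℂ) * z) ∈ L'.lattice := by
    rw [h2z, mul_add,
      show β * ((k : ℂ) * (L.minRealPeriod : ℂ)) = (k : ℤ) • (β * (L.minRealPeriod : ℂ)) by
        rw [zsmul_eq_mul]; ring,
      show β * ((j : ℂ) * (I * ((L.mulLeft I I_ne_zero).minRealPeriod : ℂ))) =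
        (j : ℤ) • (β * (I * ((L.mulLeft I I_ne_zero).minRealPeriod : ℂ))) by
        rw [zsmul_eq_mul]; ring]
    exact add_mem (zsmul_mem hw k) (zsmul_mem hm j)
  obtain ⟨t, ht⟩ := hp
  have e : β * z = (p : ℂ) * (β * z) - (t : ℤ) • (β * ((2 : ℂ) * z)) := by
    rw [ht, zsmul_eq_mul]; push_cast; ring
  rw [e]
  exact sub_mem (hpz z hz) (zsmul_mem h2 (t : ℤ))

/-- `#π₀(E(ℝ)) ∈ {1, 2}`. -/
theorem numRealComponents_eq_one_or_two (V : WeierstrassCurve ℝ) :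
    V.numRealComponents = 1 ∨ V.numRealComponents = 2 := by
  rcases lt_or_ge 0 V.Δ with h | h
  · exact Or.inr (V.numRealComponents_of_Δ_pos h)
  · exact Or.inl (V.numRealComponents_of_Δ_nonpos h)

/-- `v_p(u/v) ≤ 0` for integers `u, v` with `p ∤ u`, `v ≠ 0`. -/
theorem padicValRat_intCast_div_le_zero {p : ℕ} [Fact p.Prime] {u v : ℤ} (hu : ¬ (p : ℤ) ∣ u)
    (hv : v ≠ 0) : padicValRat p ((u : ℚ) / v) ≤ 0 := by
  have hu0 : u ≠ 0 := by rintro rfl; exact hu (dvd_zero _)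
  rw [padicValRat.div (by exact_mod_cast hu0) (by exact_mod_cast hv), padicValRat.of_int,
    padicValRat.of_int, padicValInt.eq_zero_of_not_dvd hu]
  simp

/-- ★ **P-2 (V#21h), PROVED: the cyclic-kernel period dichotomy.**  The two generators `Ω₀ ∈ Λ ∩ ℝ` and
`iΩ₀⁻ ∈ Λ ∩ iℝ` satisfy `2Λ ⊆ ℤΩ₀ ⊕ ℤ iΩ₀⁻`; if `(α/p)Ω₀ ∈ Λ'` and `(α/p)iΩ₀⁻ ∈ Λ'` then `(α/p)·2Λ ⊆ Λ'` and
`(α/p)·pΛ = αΛ ⊆ Λ'`, so `(α/p)Λ ⊆ Λ'` (`p` odd) — contradicting primitivity.  Hence for one parity `s`,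
`αΩ^s_0 = a·Ω'^s_0` with `p ∤ a`, and `Ω^s(W) = q Ω^s(W')` with `q = (n a)/(n' α)` (`n, n' ∈ {1,2}` the component
counts; imaginary parity has no component factor), `v_p(q) ≤ 0`. -/
theorem cyclicKernelPeriodDichotomy_holds : CyclicKernelPeriodDichotomy := by
  intro W W' _ _ _ _ L L' p _ α hL hL' hp2 hαL hprim
  obtain ⟨z₀, hz₀, hz₀'⟩ := hprim
  have hpP : p.Prime := Fact.out
  have hpodd : Odd p := hpP.eq_two_or_odd'.resolve_left hp2
  have hpZ : Prime (p : ℤ) := Nat.prime_iff_prime_int.mp hpP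
  have hpC : (p : ℂ) ≠ 0 := by exact_mod_cast hpP.ne_zero
  -- real structures of the two Néron lattices
  have h₂ := g₂_eq_ofReal_of_isNeronLatticeOf hL
  have h₃ := g₃_eq_ofReal_of_isNeronLatticeOf hL
  have h₂' := g₂_eq_ofReal_of_isNeronLatticeOf hL'
  have h₃' := g₃_eq_ofReal_of_isNeronLatticeOf hL'
  have hR : L.IsReal := (W.baseChange ℝ).isReal_of_g₂_eq_of_g₃_eq h₂ h₃
  have hR' : L'.IsReal := (W'.baseChange ℝ).isReal_of_g₂_eq_of_g₃_eq h₂' h₃'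
  haveI : (W.baseChange ℝ).IsElliptic := by rw [WeierstrassCurve.baseChange]; infer_instance
  haveI : (W'.baseChange ℝ).IsElliptic := by rw [WeierstrassCurve.baseChange]; infer_instance
  -- generators: `Ω₀, Ω₀'` (real) and `Ω₀⁻, Ω₀⁻'` (imaginary)
  set w : ℝ := L.minRealPeriod with hwdef
  set w' : ℝ := L'.minRealPeriod with hw'def
  set v : ℝ := (L.mulLeft I I_ne_zero).minRealPeriod with hvdef
  set v' : ℝ := (L'.mulLeft I I_ne_zero).minRealPeriod with hv'def
  have hw : (w : ℂ) ∈ L.lattice := hR.minRealPeriod_mem_lattice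
  have hIv : I * (v : ℂ) ∈ L.lattice := I_mul_minRealPeriod_mulLeft_I_mem hR
  have hw' : (w' : ℂ) ∈ L'.lattice := hR'.minRealPeriod_mem_lattice
  have hIv' : I * (v' : ℂ) ∈ L'.lattice := I_mul_minRealPeriod_mulLeft_I_mem hR'
  have hwpos : 0 < w := hR.minRealPeriod_pos
  have hw'pos : 0 < w' := hR'.minRealPeriod_pos
  have hvpos : 0 < v := hR.mulLeft_I.minRealPeriod_pos
  have hv'pos : 0 < v' := hR'.mulLeft_I.minRealPeriod_pos
  -- the periods of the curves
  have hΩ : W.realPeriodRat = (W.baseChange ℝ).numRealComponents * w := by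
    rw [WeierstrassCurve.realPeriodRat_def]
    exact (W.baseChange ℝ).realPeriod_eq_numRealComponents_mul_minRealPeriod h₂ h₃
  have hΩ' : W'.realPeriodRat = (W'.baseChange ℝ).numRealComponents * w' := by
    rw [WeierstrassCurve.realPeriodRat_def]
    exact (W'.baseChange ℝ).realPeriod_eq_numRealComponents_mul_minRealPeriod h₂' h₃'
  have hΩv : W.imaginaryPeriodRat = v := by
    rw [WeierstrassCurve.imaginaryPeriodRat_def]
    exact (W.baseChange ℝ).imaginaryPeriod_eq h₂ h₃
  have hΩv' : W'.imaginaryPeriodRat = v' := by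
    rw [WeierstrassCurve.imaginaryPeriodRat_def]
    exact (W'.baseChange ℝ).imaginaryPeriod_eq h₂' h₃'
  -- `α ≠ 0`
  have hα0 : α ≠ 0 := by
    rintro rfl
    apply hz₀'
    simp
  -- THE DICHOTOMY: `(α/p)Ω₀ ∈ Λ'` and `(α/p)·iΩ₀⁻ ∈ Λ'` cannot both hold (else `(α/p)Λ ⊆ Λ'`, `p` odd)
  have key : ¬ (((α : ℂ) / p) * (w : ℂ) ∈ L'.lattice ∧ ((α : ℂ) / p) * (I * (v : ℂ)) ∈ L'.lattice) := by
    rintro ⟨h1, h2⟩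
    refine hz₀' (mul_mem_of_generators hR hpodd h1 h2 (fun z hz ↦ ?_) z₀ hz₀)
    have e : (p : ℂ) * ((α : ℂ) / p * z) = (α : ℂ) * z := by field_simp
    rw [e]
    exact hαL z hz
  rw [not_and_or] at key
  rcases key with hcase | hcase
  · -- REAL branch: `αΩ₀ = aΩ₀'` with `p ∤ a`
    left
    have hαw : (((α : ℝ) * w : ℝ) : ℂ) ∈ L'.lattice := by
      push_cast
      exact hαL _ hw
    obtain ⟨a, ha⟩ := hR'.exists_eq_int_mul hαw
    have hpa : ¬ (p : ℤ) ∣ a := by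
      rintro ⟨a', rfl⟩
      apply hcase
      have e : (α : ℂ) / p * (w : ℂ) = (a' : ℤ) • (w' : ℂ) := by
        rw [zsmul_eq_mul]
        field_simp
        have := congrArg (fun x : ℝ ↦ (x : ℂ)) ha
        push_cast at this
        linear_combination this
      rw [e]
      exact zsmul_mem hw' a'
    have ha0 : a ≠ 0 := by
      rintro rfl
      simp only [Int.cast_zero, zero_mul, mul_eq_zero, Int.cast_eq_zero] at ha
      rcases ha with h | h
      · exact hα0 h
      · exact hwpos.ne' h
    obtain ⟨n, hn⟩ : ∃ n : ℕ, (W.baseChange ℝ).numRealComponents = n := ⟨_, rfl⟩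
    obtain ⟨n', hn'⟩ : ∃ n' : ℕ, (W'.baseChange ℝ).numRealComponents = n' := ⟨_, rfl⟩
    have hn12 : n = 1 ∨ n = 2 := hn ▸ numRealComponents_eq_one_or_two _
    have hn'12 : n' = 1 ∨ n' = 2 := hn' ▸ numRealComponents_eq_one_or_two _
    have hn0 : (n : ℤ) ≠ 0 := by rcases hn12 with rfl | rfl <;> norm_num
    have hn'0 : (n' : ℤ) ≠ 0 := by rcases hn'12 with rfl | rfl <;> norm_num
    have hpn : ¬ (p : ℤ) ∣ n := by
      rcases hn12 with rfl | rfl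
      · exact_mod_cast hpP.not_dvd_one
      · intro h
        have : (p : ℤ) ∣ ((2 : ℕ) : ℤ) := by exact_mod_cast h
        have h2 : p ∣ 2 := by exact_mod_cast this
        exact hp2 ((Nat.prime_dvd_prime_iff_eq hpP Nat.prime_two).mp h2)
    refine ⟨((n * a : ℤ) : ℚ) / ((n' * α : ℤ) : ℚ), ?_, ?_, ?_⟩
    · exact div_ne_zero (by exact_mod_cast mul_ne_zero hn0 ha0) (by exact_mod_cast mul_ne_zero hn'0 hα0)
    · refine padicValRat_intCast_div_le_zero ?_ (mul_ne_zero hn'0 hα0)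
      intro h
      rcases hpZ.dvd_mul.mp h with h | h
      · exact hpn h
      · exact hpa h
    · rw [hΩ, hΩ', hn, hn']
      have hαR : (α : ℝ) ≠ 0 := by exact_mod_cast hα0
      have hn'R : (n' : ℝ) ≠ 0 := by exact_mod_cast hn'0
      push_cast
      field_simp
      linear_combination (-(n : ℝ)) * ha
  · -- IMAGINARY branch: `α·iΩ₀⁻ = b·iΩ₀⁻'` with `p ∤ b`
    right
    have hαv : (((α : ℝ) * v : ℝ) : ℂ) ∈ (L'.mulLeft I I_ne_zero).lattice := by
      rw [PeriodPair.mem_mulLeft_lattice, Complex.inv_I, neg_mul, neg_mem_iff]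
      have e : I * (((α : ℝ) * v : ℝ) : ℂ) = (α : ℂ) * (I * (v : ℂ)) := by push_cast; ring
      rw [e]
      exact hαL _ hIv
    obtain ⟨b, hb⟩ := hR'.mulLeft_I.exists_eq_int_mul hαv
    have hpb : ¬ (p : ℤ) ∣ b := by
      rintro ⟨b', rfl⟩
      apply hcase
      have e : (α : ℂ) / p * (I * (v : ℂ)) = (b' : ℤ) • (I * (v' : ℂ)) := by
        rw [zsmul_eq_mul]
        field_simp
        have := congrArg (fun x : ℝ ↦ (x : ℂ)) hb
        push_cast at this
        linear_combination this
      rw [e]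
      exact zsmul_mem hIv' b'
    have hb0 : b ≠ 0 := by
      rintro rfl
      simp only [Int.cast_zero, zero_mul, mul_eq_zero, Int.cast_eq_zero] at hb
      rcases hb with h | h
      · exact hα0 h
      · exact hvpos.ne' h
    refine ⟨((b : ℤ) : ℚ) / ((α : ℤ) : ℚ), ?_, ?_, ?_⟩
    · exact div_ne_zero (by exact_mod_cast hb0) (by exact_mod_cast hα0)
    · exact padicValRat_intCast_div_le_zero hpb hα0
    · rw [hΩv, hΩv']
      have hαR : (α : ℝ) ≠ 0 := by exact_mod_cast hα0
      push_cast
      field_simp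
      linear_combination -hb

end Dichotomy

/-! ## §4  The statement reached, and the assembly (PROVED) -/

/-- **What the lever reaches: R off its two walls, row-free.**  `EisensteinAdditiveManinResidual`'s
conclusion `p ∤ c(D)` for EVERY additive `p ≥ 5` with `p² ∣ N` and `W[p]` reducible at a lattice-optimal
`X₀(N)`-datum, under the member receptacle and the even non-resonance wall — no row list, no four cites,
no orientation, no unit twist. -/
def ResidualOffWalls : Prop :=
  ∀ (W : WeierstrassCurve ℚ) [W.IsElliptic] [W.IsGloballyMinimal] {N : ℕ} [NeZero N]
    (D : ModularParametrizationData W N) (p : ℕ) [Fact p.Prime],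
    5 ≤ p → p ^ 2 ∣ N → ¬ W.HasGoodReductionAtPrime p → ¬ W.HasMultiplicativeReductionAtPrime p →
    ¬ W.HasIrreducibleModPGaloisRep p →
    (∀ z ∈ D.L.lattice, ∃ w ∈ periodLattice D.f, z = D.c * w) →
    MemberReceptacle W p → EvenNonResonant W p N → ¬ (p : ℤ) ∣ D.maninConstant

/-- The assembly (rev 3: now a THEOREM, `assembly_holds`). -/
def Assembly : Prop :=
  KatoMemberTwoParity → CyclicKernelPeriodDichotomy → ResidualOffWalls

section AssemblyProof

/-- **A `p`-primitive INTEGRAL isogeny scalar.**  For `ℚ`-isogenous globally minimal `W, W'` with Néron lattices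
`Λ, Λ'` and a prime `p` there is `α ∈ ℤ` with `αΛ ⊆ Λ'` and `(α/p)Λ ⊄ Λ'`: start from the tree's commensurability
scalar `a ∈ ℤ ∖ 0` (`neronLattice_commensurable_of_isIsogenous_holds`) and divide by `p` as long as the inclusion
survives — every surviving scalar is an INTEGER by Néron integrality (`integral_neronScaling_of_isGloballyMinimal_holds`),
so the process stops after `≤ |a|` steps. [cite: SilvermanATAEC1994, IV.5.1 with IV.6.1 and Cor. IV.9.1]
[cite: SilvermanAEC2009, Thm. VI.4.1(b) and Thm. VI.5.3] -/
theorem exists_primitive_integral_scalar (W W' : WeierstrassCurve ℚ) [W.IsElliptic] [W.IsGloballyMinimal]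
    [W'.IsElliptic] [W'.IsGloballyMinimal] (L L' : PeriodPair) (p : ℕ) [Fact p.Prime]
    (hL : IsNeronLatticeOf (W.baseChange ℂ) L) (hL' : IsNeronLatticeOf (W'.baseChange ℂ) L')
    (hiso : IsIsogenous W W') :
    ∃ α : ℤ, (∀ z ∈ L.lattice, (α : ℂ) * z ∈ L'.lattice) ∧
      (∃ z ∈ L.lattice, ((α : ℂ) / p) * z ∉ L'.lattice) := by
  have hpP : p.Prime := Fact.out
  obtain ⟨a, ha0, haL⟩ := neronLattice_commensurable_of_isIsogenous_holds hiso hL hL'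
  -- `P j`: the scalar `a/p^j` still maps `Λ` into `Λ'`
  let P : ℕ → Prop := fun j ↦ ∀ z ∈ L.lattice, (((a : ℚ) / (p : ℚ) ^ j : ℚ) : ℂ) * z ∈ L'.lattice
  have hP0 : P 0 := fun z hz ↦ by
    have e : (((a : ℚ) / (p : ℚ) ^ 0 : ℚ) : ℂ) = (a : ℂ) := by push_cast; ring
    rw [e]; exact haL z hz
  have hint : ∀ j, P j → ∃ k : ℤ, (k : ℚ) = (a : ℚ) / (p : ℚ) ^ j := fun j hj ↦
    integral_neronScaling_of_isGloballyMinimal_holds W W' L L' hL hL' _ hj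
  have hbound : ∀ j, P j → j ≤ a.natAbs := by
    intro j hj
    obtain ⟨k, hk⟩ := hint j hj
    have hpj : ((p : ℚ) ^ j) ≠ 0 := pow_ne_zero _ (by exact_mod_cast hpP.ne_zero)
    have hka : k * (p : ℤ) ^ j = a := by
      have h := hk
      field_simp at h
      exact_mod_cast h
    have hdvd : (p : ℤ) ^ j ∣ a := ⟨k, by rw [← hka]; ring⟩
    have hle : ((p : ℤ) ^ j).natAbs ≤ a.natAbs := Int.natAbs_le_of_dvd_ne_zero hdvd ha0
    rw [Int.natAbs_pow, Int.natAbs_natCast] at hle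
    exact (Nat.lt_pow_self hpP.one_lt).le.trans hle
  obtain ⟨j₀, hj₀⟩ : ∃ j₀, j₀ = Nat.findGreatest P a.natAbs := ⟨_, rfl⟩
  have hPj₀ : P j₀ := hj₀ ▸ Nat.findGreatest_spec (Nat.zero_le _) hP0
  have hnot : ¬ P (j₀ + 1) := fun h ↦
    Nat.findGreatest_is_greatest (hj₀ ▸ Nat.lt_succ_self j₀) (hbound _ h) h
  obtain ⟨α, hα⟩ := hint j₀ hPj₀
  refine ⟨α, fun z hz ↦ ?_, ?_⟩
  · have h := hPj₀ z hz
    rwa [← hα, Rat.cast_intCast] at h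
  · by_contra hall
    push Not at hall
    refine hnot fun z hz ↦ ?_
    have e : (((a : ℚ) / (p : ℚ) ^ (j₀ + 1) : ℚ) : ℂ) = (α : ℂ) / p := by
      rw [pow_succ, ← div_div, ← hα]
      push_cast
      ring
    rw [e]
    exact hall z hz

/-- ★ **The assembly, PROVED.**  Take Kato's member `W_K` (from `KatoMemberTwoParity`), a Néron lattice `Λ_K`
(`exists_isNeronLatticeOf_holds`), a `p`-primitive integral scalar `αΛ_W ⊆ Λ_K`
(`exists_primitive_integral_scalar`); the dichotomy gives a parity `s` and `q ∈ ℚ` with `q·Ω^s(W_K) = Ω^s(W)`,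
`v_p(q) ≤ 0`; the lattice-optimal datum gives `m·Ω^s(W) = |c|·Ω_f^s` with `m ∣ 2` (`m = 1` for `s = +`);
so `ϖ^s := q m/|c|` has `ϖ^s Ω^s(W_K) = Ω_f^s` and `0 ≤ v_p(ϖ^s) = v_p(q) + v_p(m) − v_p(c) ≤ −v_p(c)`, i.e.
`p ∤ c`. -/
theorem assembly_holds : Assembly := by
  intro hK hD W _ _ N _ D p _ hp5 hpN hgood hmult hred hopt hrec hNR hdiv
  have hpP : p.Prime := Fact.out
  have hp2 : p ≠ 2 := by omega
  have hc0 : D.c ≠ 0 := D.maninConstant_ne_zero_holds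
  have hdivc : (p : ℤ) ∣ D.c := hdiv
  -- `1 ≤ v_p(c)`
  have hvc : 1 ≤ padicValRat p (D.c : ℚ) := by
    rw [padicValRat.of_int]
    have h := (padicValInt_dvd_iff 1 D.c).mp (by rwa [pow_one])
    rcases h with h | h
    · exact absurd h hc0
    · exact_mod_cast h
  have hvabs : padicValRat p (|(D.c : ℚ)|) = padicValRat p (D.c : ℚ) := by
    rcases abs_choice (D.c : ℚ) with h | h
    · rw [h]
    · rw [h, padicValRat.neg]
  have hcQ : (D.c : ℚ) ≠ 0 := by exact_mod_cast hc0
  have habsQ : |(D.c : ℚ)| ≠ 0 := abs_ne_zero.mpr hcQ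
  have habsR : |(D.c : ℝ)| ≠ 0 := abs_ne_zero.mpr (by exact_mod_cast hc0)
  -- Kato's member and the two valuations
  obtain ⟨W_K, hKE, hKM, hiso, hodd, heven⟩ := hK W D.f D.isNewformOf p hp5 hpN hgood hmult hred hrec
  haveI : (W_K.baseChange ℂ).IsElliptic := by rw [WeierstrassCurve.baseChange]; infer_instance
  obtain ⟨L_K, hL_K⟩ := exists_isNeronLatticeOf_holds (W_K.baseChange ℂ)
  obtain ⟨α, hαL, hprim⟩ := exists_primitive_integral_scalar W W_K D.L L_K p D.isNeronLattice hL_K hiso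
  rcases hD W W_K D.L L_K p α D.isNeronLattice hL_K hp2 hαL hprim with
    ⟨q, hq0, hqv, hq⟩ | ⟨q, hq0, hqv, hq⟩
  · -- REAL parity: `Ω(W) = |c|·Ω⁺_f` exactly
    have hΩ : W.realPeriodRat = |(D.c : ℝ)| * plusPeriod D.f :=
      D.realPeriodRat_eq_abs_mul_plusPeriod_of_latticeEq hopt
    have hϖ : ((q / |(D.c : ℚ)| : ℚ) : ℝ) * W_K.realPeriodRat = plusPeriod D.f := by
      push_cast
      rw [div_mul_eq_mul_div, hq, hΩ]
      field_simp
    have hv := heven hNR _ hϖ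
    rw [padicValRat.div hq0 habsQ, hvabs] at hv
    linarith
  · -- IMAGINARY parity: `m·Ω⁻(W) = |c|·Ω⁻_f`, `m ∣ 2`
    obtain ⟨mm, hmm2, hmm⟩ := SkinnerUrban2014.exists_dvd_two_mul_imaginaryPeriodRat_eq_of_latticeEq D hopt
    have hmm0 : mm ≠ 0 := by
      rintro rfl
      exact two_ne_zero (Nat.eq_zero_of_zero_dvd hmm2)
    have hmmQ : (mm : ℚ) ≠ 0 := by exact_mod_cast hmm0
    have hvmm : padicValRat p (mm : ℚ) = 0 := by
      rw [padicValRat.of_nat]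
      have : ¬ p ∣ mm := fun h ↦ by
        have h2 : p ∣ 2 := h.trans hmm2
        have := Nat.le_of_dvd two_pos h2
        omega
      exact_mod_cast padicValNat.eq_zero_of_not_dvd this
    have hϖ : ((q * mm / |(D.c : ℚ)| : ℚ) : ℝ) * W_K.imaginaryPeriodRat = minusPeriod D.f := by
      push_cast
      rw [div_mul_eq_mul_div, mul_right_comm, hq, mul_comm W.imaginaryPeriodRat, hmm]
      field_simp
    have hv := hodd _ hϖ
    rw [padicValRat.div (mul_ne_zero hq0 hmmQ) habsQ, padicValRat.mul hq0 hmmQ, hvmm, hvabs] at hv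
    linarith

/-- **Net reduction of the lever (rev 3): the kernel target alone gives R off its two walls.** -/
theorem residualOffWalls_of_katoMemberTwoParity (hK : KatoMemberTwoParity) : ResidualOffWalls :=
  assembly_holds hK cyclicKernelPeriodDichotomy_holds

end AssemblyProof

open Summit.BirchSwinnertonDyer.BirchSwinnertonDyer.Theorems.ManinFrameResidueProperRTameTwist

/-! ## §5  Even identities: orthogonality over EVEN characters, the trivial character via Hecke at `d′`,
unit Euler factors for odd-order characters, one even character at the member, one admissible `γ` -/

section EvenOrthogonality

variable {d : ℕ} [NeZero d]

/-- **Orthogonality over the EVEN Dirichlet characters modulo `d`**: for a unit `b` and any `a`,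
`2 · Σ_{χ even} χ(b⁻¹) χ(a) = φ(d) 𝟙_{a = b} + φ(d) 𝟙_{a = −b}` (`2·𝟙_even(χ) = 1 + χ(−1)`). [folklore] -/
theorem two_mul_sum_even_char_inv_mul_char (b : ZMod d) (hb : IsUnit b) (a : ZMod d) :
    2 * ∑ χ ∈ (Finset.univ : Finset (DirichletCharacter ℂ d)) with χ.Even, χ b⁻¹ * χ a =
      (if b = a then (d.totient : ℂ) else 0) + (if b = -a then (d.totient : ℂ) else 0) := by
  have hind : ∀ χ : DirichletCharacter ℂ d,
      (2 : ℂ) * (if χ.Even then χ b⁻¹ * χ a else 0) = χ b⁻¹ * χ a + χ b⁻¹ * χ (-a) := by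
    intro χ
    rcases χ.even_or_odd with h | h
    · rw [if_pos h, h.eval_neg]; ring
    · rw [if_neg h.not_even, h.eval_neg]; ring
  rw [Finset.sum_filter, Finset.mul_sum]
  simp_rw [hind]
  rw [Finset.sum_add_distrib, DirichletCharacter.sum_char_inv_mul_char_eq ℂ hb a,
    DirichletCharacter.sum_char_inv_mul_char_eq ℂ hb (-a)]

end EvenOrthogonality

section EvenSymbols

variable {N : ℕ} [NeZero N]

/-- **Even orthogonality applied to the twisted symbol sums**: for a prime `d′`, `b` prime to `d′`, and `f`
with real coefficients, `2 · Σ_{χ even} χ(b)⁻¹ · Σ_a χ(a){∞, a/d′}_f = (d′ − 1) · ({∞, b/d′}_f + conj {∞, b/d′}_f)`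
(the sum INCLUDES the trivial character). [cite: MazurTateTeitelbaum1986, §I.8] -/
theorem two_mul_sum_even_twistedSymbolSum {d' : ℕ} (hd' : d'.Prime) (f : CuspForm (Gamma0 N) 2)
    (hreal : ∀ n, (cuspCoeff f n).im = 0) (b : ℤ) (hb : IsUnit ((b : ZMod d'))) :
    haveI : NeZero d' := ⟨hd'.ne_zero⟩
    2 * ∑ χ ∈ (Finset.univ : Finset (DirichletCharacter ℂ d')) with χ.Even,
        χ ((b : ZMod d'))⁻¹ * twistedSymbolSum f χ =
      ((d' - 1 : ℕ) : ℂ) * (modularSymbol f ((b : ℚ) / d') +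
        starRingEnd ℂ (modularSymbol f ((b : ℚ) / d'))) := by
  haveI : NeZero d' := ⟨hd'.ne_zero⟩
  have hswap : ∑ χ ∈ (Finset.univ : Finset (DirichletCharacter ℂ d')) with χ.Even,
      χ ((b : ZMod d'))⁻¹ * twistedSymbolSum f χ =
      ∑ x : ZMod d', (∑ χ ∈ (Finset.univ : Finset (DirichletCharacter ℂ d')) with χ.Even,
        χ ((b : ZMod d'))⁻¹ * χ x) * modularSymbol f ((x.val : ℚ) / d') := by
    simp only [twistedSymbolSum, Finset.mul_sum, Finset.sum_mul, mul_assoc]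
    exact Finset.sum_comm
  rw [hswap, Finset.mul_sum]
  simp_rw [← mul_assoc, two_mul_sum_even_char_inv_mul_char _ hb, add_mul, Finset.sum_add_distrib,
    ite_mul, zero_mul, Finset.sum_ite_eq, Finset.mem_univ, if_true]
  have hneg : ∑ x : ZMod d', (if (b : ZMod d') = -x then
      (d'.totient : ℂ) * modularSymbol f ((x.val : ℚ) / d') else 0) =
      (d'.totient : ℂ) * modularSymbol f ((((-b : ℤ) : ZMod d').val : ℚ) / d') := by
    have : ∀ x : ZMod d', ((b : ZMod d') = -x) = (((-b : ℤ) : ZMod d') = x) := by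
      intro x; rw [Int.cast_neg, neg_eq_iff_eq_neg]
    simp_rw [this, Finset.sum_ite_eq, Finset.mem_univ, if_true]
  rw [hneg, Nat.totient_prime hd']
  have hval : ∀ c : ℤ, modularSymbol f ((((c : ZMod d').val : ℕ) : ℚ) / d') =
      modularSymbol f ((c : ℚ) / d') := by
    intro c
    have h1 : (((c : ZMod d').val : ℕ) : ℤ) = c % d' := ZMod.val_intCast c
    have hd0 : (d' : ℚ) ≠ 0 := by exact_mod_cast hd'.ne_zero
    have h2 : ((((c : ZMod d').val : ℕ) : ℚ) / d') = (c : ℚ) / d' + ((-(c / d') : ℤ) : ℚ) := by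
      have h3 : ((((c : ZMod d').val : ℕ) : ℤ) : ℚ) = ((c % d' : ℤ) : ℚ) := by exact_mod_cast h1
      rw [Int.emod_def] at h3
      push_cast at h3 ⊢
      rw [h3]
      field_simp
      ring
    rw [h2, modularSymbol_add_intCast_holds f]
  rw [hval b, hval (-b), Int.cast_neg, neg_div, modularSymbol_neg_eq_conj_holds f hreal]
  ring

/-- Reindexing a sum over `ZMod d′` by the representatives `0 ≤ val < d′`. [folklore] -/
theorem sum_zmod_val_eq_sum_range {d' : ℕ} [NeZero d'] (g : ℕ → ℂ) :
    ∑ a : ZMod d', g a.val = ∑ j ∈ Finset.range d', g j := by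
  refine Finset.sum_nbij' (fun a ↦ a.val) (fun j ↦ ((j : ℕ) : ZMod d')) (fun a _ ↦ ?_) (fun _ _ ↦ Finset.mem_univ _)
    (fun a _ ↦ ZMod.natCast_zmod_val a) (fun j hj ↦ ZMod.val_natCast_of_lt (Finset.mem_range.mp hj))
    (fun _ _ ↦ rfl)
  exact Finset.mem_coe.mpr (Finset.mem_range.mpr (ZMod.val_lt a))

/-- **The trivial character, via Hecke at `d′`**: for a normalised eigenform `f` of level `N` and a prime
`d′ ∤ N`, `Σ_{a mod d′, a ≠ 0} {∞, a/d′}_f = (a_{d′} − 2)·{∞, 0}_f`, from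
`a_{d′}{∞,0} = Σ_{j mod d′} {∞, j/d′} + {∞, 0}` (`cuspCoeff_mul_modularSymbol`). [cite: MazurTateTeitelbaum1986, §I.4 (4.2)] -/
theorem twistedSymbolSum_one {d' : ℕ} (hd' : d'.Prime) (f : CuspForm (Gamma0 N) 2) (hf : IsNewform0 f)
    (hd'N : ¬ d' ∣ N) :
    haveI : NeZero d' := ⟨hd'.ne_zero⟩
    twistedSymbolSum f (1 : DirichletCharacter ℂ d') = (cuspCoeff f d' - 2) * modularSymbol f 0 := by
  haveI : NeZero d' := ⟨hd'.ne_zero⟩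
  haveI : Fact d'.Prime := ⟨hd'⟩
  have hH := cuspCoeff_mul_modularSymbol (p := d') hf hd' hd'N 0
  simp only [zero_add, mul_zero] at hH
  have hsum : ∑ a : ZMod d', (1 : DirichletCharacter ℂ d') a * modularSymbol f ((a.val : ℚ) / d') =
      ∑ a : ZMod d', modularSymbol f ((a.val : ℚ) / d') - modularSymbol f 0 := by
    rw [← Finset.sum_erase_add _ _ (Finset.mem_univ (0 : ZMod d')),
      ← Finset.sum_erase_add Finset.univ (fun a : ZMod d' ↦ modularSymbol f ((a.val : ℚ) / d'))
        (Finset.mem_univ (0 : ZMod d'))]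
    rw [ZMod.val_zero, Nat.cast_zero, zero_div, MulChar.map_nonunit _ not_isUnit_zero, zero_mul, add_zero,
      add_sub_cancel_right]
    refine Finset.sum_congr rfl fun a ha ↦ ?_
    rw [MulChar.one_apply (isUnit_iff_ne_zero.mpr (Finset.ne_of_mem_erase ha)), one_mul]
  have hfin : ∑ a : ZMod d', modularSymbol f ((a.val : ℚ) / d') =
      ∑ j : Fin d', modularSymbol f ((j : ℚ) / d') := by
    rw [sum_zmod_val_eq_sum_range (fun n ↦ modularSymbol f ((n : ℚ) / d')), ← Fin.sum_univ_eq_sum_range]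
  rw [twistedSymbolSum, hsum, hfin]
  linear_combination -hH

end EvenSymbols

/-! ### Unit Euler factors for characters of odd order prime to the odd part of `p − 1`:
the ONE wall `ℓ ≡ a_ℓ (mod p)` -/

section EvenEuler

variable {p : ℕ}

/-- **`p ∤ ℓⁿ − aⁿ` for `n` odd and prime to the odd part of `p − 1`, off the wall `ℓ ≡ a (mod p)`**:
otherwise `u = ℓ/a` has `uⁿ = u^{p−1} = 1`, so `u^{gcd(n, p−1)} = u = 1`. [folklore] -/
theorem not_dvd_pow_sub_pow_of_odd [hp : Fact p.Prime] {ℓ a : ℤ} (hℓ : ((ℓ : ZMod p)) ≠ 0)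
    (hA : ((ℓ : ZMod p)) ≠ (a : ZMod p)) {n : ℕ} (hn2 : ¬ 2 ∣ n)
    (hr : ∀ r : ℕ, r.Prime → r ≠ 2 → r ∣ p - 1 → ¬ r ∣ n) : ¬ (p : ℤ) ∣ ℓ ^ n - a ^ n := by
  intro hdvd
  have hn : n ≠ 0 := by rintro rfl; exact hn2 (dvd_zero 2)
  have h0 : ((ℓ : ZMod p)) ^ n = ((a : ZMod p)) ^ n := by
    have : (((ℓ ^ n - a ^ n : ℤ)) : ZMod p) = 0 := (ZMod.intCast_zmod_eq_zero_iff_dvd _ p).mpr hdvd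
    push_cast at this
    exact sub_eq_zero.mp this
  by_cases ha : ((a : ZMod p)) = 0
  · rw [ha, zero_pow hn] at h0
    exact pow_ne_zero n hℓ h0
  set u : ZMod p := (ℓ : ZMod p) / (a : ZMod p) with hu
  have hu1 : u ^ n = 1 := by
    rw [hu, div_pow, h0, div_self (pow_ne_zero n ha)]
  have hu0 : u ≠ 0 := by rw [hu]; exact div_ne_zero hℓ ha
  have hup : u ^ (p - 1) = 1 := ZMod.pow_card_sub_one_eq_one hu0
  have hgcd : Nat.gcd n (p - 1) = 1 := by
    by_contra h1
    obtain ⟨r, hr', hrg⟩ := Nat.exists_prime_and_dvd h1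
    have hrn : r ∣ n := hrg.trans (Nat.gcd_dvd_left _ _)
    have hrp : r ∣ p - 1 := hrg.trans (Nat.gcd_dvd_right _ _)
    by_cases hr2 : r = 2
    · subst hr2; exact hn2 hrn
    · exact hr r hr' hr2 hrp hrn
  have hu' : u = 1 := by
    have := pow_gcd_eq_one.mpr ⟨hu1, hup⟩
    rwa [hgcd, pow_one] at this
  apply hA
  rw [hu] at hu'
  exact (div_eq_one_iff_eq ha).mp hu'

/-- Packaged: `(ℓ − aζ) · w = t`, `w` integral, `p ∤ t ∈ ℤ`, for `ζⁿ = 1` with `n` odd, prime to the odd part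
of `p − 1`, and `ℓ ≢ a (mod p)`. [folklore] -/
theorem exists_eulerFactor_mul_eq_of_odd [hp : Fact p.Prime] {ℓ a : ℤ}
    (hℓ : ((ℓ : ZMod p)) ≠ 0) (hA : ((ℓ : ZMod p)) ≠ (a : ZMod p))
    {n : ℕ} (hn2 : ¬ 2 ∣ n) (hr : ∀ r : ℕ, r.Prime → r ≠ 2 → r ∣ p - 1 → ¬ r ∣ n)
    {ζ : ℂ} (hζ : ζ ^ n = 1) :
    ∃ (w : ℂ) (t : ℤ), IsIntegral ℤ w ∧ ((ℓ : ℂ) - a * ζ) * w = t ∧ ¬ (p : ℤ) ∣ t := by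
  have hn : 0 < n := Nat.pos_of_ne_zero (by rintro rfl; exact hn2 (dvd_zero 2))
  obtain ⟨w, hw, hwt⟩ := exists_eulerFactor_mul_eq ℓ a hn hζ
  exact ⟨w, ℓ ^ n - a ^ n, hw, hwt, not_dvd_pow_sub_pow_of_odd hℓ hA hn2 hr⟩

/-- The symmetric Euler factor `(ℓ − aζ)(ℓ − aζ⁻¹)` is a `p`-unit under the same hypotheses. [folklore] -/
theorem exists_symmEulerFactor_mul_eq_of_odd [hp : Fact p.Prime] (ℓ : ℕ) (a : ℤ)
    (hℓ : ((ℓ : ZMod p)) ≠ 0) (hA : ((ℓ : ZMod p)) ≠ (a : ZMod p))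
    {n : ℕ} (hn2 : ¬ 2 ∣ n) (hr : ∀ r : ℕ, r.Prime → r ≠ 2 → r ∣ p - 1 → ¬ r ∣ n)
    {ζ : ℂ} (hζ : ζ ^ n = 1) :
    ∃ (w : ℂ) (t : ℤ), IsIntegral ℤ w ∧
      (((ℓ : ℂ) - (a : ℂ) * ζ) * ((ℓ : ℂ) - (a : ℂ) * ζ⁻¹)) * w = t ∧ ¬ (p : ℤ) ∣ t := by
  have hℓ' : (((ℓ : ℤ) : ZMod p)) ≠ 0 := by simpa using hℓ
  have hA' : (((ℓ : ℤ) : ZMod p)) ≠ (a : ZMod p) := by simpa using hA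
  have hζ' : ζ⁻¹ ^ n = 1 := by rw [inv_pow, hζ, inv_one]
  obtain ⟨w₁, t₁, hw₁, he₁, ht₁⟩ := exists_eulerFactor_mul_eq_of_odd hℓ' hA' hn2 hr hζ
  obtain ⟨w₂, t₂, hw₂, he₂, ht₂⟩ := exists_eulerFactor_mul_eq_of_odd hℓ' hA' hn2 hr hζ'
  refine ⟨w₁ * w₂, t₁ * t₂, hw₁.mul hw₂, ?_, fun hdvd ↦ ((Int.prime_iff_natAbs_prime.mpr
    (by simpa using hp.out)).dvd_or_dvd hdvd).elim ht₁ ht₂⟩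
  push_cast at he₁ he₂ ⊢
  linear_combination ((ℓ : ℂ) - (a : ℂ) * ζ⁻¹) * w₂ * he₁ + (t₁ : ℂ) * he₂

end EvenEuler


/-! ### One even character at the member, one admissible `γ` -/

section OneEvenCharacter

variable {V : WeierstrassCurve ℚ} [V.IsElliptic] {N : ℕ} [NeZero N] {p : ℕ} [hp : Fact p.Prime]

/-- **One even character at the member.** For the member `V` (newform `f`, `p ≥ 5`, `p² ∣ N`), off the ONE
wall `ℓ ≢ a_ℓ (mod p)` at the primes `ℓ ∥ N`, with the Kato–Perrin-Riou torsion clause for `p ≤ 7` and the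
member even clause `MemberEvenClause V f p`: for an auxiliary prime `d′ > N` with `p ∤ d′ − 1`, `d′ ≢ 1 (mod r)`
for odd `r ∣ p − 1`, `d′ ≢ 1 (mod 4)` (and `p` a square mod `d′` when `p ≤ 7`) and an EVEN character `χ ≠ 1`
of conductor `d′`, `Σ_a χ(a){∞, a/d′}_f / Ω⁺(V)` is `p`-integral: the symmetric Euler factors at `ℓ ∥ N` are
`p`-units because `χ(ℓ)` has odd order `(d′−1)/2` prime to the odd part of `p − 1`
(`exists_symmEulerFactor_mul_eq_of_odd`). [cite: Kato2004Asterisque, Thm. 9.7 (p. 189)] [cite: WiersemaWuthrich2022, Thm. 1] -/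
theorem pint_twistedSymbolSum_div_even (f : CuspForm (Gamma0 N) 2) (hf : IsNewformOf V f) (hp5 : 5 ≤ p)
    (hpN : p ^ 2 ∣ N) (hNR : ∀ ℓ ∈ N.primeFactors, ¬ ℓ ^ 2 ∣ N → (ℓ : ZMod p) ≠ (V.LFunction ℓ : ZMod p))
    (htors : p ≤ 7 → ∀ P : (V.baseChange ℚ_[p]).toAffine.Point, p • P = 0 → P = 0)
    (hcl : MemberEvenClause V f p)
    {d' : ℕ} (hd' : d'.Prime) (hNd' : N < d') (hpd' : ¬ p ∣ d' - 1)
    (hrd' : ∀ r : ℕ, r.Prime → r ≠ 2 → r ∣ p - 1 → ¬ r ∣ d' - 1) (h4d' : ¬ 4 ∣ d' - 1)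
    (hsq : 7 < p ∨ IsSquare ((p : ZMod d')))
    {ϖ : ℚ} (hϖ : (ϖ : ℝ) * V.realPeriodRat = plusPeriod f)
    (χ : DirichletCharacter ℂ d') (hχ : χ.Even) (hχ1 : χ ≠ 1) :
    haveI : NeZero d' := ⟨hd'.ne_zero⟩
    ∃ s : ℕ, ¬ p ∣ s ∧ IsIntegral ℤ ((s : ℂ) * (twistedSymbolSum f χ / (V.realPeriodRat : ℂ))) := by
  haveI : NeZero d' := ⟨hd'.ne_zero⟩
  haveI : Fact d'.Prime := ⟨hd'⟩
  have hpP : p.Prime := hp.out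
  have hN0 : N ≠ 0 := NeZero.ne N
  have hprim : χ.IsPrimitive := by
    rw [DirichletCharacter.isPrimitive_def]
    rcases (Nat.dvd_prime hd').mp (DirichletCharacter.conductor_dvd_level χ) with h | h
    · exact absurd (DirichletCharacter.eq_one_iff_conductor_eq_one.mpr h) hχ1
    · exact h
  have hord : ¬ p ∣ orderOf χ := by
    intro h
    have h1 : orderOf χ ∣ Fintype.card (DirichletCharacter ℂ d') := orderOf_dvd_card
    have h2 : Fintype.card (DirichletCharacter ℂ d') = d'.totient := by
      rw [← Nat.card_eq_fintype_card]
      exact DirichletCharacter.card_eq_totient_of_hasEnoughRootsOfUnity ℂ d'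
    rw [h2, Nat.totient_prime hd'] at h1
    exact hpd' (h.trans h1)
  have hpN1 : p ∣ N := (dvd_pow_self p two_ne_zero).trans hpN
  have hpd'ne : p ≠ d' := by
    rintro rfl
    exact absurd (Nat.le_of_dvd (Nat.pos_of_ne_zero hN0) hpN1) (not_le.mpr hNd')
  have hm : d'.Coprime (p * N) := Nat.Coprime.mul_right ((Nat.coprime_primes hd' hpP).mpr hpd'ne.symm)
    ((hd'.coprime_iff_not_dvd).mpr fun h ↦ absurd (Nat.le_of_dvd (Nat.pos_of_ne_zero hN0) h)
      (not_le.mpr hNd'))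
  have hd'2 : d' ≠ 2 := by
    rintro rfl
    have := Nat.le_of_dvd (Nat.pos_of_ne_zero hN0) hpN1
    omega
  have hex : 7 < p ∨ (Nat.Coprime (orderOf ((p : ZMod d'))) (p - 1) ∧
      ∀ P : (V.baseChange ℚ_[p]).toAffine.Point, p • P = 0 → P = 0) := by
    rcases lt_or_ge 7 p with h7 | h7
    · exact Or.inl h7
    · refine Or.inr ⟨?_, htors h7⟩
      rcases hsq with h | h
      · omega
      · exact coprime_orderOf_sub_one hpP hd' hd'2 hpd'ne h4d' hrd' h
  -- the value `r` and the clause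
  have hΩf : 0 < plusPeriod f := IsNewform0.plusPeriod_pos_holds hf.1 hf.coeffField_eq_bot
  have hΩ : 0 < V.realPeriodRat := V.realPeriodRat_pos_holds
  have hϖ0 : (ϖ : ℂ) ≠ 0 := by
    have : (ϖ : ℝ) ≠ 0 := by
      rintro h; rw [h, zero_mul] at hϖ; exact hΩf.ne' hϖ.symm
    exact_mod_cast this
  have hΩfC : ((plusPeriod f : ℝ) : ℂ) = (ϖ : ℂ) * (V.realPeriodRat : ℂ) := by
    rw [← hϖ]; push_cast; ring
  set E : ℂ := ∏ ℓ ∈ N.primeFactors with ¬ ℓ ^ 2 ∣ N,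
      (((ℓ : ℂ) - (V.LFunction ℓ : ℂ) * χ (ℓ : ZMod d')) *
        ((ℓ : ℂ) - (V.LFunction ℓ : ℂ) * (χ (ℓ : ZMod d'))⁻¹)) with hEdef
  set T : ℂ := twistedSymbolSum f χ with hTdef
  set r : ℂ := E * T / ((plusPeriod f : ℝ) : ℂ) with hrdef
  have hden : ((plusPeriod f : ℝ) : ℂ) ≠ 0 := by exact_mod_cast hΩf.ne'
  have hval : E * T = r * ((plusPeriod f : ℝ) : ℂ) := by
    rw [hrdef, div_mul_cancel₀ _ hden]
  obtain ⟨s, hs, hint⟩ := hcl d' hm hex χ hprim hχ1 hord ϖ r hχ hϖ hval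
  have hre : (ϖ : ℂ) * r = E * (T / (V.realPeriodRat : ℂ)) := by
    rw [hrdef, hΩfC]
    have hΩ0 : (V.realPeriodRat : ℂ) ≠ 0 := by exact_mod_cast hΩ.ne'
    field_simp
  have hpint : ∃ s : ℕ, ¬ p ∣ s ∧ IsIntegral ℤ ((s : ℂ) * (E * (T / (V.realPeriodRat : ℂ)))) :=
    ⟨s, hs, by rw [← hre, ← mul_assoc]; exact hint⟩
  -- cancel the `p`-unit `E`: every `χ(ℓ)` has odd order `(d′ − 1)/2`, prime to the odd part of `p − 1`
  have hd'odd : d' % 2 = 1 := (Nat.Prime.mod_two_eq_one_iff_ne_two hd').mpr hd'2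
  obtain ⟨hn2, hn2'⟩ := half_sub_one_odd hd' hd'2 h4d'
  have hhalf : d' / 2 = (d' - 1) / 2 := by omega
  have hrn : ∀ r : ℕ, r.Prime → r ≠ 2 → r ∣ p - 1 → ¬ r ∣ (d' - 1) / 2 :=
    fun r hr hr2 hrp hrn ↦ hrd' r hr hr2 hrp (hrn.trans ⟨2, by omega⟩)
  have hEwt : ∃ (w : ℂ) (t : ℤ), IsIntegral ℤ w ∧ E * w = t ∧ ¬ (p : ℤ) ∣ t := by
    rw [hEdef]
    refine exists_prod_mul_eq hpP _ _ fun ℓ hℓ ↦ ?_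
    obtain ⟨hℓN, hℓ2⟩ := Finset.mem_filter.mp hℓ
    have hℓprime := Nat.prime_of_mem_primeFactors hℓN
    have hℓne : ℓ ≠ p := by
      rintro rfl; exact hℓ2 hpN
    have hℓ0 : ((ℓ : ZMod p)) ≠ 0 := by
      rw [Ne, ZMod.natCast_eq_zero_iff]
      exact fun h ↦ hℓne ((Nat.prime_dvd_prime_iff_eq hpP hℓprime).mp h).symm
    have hℓd' : ((ℓ : ZMod d')) ≠ 0 := by
      rw [Ne, ZMod.natCast_eq_zero_iff]
      exact fun h ↦ absurd (Nat.le_of_dvd hℓprime.pos h)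
        (not_le.mpr ((Nat.le_of_dvd (Nat.pos_of_ne_zero hN0) (Nat.dvd_of_mem_primeFactors hℓN)).trans_lt hNd'))
    -- `χ(ℓ)^{(d′−1)/2} = χ(ℓ^{(d′−1)/2}) = χ(±1) = 1` (`χ` even)
    have hζ : (χ (ℓ : ZMod d')) ^ ((d' - 1) / 2) = 1 := by
      rw [← map_pow, ← hhalf]
      rcases ZMod.pow_div_two_eq_neg_one_or_one d' hℓd' with h | h
      · rw [h, map_one]
      · rw [h]; exact hχ
    exact exists_symmEulerFactor_mul_eq_of_odd ℓ (V.LFunction ℓ) hℓ0 (hNR ℓ hℓN hℓ2) hn2 hrn hζ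
  obtain ⟨w, t, hw, hEw, ht⟩ := hEwt
  exact pint_of_pint_mul_of_mul_eq hpP hw hEw ht hpint

/-- **One admissible `γ`: the even combination.** For `γ = (a b; c d) ∈ Γ₀(N)` and an auxiliary prime
`d′ ≡ d (mod c)` as in `exists_admissiblePrime`, the combination
`((d′ − 1)·Re{∞, γ∞}_f + (d′ + 1 − a_{d′})·{∞, 0}_f) / Ω⁺(V)` is `p`-integral: Manin's trick
`{∞, b′/d′} = {∞, γ∞} + {∞, 0}`, even orthogonality INCLUDING the trivial character, the trivial term
`(a_{d′} − 2){∞, 0}` (Hecke at `d′`), and `pint_twistedSymbolSum_div_even` for every even `χ ≠ 1`.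
[cite: Manin1972, Thm. 1.6] [cite: MazurTateTeitelbaum1986, §I.8] -/
theorem pint_evenCombination (f : CuspForm (Gamma0 N) 2) (hf : IsNewformOf V f) (hp5 : 5 ≤ p)
    (hpN : p ^ 2 ∣ N) (hNR : ∀ ℓ ∈ N.primeFactors, ¬ ℓ ^ 2 ∣ N → (ℓ : ZMod p) ≠ (V.LFunction ℓ : ZMod p))
    (htors : p ≤ 7 → ∀ P : (V.baseChange ℚ_[p]).toAffine.Point, p • P = 0 → P = 0)
    (hcl : MemberEvenClause V f p)
    {ϖ : ℚ} (hϖ : (ϖ : ℝ) * V.realPeriodRat = plusPeriod f)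
    (γ : Gamma0 N) {k : ℤ} {d' : ℕ} (hd' : d'.Prime) (hNd' : N < d')
    (hd'eq : (d' : ℤ) = (γ : SL(2, ℤ)) 1 1 + k * (γ : SL(2, ℤ)) 1 0)
    (hpd' : ¬ p ∣ d' - 1) (hrd' : ∀ r : ℕ, r.Prime → r ≠ 2 → r ∣ p - 1 → ¬ r ∣ d' - 1) (h4d' : ¬ 4 ∣ d' - 1)
    (hsq : 7 < p ∨ IsSquare ((p : ZMod d'))) :
    ∃ s : ℕ, ¬ p ∣ s ∧ _root_.IsIntegral ℤ ((s : ℂ) *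
      (((((d' : ℂ) - 1) * (((cuspSymbol f γ).re : ℝ) : ℂ) +
        ((d' : ℂ) + 1 - (V.LFunction d' : ℂ)) * modularSymbol f 0) / (V.realPeriodRat : ℂ)))) := by
  have hpP : p.Prime := hp.out
  have hN0 : N ≠ 0 := NeZero.ne N
  have hreal : ∀ n, (cuspCoeff f n).im = 0 := cuspCoeff_im_eq_zero_of_coeffField_eq_bot hf.coeffField_eq_bot
  haveI : NeZero d' := ⟨hd'.ne_zero⟩
  haveI : Fact d'.Prime := ⟨hd'⟩
  have hd'N : ¬ d' ∣ N := fun h ↦ absurd (Nat.le_of_dvd (Nat.pos_of_ne_zero hN0) h) (not_le.mpr hNd')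
  -- `δ = γ T^k`: same first column, lower-right entry `d′`
  set δ : Gamma0 N := γ * ⟨ModularGroup.T ^ k, Literature.NumberTheory.Automorphic.T_zpow_mem_Gamma0 k⟩
    with hδdef
  obtain ⟨h00, h10, h01, h11⟩ := entries_mul_T_zpow (γ : SL(2, ℤ)) k
  have hδ : (δ : SL(2, ℤ)) = (γ : SL(2, ℤ)) * ModularGroup.T ^ k := rfl
  have hd11 : ((δ : SL(2, ℤ)) 1 1 : ℤ) = d' := by rw [hδ, h11, hd'eq]; ring
  have hcs : cuspSymbol f δ = cuspSymbol f γ := by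
    simp only [cuspSymbol, hδ, h00, h10]
  obtain ⟨b', hb'def⟩ : ∃ b' : ℤ, b' = (δ : SL(2, ℤ)) 0 1 := ⟨_, rfl⟩
  -- Manin: `{∞, b′/d′} = {∞, δ∞} + {∞, 0}`
  have hne : (((δ : SL(2, ℤ)) 1 0 : ℤ) : ℚ) * 0 + (((δ : SL(2, ℤ)) 1 1 : ℤ) : ℚ) ≠ 0 := by
    rw [mul_zero, zero_add, hd11]; exact_mod_cast hd'.ne_zero
  have hM := modularSymbol_gamma0_smul_holds f δ 0 hne
  rw [mul_zero, zero_add, mul_zero, zero_add, hd11, hcs, ← hb'def, Int.cast_natCast] at hM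
  -- `b′` is a unit mod `d′`
  have hbu : IsUnit ((b' : ZMod d')) := by
    rw [ZMod.coe_int_isUnit_iff_isCoprime]
    refine ⟨(δ : SL(2, ℤ)) 0 0, -(δ : SL(2, ℤ)) 1 0, ?_⟩
    have hdet := entry_det δ
    rw [hd11, ← hb'def] at hdet
    linear_combination hdet
  have hbu' : IsUnit ((b' : ZMod d'))⁻¹ := isUnit_iff_ne_zero.mpr (inv_ne_zero hbu.ne_zero)
  -- the even identity (trivial character included)
  have hid := two_mul_sum_even_twistedSymbolSum hd' f hreal b' hbu
  rw [hM, Complex.add_conj, Complex.add_re] at hid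
  push_cast at hid
  -- the trivial character: `(a_{d′} − 2){∞, 0}`
  have h1mem : (1 : DirichletCharacter ℂ d') ∈
      (Finset.univ : Finset (DirichletCharacter ℂ d')).filter (fun χ ↦ χ.Even) :=
    Finset.mem_filter.mpr ⟨Finset.mem_univ _,
      show (1 : DirichletCharacter ℂ d') (-1) = 1 from MulChar.one_apply isUnit_one.neg⟩
  have hsplit := Finset.sum_erase_add _
    (fun χ : DirichletCharacter ℂ d' ↦ χ ((b' : ZMod d'))⁻¹ * twistedSymbolSum f χ) h1mem
  have hg1 : (1 : DirichletCharacter ℂ d') ((b' : ZMod d'))⁻¹ *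
      twistedSymbolSum f (1 : DirichletCharacter ℂ d') = (cuspCoeff f d' - 2) * modularSymbol f 0 := by
    rw [MulChar.one_apply hbu', one_mul, twistedSymbolSum_one hd' f hf.1 hd'N]
  have haq : cuspCoeff f d' = (V.LFunction d' : ℂ) := hf.2 d'
  have him0 : (modularSymbol f 0).im = 0 := by
    have := modularSymbol_neg_eq_conj_holds f hreal 0
    rw [neg_zero] at this
    exact Complex.conj_eq_iff_im.mp this.symm
  have hM0 : (((modularSymbol f 0).re : ℝ) : ℂ) = modularSymbol f 0 :=
    Complex.ext (by simp) (by simp [him0])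
  -- each non-trivial even summand divided by `Ω⁺(V)` is `p`-integral
  have hΩ : 0 < V.realPeriodRat := V.realPeriodRat_pos_holds
  have hΩ0 : (V.realPeriodRat : ℂ) ≠ 0 := by exact_mod_cast hΩ.ne'
  have hsum : ∃ s : ℕ, ¬ p ∣ s ∧ IsIntegral ℤ ((s : ℂ) *
      ∑ χ ∈ ((Finset.univ : Finset (DirichletCharacter ℂ d')).filter (fun χ ↦ χ.Even)).erase 1,
        χ ((b' : ZMod d'))⁻¹ * (twistedSymbolSum f χ / (V.realPeriodRat : ℂ))) := by
    refine pint_sum hpP _ _ fun χ hχ ↦ pint_mul hpP (pint_of_isIntegral hpP (isIntegral_apply hd' χ _)) ?_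
    obtain ⟨hχ1, hχe⟩ := Finset.mem_erase.mp hχ
    exact pint_twistedSymbolSum_div_even f hf hp5 hpN hNR htors hcl hd' hNd' hpd' hrd' h4d' hsq hϖ χ
      (Finset.mem_filter.mp hχe).2 hχ1
  have hsum_eq : ∑ χ ∈ ((Finset.univ : Finset (DirichletCharacter ℂ d')).filter (fun χ ↦ χ.Even)).erase 1,
      χ ((b' : ZMod d'))⁻¹ * (twistedSymbolSum f χ / (V.realPeriodRat : ℂ)) =
      ((((d' : ℂ) - 1) * (((cuspSymbol f γ).re : ℝ) : ℂ) +
        ((d' : ℂ) + 1 - (V.LFunction d' : ℂ)) * modularSymbol f 0) / (V.realPeriodRat : ℂ)) := by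
    simp_rw [← mul_div_assoc, ← Finset.sum_div]
    congr 1
    have hK : ((d' - 1 : ℕ) : ℂ) = (d' : ℂ) - 1 := by
      rw [Nat.cast_sub hd'.one_le, Nat.cast_one]
    rw [hK] at hid
    linear_combination hsplit + (1 / 2 : ℂ) * hid - hg1 - modularSymbol f 0 * haq +
      ((d' : ℂ) - 1) * hM0
  rw [hsum_eq] at hsum
  exact hsum

end OneEvenCharacter


/-! ## §6  The Mazur relation at a non-anomalous prime, and the antisymmetric elimination -/

section MazurRelation

variable {N : ℕ} [NeZero N]

/-- **Mazur's relation** `(q + 1 − a_q)·{∞, 0}_f ∈ Λ_f` for a prime `q ∤ N`: Hecke at `q`,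
`a_q{∞, 0} = Σ_{j mod q}{∞, j/q} + {∞, 0}`, and Manin `{∞, j/q} = {∞, γ_j ∞} + {∞, 0}` for
`γ_j = (u j; −vN q) ∈ Γ₀(N)` (`j ≠ 0`). [cite: Mazur1977, §II.18] [cite: Manin1972, Thm. 1.6] -/
theorem sub_cuspCoeff_mul_modularSymbol_zero_mem (f : CuspForm (Gamma0 N) 2) (hf : IsNewform0 f)
    {q : ℕ} (hq : q.Prime) (hqN : ¬ q ∣ N) :
    ((q : ℂ) + 1 - cuspCoeff f q) * modularSymbol f 0 ∈ periodLattice f := by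
  haveI : Fact q.Prime := ⟨hq⟩
  have hH := cuspCoeff_mul_modularSymbol (p := q) hf hq hqN 0
  simp only [zero_add, mul_zero] at hH
  have key : ∀ j : Fin q, ∃ z ∈ periodLattice f,
      modularSymbol f ((j : ℚ) / q) = z + modularSymbol f 0 := by
    intro j
    by_cases hj : (j : ℕ) = 0
    · refine ⟨0, zero_mem _, ?_⟩
      rw [hj, Nat.cast_zero, zero_div, zero_add]
    · have hcop : Nat.Coprime q ((j : ℕ) * N) :=
        Nat.Coprime.mul_right ((hq.coprime_iff_not_dvd).mpr fun h ↦ hj (Nat.eq_zero_of_dvd_of_lt h j.isLt))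
          ((hq.coprime_iff_not_dvd).mpr hqN)
      obtain ⟨u, v, huv⟩ := Nat.isCoprime_iff_coprime.mpr hcop
      push_cast at huv
      let A : SL(2, ℤ) := ⟨!![u, (j : ℕ); -(v * N), q], by
        rw [Matrix.det_fin_two_of]; linear_combination huv⟩
      have hA : A ∈ Gamma0 N := by
        rw [Gamma0_mem]
        show (((-(v * (N : ℤ)) : ℤ) : ZMod N)) = 0
        push_cast
        simp
      let γ : Gamma0 N := ⟨A, hA⟩
      have h00 : ((γ : SL(2, ℤ)) 0 0 : ℤ) = u := rfl
      have h01 : ((γ : SL(2, ℤ)) 0 1 : ℤ) = (j : ℕ) := rfl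
      have h10 : ((γ : SL(2, ℤ)) 1 0 : ℤ) = -(v * N) := rfl
      have h11 : ((γ : SL(2, ℤ)) 1 1 : ℤ) = q := rfl
      have hne : (((γ : SL(2, ℤ)) 1 0 : ℤ) : ℚ) * 0 + (((γ : SL(2, ℤ)) 1 1 : ℤ) : ℚ) ≠ 0 := by
        rw [mul_zero, zero_add, h11]; exact_mod_cast hq.ne_zero
      have hM := modularSymbol_gamma0_smul_holds f γ 0 hne
      rw [mul_zero, zero_add, mul_zero, zero_add, h01, h11, Int.cast_natCast, Int.cast_natCast] at hM
      exact ⟨cuspSymbol f γ, cuspSymbol_mem_periodLattice f γ, hM⟩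
  choose z hz hzeq using key
  have hsum : ∑ j : Fin q, modularSymbol f ((j : ℚ) / q) = ∑ j : Fin q, z j + q * modularSymbol f 0 := by
    rw [Finset.sum_congr rfl fun j _ ↦ hzeq j, Finset.sum_add_distrib, Finset.sum_const, Finset.card_univ,
      Fintype.card_fin, nsmul_eq_mul]
  have heq : ((q : ℂ) + 1 - cuspCoeff f q) * modularSymbol f 0 = -∑ j : Fin q, z j := by
    linear_combination -hsum - hH
  rw [heq]
  exact neg_mem (sum_mem fun j _ ↦ hz j)

/-- Real form: if `re Λ_f = ℤ·Ω/2` and `a_q ∈ ℤ`, then `(q + 1 − a_q)·Re{∞, 0}_f = t₀·Ω/2` for some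
`t₀ ∈ ℤ`. [cite: Mazur1977, §II.18] -/
theorem exists_int_sub_cuspCoeff_mul_re_modularSymbol_zero (f : CuspForm (Gamma0 N) 2) (hf : IsNewform0 f)
    {q : ℕ} (hq : q.Prime) (hqN : ¬ q ∣ N) {a : ℤ} (ha : cuspCoeff f q = (a : ℂ))
    {Ω : ℝ} (hΩ : realPeriods f = AddSubgroup.zmultiples (Ω / 2)) :
    ∃ t₀ : ℤ, (((q : ℤ) + 1 - a : ℤ) : ℝ) * (modularSymbol f 0).re = t₀ * (Ω / 2) := by
  have hmem := sub_cuspCoeff_mul_modularSymbol_zero_mem f hf hq hqN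
  have hre : ((((q : ℂ) + 1 - cuspCoeff f q) * modularSymbol f 0)).re ∈ realPeriods f :=
    AddSubgroup.mem_map_of_mem _ hmem
  rw [hΩ, AddSubgroup.mem_zmultiples_iff] at hre
  obtain ⟨k, hk⟩ := hre
  refine ⟨k, ?_⟩
  rw [zsmul_eq_mul] at hk
  rw [hk, ha]
  have : ((q : ℂ) + 1 - (a : ℂ)) = ((((q : ℤ) + 1 - a : ℤ) : ℝ) : ℂ) := by push_cast; ring
  rw [this, Complex.re_ofReal_mul]

end MazurRelation

section Elimination

/-- **The antisymmetric elimination (pure algebra in a field).** Two instances of the per-`γ`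
congruence `m·((D − 1) n Φ) = −t·((1 − Φ)(Φ − D))` at INVERSE data (`D D₂ = 1`, `Φ Φ₂ = 1`) force
`m₁ + m₂ = 0`, provided `D ≠ 1`, `n ≠ 0`, `Φ ≠ 0`. [folklore] -/
theorem add_eq_zero_of_congr_pair {F : Type*} [Field F] {m₁ m₂ D D₂ Φ Φ₂ n t : F}
    (h₁ : m₁ * ((D - 1) * n * Φ) = -t * ((1 - Φ) * (Φ - D)))
    (h₂ : m₂ * ((D₂ - 1) * n * Φ₂) = -t * ((1 - Φ₂) * (Φ₂ - D₂)))
    (hD : D * D₂ = 1) (hΦ : Φ * Φ₂ = 1) (hD1 : D ≠ 1) (hn : n ≠ 0) (hΦ0 : Φ ≠ 0) :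
    m₁ + m₂ = 0 := by
  have key : (m₁ + m₂) * ((D - 1) * n * Φ) = 0 := by
    linear_combination h₁ - D * Φ ^ 2 * h₂ -
      (-m₂ * n * Φ ^ 2 * Φ₂ + t * Φ ^ 2 * (1 - Φ₂)) * hD -
      (-m₂ * n * Φ * (1 - D) + t * (D - D * Φ - Φ + D * Φ * Φ₂)) * hΦ
  rcases mul_eq_zero.mp key with h | h
  · exact h
  · exfalso
    rcases mul_eq_zero.mp h with h' | h'
    · rcases mul_eq_zero.mp h' with h'' | h''
      · exact hD1 (sub_eq_zero.mp h'')
      · exact hn h''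
    · exact hΦ0 h'

end Elimination


/-! ## §6½  The `p′`-transfer `Γ₀(N) ⇝ Γ₀(N′)` (rev 8): elementary matrix arithmetic

For `γ = (a b; c d) ∈ SL(2, ℤ)`: `c ∣ (γⁿ)₁₀`, `(γⁿ)₁₀ ≡ c·Σ_{i<n} dⁱaⁿ⁻¹⁻ⁱ (mod c²)`; with `ad ≡ 1 (mod ℓ)` the sum for
`n = ℓ(ℓ−1)` is `≡ 0 (mod ℓ)`, so `ℓ^j ∣ c`, `j ≥ 1` ⟹ `ℓ^{j+1} ∣ (γ^{(ℓ−1)ℓ})₁₀` (`pow_entry10_climb`).  Iterating over the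
prime factorisation of `D`: if every prime `ℓ ∣ D` divides `N` and is `< p`, every `γ` with `N ∣ c_γ` has a power `γ^k`,
`p ∤ k`, with `N·D ∣ (γ^k)₁₀` (`exists_pow_entry10_dvd_mul`, `exists_pow_entry10_dvd_of_gamma0`). -/

section Transfer

open Finset

/-- `n ∣ a − b` and `ℓ ∣ n` ⟹ `n·ℓ ∣ a^ℓ − b^ℓ` (one binomial step). -/
theorem mul_dvd_pow_sub_pow {n a b : ℤ} {ℓ : ℕ} (hab : n ∣ a - b) (hℓn : (ℓ : ℤ) ∣ n) :
    n * ℓ ∣ a ^ ℓ - b ^ ℓ := by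
  have hgeom : (∑ i ∈ range ℓ, a ^ i * b ^ (ℓ - 1 - i)) * (a - b) = a ^ ℓ - b ^ ℓ :=
    Commute.geom_sum₂_mul (Commute.all a b) ℓ
  have hS : (ℓ : ℤ) ∣ ∑ i ∈ range ℓ, a ^ i * b ^ (ℓ - 1 - i) := by
    rcases Nat.eq_zero_or_pos ℓ with h0 | hpos
    · subst h0; simp
    haveI : NeZero ℓ := ⟨hpos.ne'⟩
    apply (ZMod.intCast_zmod_eq_zero_iff_dvd _ ℓ).mp
    have hab' : ((a : ℤ) : ZMod ℓ) = ((b : ℤ) : ZMod ℓ) :=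
      (ZMod.intCast_eq_intCast_iff_dvd_sub a b ℓ).mpr (dvd_sub_comm.mp (hℓn.trans hab))
    push_cast
    rw [hab', geom_sum₂_self, ZMod.natCast_self, zero_mul]
  rw [← hgeom, mul_comm n]
  exact mul_dvd_mul hS hab

/-- Entries of powers of `γ = (a b; c d) ∈ SL(2, ℤ)`: `c ∣ (γⁿ)₁₀`, `c ∣ (γⁿ)₁₁ − dⁿ`, and
`c² ∣ (γⁿ)₁₀ − c·Σ_{i<n} dⁱ aⁿ⁻¹⁻ⁱ`. -/
theorem pow_entries_aux (γ : SL(2, ℤ)) (n : ℕ) :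
    (γ 1 0 ∣ (γ ^ n) 1 0) ∧ (γ 1 0 ∣ (γ ^ n) 1 1 - (γ 1 1) ^ n) ∧
      ((γ 1 0) ^ 2 ∣ (γ ^ n) 1 0 - γ 1 0 * ∑ i ∈ range n, (γ 1 1) ^ i * (γ 0 0) ^ (n - 1 - i)) := by
  induction n with
  | zero =>
    refine ⟨?_, ?_, ?_⟩
    · rw [pow_zero]; exact ⟨0, by simp⟩
    · rw [pow_zero, pow_zero]; exact ⟨0, by simp⟩
    · rw [pow_zero, sum_range_zero, mul_zero, sub_zero]; exact ⟨0, by simp⟩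
  | succ n ih =>
    obtain ⟨h1, h2, h3⟩ := ih
    have e : ∀ i j : Fin 2, (γ ^ (n + 1)) i j =
        ((((γ ^ n : SL(2, ℤ)) : Matrix (Fin 2) (Fin 2) ℤ) * (γ : Matrix (Fin 2) (Fin 2) ℤ)) i j) := by
      intro i j; rw [pow_succ]; rfl
    have e10 : (γ ^ (n + 1)) 1 0 = (γ ^ n) 1 0 * γ 0 0 + (γ ^ n) 1 1 * γ 1 0 := by
      rw [e, Matrix.mul_apply, Fin.sum_univ_two]
    have e11 : (γ ^ (n + 1)) 1 1 = (γ ^ n) 1 0 * γ 0 1 + (γ ^ n) 1 1 * γ 1 1 := by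
      rw [e, Matrix.mul_apply, Fin.sum_univ_two]
    refine ⟨?_, ?_, ?_⟩
    · rw [e10]; exact dvd_add (dvd_mul_of_dvd_left h1 _) (dvd_mul_left _ _)
    · rw [e11]
      have : (γ ^ n) 1 0 * γ 0 1 + (γ ^ n) 1 1 * γ 1 1 - γ 1 1 ^ (n + 1) =
          (γ ^ n) 1 0 * γ 0 1 + ((γ ^ n) 1 1 - γ 1 1 ^ n) * γ 1 1 := by ring
      rw [this]; exact dvd_add (dvd_mul_of_dvd_left h1 _) (dvd_mul_of_dvd_left h2 _)
    · rw [e10]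
      simp only [Nat.add_sub_cancel]
      rw [geom_sum₂_succ_eq]
      have : (γ ^ n) 1 0 * γ 0 0 + (γ ^ n) 1 1 * γ 1 0 -
          γ 1 0 * (γ 1 1 ^ n + γ 0 0 * ∑ i ∈ range n, γ 1 1 ^ i * γ 0 0 ^ (n - 1 - i)) =
          γ 0 0 * ((γ ^ n) 1 0 - γ 1 0 * ∑ i ∈ range n, γ 1 1 ^ i * γ 0 0 ^ (n - 1 - i)) +
            γ 1 0 * ((γ ^ n) 1 1 - γ 1 1 ^ n) := by ring
      rw [this]
      exact dvd_add (dvd_mul_of_dvd_right h3 _) (by rw [pow_two]; exact mul_dvd_mul_left _ h2)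

/-- **Climbing one `ℓ`-power.** `ℓ^j ∣ c` (`j ≥ 1`) ⟹ `ℓ^{j+1} ∣ (γ^{(ℓ−1)ℓ})₁₀`: the image of
`Γ₀(ℓ^j)` in `SL₂(ℤ/ℓ^{j+1})` modulo `Γ₀(ℓ^{j+1})` is the lower Borel of `SL₂(𝔽_ℓ)`, of exponent `ℓ(ℓ−1)`. -/
theorem pow_entry10_climb (γ : SL(2, ℤ)) {ℓ : ℕ} (hℓ : ℓ.Prime) {j : ℕ} (hj : 1 ≤ j)
    (hc : (ℓ : ℤ) ^ j ∣ γ 1 0) : (ℓ : ℤ) ^ (j + 1) ∣ (γ ^ ((ℓ - 1) * ℓ)) 1 0 := by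
  set n : ℕ := (ℓ - 1) * ℓ with hndef
  obtain ⟨-, -, h3⟩ := pow_entries_aux γ n
  set S : ℤ := ∑ i ∈ range n, (γ 1 1) ^ i * (γ 0 0) ^ (n - 1 - i) with hSdef
  have hsplit : (γ ^ n) 1 0 = ((γ ^ n) 1 0 - γ 1 0 * S) + γ 1 0 * S := by ring
  rw [hsplit]
  refine dvd_add (dvd_trans ?_ h3) ?_
  · calc (ℓ : ℤ) ^ (j + 1) ∣ (ℓ : ℤ) ^ (2 * j) := pow_dvd_pow _ (by omega)
      _ = ((ℓ : ℤ) ^ j) ^ 2 := by ring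
      _ ∣ (γ 1 0) ^ 2 := pow_dvd_pow_of_dvd hc 2
  · rw [pow_succ]
    refine mul_dvd_mul hc ?_
    haveI : Fact ℓ.Prime := ⟨hℓ⟩
    apply (ZMod.intCast_zmod_eq_zero_iff_dvd _ ℓ).mp
    have hℓc : (ℓ : ℤ) ∣ γ 1 0 := (dvd_pow_self _ (by omega)).trans hc
    have hdet : γ 0 0 * γ 1 1 - γ 0 1 * γ 1 0 = 1 := by
      have h := Matrix.det_fin_two (γ : Matrix (Fin 2) (Fin 2) ℤ)
      rw [γ.2] at h
      linear_combination -h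
    have had : ((γ 0 0 : ℤ) : ZMod ℓ) * ((γ 1 1 : ℤ) : ZMod ℓ) = 1 := by
      have h1 : (((γ 0 0 * γ 1 1 : ℤ)) : ZMod ℓ) = (((1 + γ 0 1 * γ 1 0 : ℤ)) : ZMod ℓ) := by
        congr 1; linear_combination hdet
      push_cast at h1
      rw [h1, (ZMod.intCast_zmod_eq_zero_iff_dvd _ ℓ).mpr hℓc]; ring
    have ha0 : ((γ 0 0 : ℤ) : ZMod ℓ) ≠ 0 := fun h ↦ by
      rw [h, zero_mul] at had; exact zero_ne_one had
    have hd0 : ((γ 1 1 : ℤ) : ZMod ℓ) ≠ 0 := fun h ↦ by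
      rw [h, mul_zero] at had; exact zero_ne_one had
    have hn : ((n : ℕ) : ZMod ℓ) = 0 := by
      rw [hndef, Nat.cast_mul, ZMod.natCast_self, mul_zero]
    have hapow : ((γ 0 0 : ℤ) : ZMod ℓ) ^ n = 1 := by
      rw [hndef, pow_mul, ZMod.pow_card_sub_one_eq_one ha0, one_pow]
    have hdpow : ((γ 1 1 : ℤ) : ZMod ℓ) ^ n = 1 := by
      rw [hndef, pow_mul, ZMod.pow_card_sub_one_eq_one hd0, one_pow]
    rw [hSdef]
    push_cast
    by_cases hda : ((γ 1 1 : ℤ) : ZMod ℓ) = ((γ 0 0 : ℤ) : ZMod ℓ)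
    · rw [hda, geom_sum₂_self, hn, zero_mul]
    · have h := Commute.geom_sum₂_mul (Commute.all ((γ 1 1 : ℤ) : ZMod ℓ) ((γ 0 0 : ℤ) : ZMod ℓ)) n
      rw [hdpow, hapow, sub_self] at h
      exact (mul_eq_zero.mp h).resolve_right (sub_ne_zero.mpr hda)

/-- **The `p′`-transfer for lower-left entries.**  If every prime `ℓ ∣ D` divides `N` and is `< p`, then every
`γ` with `N ∣ c_γ` has a power `γ^k`, `p ∤ k`, with `N·D ∣ c_{γ^k}`. -/
theorem exists_pow_entry10_dvd_mul {p : ℕ} (hp : p.Prime) (D : ℕ) :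
    ∀ (N : ℕ), 0 < N → (∀ ℓ : ℕ, ℓ.Prime → ℓ ∣ D → ℓ ∣ N ∧ ℓ < p) →
      ∀ γ : SL(2, ℤ), (N : ℤ) ∣ γ 1 0 →
        ∃ k : ℕ, 0 < k ∧ ¬ p ∣ k ∧ ((N * D : ℕ) : ℤ) ∣ (γ ^ k) 1 0 := by
  induction D using Nat.recOnMul with
  | zero => intro N _ h; exact absurd (h p hp (dvd_zero p)).2 (lt_irrefl p)
  | one => intro N _ _ γ hγ; exact ⟨1, one_pos, hp.not_dvd_one, by rwa [mul_one, pow_one]⟩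
  | prime ℓ hℓ =>
    intro N hN h γ hγ
    obtain ⟨hℓN, hℓp⟩ := h ℓ hℓ dvd_rfl
    obtain ⟨e, N₀, hN₀, hNe⟩ := Nat.exists_eq_pow_mul_and_not_dvd hN.ne' ℓ hℓ.ne_one
    have he : 1 ≤ e := by
      by_contra he0
      have : e = 0 := by omega
      rw [this, pow_zero, one_mul] at hNe
      exact hN₀ (hNe ▸ hℓN)
    have hc : (ℓ : ℤ) ^ e ∣ γ 1 0 := by
      refine dvd_trans ?_ hγ
      exact_mod_cast (Dvd.intro _ hNe.symm : ℓ ^ e ∣ N)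
    have hclimb := pow_entry10_climb γ hℓ he hc
    have hNpow : (N : ℤ) ∣ (γ ^ ((ℓ - 1) * ℓ)) 1 0 := hγ.trans (pow_entries_aux γ _).1
    refine ⟨(ℓ - 1) * ℓ, Nat.mul_pos (by have := hℓ.two_le; omega) hℓ.pos, fun hdvd ↦ ?_, ?_⟩
    · rcases (Nat.Prime.dvd_mul hp).mp hdvd with h1 | h1
      · have := Nat.le_of_dvd (by have := hℓ.two_le; omega) h1; omega
      · have := Nat.le_of_dvd hℓ.pos h1; omega
    · -- `N ℓ = ℓ^{e+1} N₀` with coprime factors, both dividing the entry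
      have hprod : N * ℓ = ℓ ^ (e + 1) * N₀ := by rw [hNe]; ring
      rw [hprod]
      have hcop : Nat.Coprime (ℓ ^ (e + 1)) N₀ :=
        Nat.Coprime.pow_left _ ((Nat.Prime.coprime_iff_not_dvd hℓ).mpr hN₀)
      have hN₀dvd : (N₀ : ℤ) ∣ (γ ^ ((ℓ - 1) * ℓ)) 1 0 :=
        dvd_trans (by exact_mod_cast (Dvd.intro_left _ hNe.symm : N₀ ∣ N)) hNpow
      rw [Int.natCast_dvd] at hN₀dvd ⊢
      have hclimb' : ℓ ^ (e + 1) ∣ ((γ ^ ((ℓ - 1) * ℓ)) 1 0).natAbs := by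
        rw [← Int.natCast_dvd]; exact_mod_cast hclimb
      exact hcop.mul_dvd_of_dvd_of_dvd hclimb' hN₀dvd
  | mul a b iha ihb =>
    intro N hN h γ hγ
    rcases Nat.eq_zero_or_pos a with ha0 | ha0
    · subst ha0; exact absurd (h p hp (by simp)).2 (lt_irrefl p)
    rcases Nat.eq_zero_or_pos b with hb0 | hb0
    · subst hb0; exact absurd (h p hp (by simp)).2 (lt_irrefl p)
    obtain ⟨k₁, hk₁, hpk₁, hd₁⟩ :=
      iha N hN (fun ℓ hℓ hℓa ↦ h ℓ hℓ (hℓa.mul_right b)) γ hγ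
    obtain ⟨k₂, hk₂, hpk₂, hd₂⟩ :=
      ihb (N * a) (Nat.mul_pos hN ha0) (fun ℓ hℓ hℓb ↦
        ⟨(h ℓ hℓ (hℓb.mul_left a)).1.mul_right a, (h ℓ hℓ (hℓb.mul_left a)).2⟩) (γ ^ k₁) hd₁
    refine ⟨k₁ * k₂, Nat.mul_pos hk₁ hk₂, fun hdvd ↦ ?_, ?_⟩
    · rcases (Nat.Prime.dvd_mul hp).mp hdvd with h1 | h1
      · exact hpk₁ h1
      · exact hpk₂ h1
    · rw [pow_mul, ← mul_assoc]; exact hd₂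

/-- `Γ₀(N') ≤ Γ₀(N)` for `N ∣ N'`. -/
theorem Gamma0_le_of_dvd {N N' : ℕ} (h : N ∣ N') : Gamma0 N' ≤ Gamma0 N := by
  intro A hA
  rw [Gamma0_mem] at hA ⊢
  have h1 : (N' : ℤ) ∣ A 1 0 := (ZMod.intCast_zmod_eq_zero_iff_dvd _ N').mp (by exact_mod_cast hA)
  exact_mod_cast (ZMod.intCast_zmod_eq_zero_iff_dvd _ N).mpr ((Int.natCast_dvd_natCast.mpr h).trans h1)

/-- **Transfer for `Γ₀(N)`.**  If every prime `ℓ ∣ N'/N` divides `N` and is `< p`, every `κ ∈ Γ₀(N)` has a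
power `κ^k ∈ Γ₀(N')` with `p ∤ k`. -/
theorem exists_pow_entry10_dvd_of_gamma0 {p N N' : ℕ} (hp : p.Prime) [NeZero N] (hNN' : N ∣ N')
    (hprimes : ∀ ℓ : ℕ, ℓ.Prime → ℓ ∣ N' / N → ℓ ∣ N ∧ ℓ < p) (κ : Gamma0 N) :
    ∃ k : ℕ, ¬ p ∣ k ∧ (N' : ℤ) ∣ ((κ ^ k : Gamma0 N) : SL(2, ℤ)) 1 0 := by
  obtain ⟨k, -, hpk, hk⟩ :=
    exists_pow_entry10_dvd_mul hp (N' / N) N (NeZero.pos N) hprimes κ (natCast_dvd_entry10 κ)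
  refine ⟨k, hpk, ?_⟩
  rw [Nat.mul_div_cancel' hNN'] at hk
  exact hk


end Transfer

/-! ## §7  The even member lever, PROVED

Scheme (g12).  Suppose `v_p(ϖ) < 0`.  Write `Re{∞, γ∞}_f = m(γ)·Ω⁺_f/2` (`m : Γ₀(N) → ℤ` additive) and
`(q + 1 − a_q)·{∞, 0}_f = t₀·Ω⁺_f/2` (Mazur's relation at the non-anomalous prime `q` of (E1)).  For every
ADMISSIBLE `γ` the combination of `pint_evenCombination` is `p`-integral, and `v_p(ϖ) < 0` turns this into
`p ∣ (d′ − 1)·m(γ)·n_q + (d′ + 1 − a_{d′})·t₀`; reducing with (E0) (`a_{d′} ≡ φ(d) + d φ(d)⁻¹`,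
`d′ ≡ d (mod N)`) gives ONE congruence `m(γ)·(d − 1) n_q φ(d) ≡ −t₀ (1 − φ(d))(φ(d) − d) (mod p)` per
admissible `γ`, whose right side is ANTISYMMETRIC under `(d, φ(d)) ↦ (d⁻¹, φ(d)⁻¹)` while the left is
symmetric: two admissible `γ₁, γ₂` with `d₁d₂ ≡ 1`, `φ(d₁)φ(d₂) = 1` have `m(γ₁) + m(γ₂) ≡ 0`
(`add_eq_zero_of_congr_pair`).  For any `κ`, `η = (κ^{p−1})⁴` has `d_η ≡ 1`, `φ(d_η) = 1` and splits
(bsd-wall `exists_eq_mul_adjustableL` / `…57`) as `γ₁γ₂` with both factors admissible, so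
`4(p − 1)·m(κ) = m(η) ≡ 0`, i.e. `p ∣ m(κ)` for ALL `κ` — contradicting `re Λ_f = ℤ·Ω⁺_f/2`. -/

section Core

/-- **The even member lever at one curve, TRANSFER FORM (rev 8).**  The member `V` with its newform `f` on `Γ₀(N)`,
`p ≥ 5`, `p² ∣ N`; an Eisenstein congruence `a_q ≡ φ(q) + qφ(q)⁻¹ (mod p)` at the primes `q > N'` for `φ` of modulus
`M ∣ N'`, `N ∣ N'`, and the transfer property «every `κ ∈ Γ₀(N)` has a power `κ^k ∈ Γ₀(N')`, `p ∤ k`»; plus (E1), the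
one wall, the KP torsion clause and `MemberEvenClause V f p` ⟹ `v_p(Ω⁺_f/Ω⁺(V)) ≥ 0`.  PROOF: the rev-3 argument run
on the subgroup `Γ₀(N') ≤ Γ₀(N)` (there `γ ↦ d_γ mod M` is a homomorphism and `φ(d_γ)` a unit, and bsd-wall's splitting
`exists_eq_mul_adjustableL/57` works at any level divisible by `p`) gives `p ∣ m(γ)` for `γ ∈ Γ₀(N')`; additivity
`m(κ^k) = k·m(κ)` and `p ∤ k` transfer it to `Γ₀(N)`; then `re Λ_f ⊆ ℤ·pΩ/2` contradicts `re Λ_f = ℤ·Ω/2`.  NO level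
control `M ∣ N` is used.
[cite: Manin1972, Thm. 1.6] [cite: Mazur1977, §II.18] [cite: Kato2004Asterisque, Thm. 9.7 (p. 189)] -/
theorem evenMemberLever_coreT (V : WeierstrassCurve ℚ) [V.IsElliptic] {N : ℕ} [NeZero N]
    (f : CuspForm (Gamma0 N) 2) (p : ℕ) [hp : Fact p.Prime]
    (hf : IsNewformOf V f) (hp5 : 5 ≤ p) (hpN : p ^ 2 ∣ N)
    {N' M : ℕ} [NeZero N'] (φ : DirichletCharacter (ZMod p) M) (hNN' : N ∣ N') (hMN' : M ∣ N')
    (htr : ∀ κ : Gamma0 N, ∃ k : ℕ, ¬ p ∣ k ∧ (N' : ℤ) ∣ ((κ ^ k : Gamma0 N) : SL(2, ℤ)) 1 0)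
    (hφ : ∀ q : ℕ, q.Prime → N' < q →
      (V.LFunction q : ZMod p) = φ (q : ZMod M) + (q : ZMod p) * (φ (q : ZMod M))⁻¹)
    (hE1 : NonAnomalousPrime V p N) (hNR : EvenNonResonant V p N)
    (htors : p ≤ 7 → ∀ P : (V.baseChange ℚ_[p]).toAffine.Point, p • P = 0 → P = 0)
    (hcl : MemberEvenClause V f p) (ϖ : ℚ) (hϖ : (ϖ : ℝ) * V.realPeriodRat = plusPeriod f) :
    0 ≤ padicValRat p ϖ := by
  have hpP : p.Prime := hp.out
  have hN0 : N ≠ 0 := NeZero.ne N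
  have hpN1 : p ∣ N := (dvd_pow_self p two_ne_zero).trans hpN
  have hpN1' : p ∣ N' := hpN1.trans hNN'
  have hNN'le : N ≤ N' := Nat.le_of_dvd (NeZero.pos N') hNN'
  have hp2 : p ≠ 2 := by omega
  by_contra hneg
  rw [not_le] at hneg
  -- periods
  have hΩf : 0 < plusPeriod f := IsNewform0.plusPeriod_pos_holds hf.1 hf.coeffField_eq_bot
  obtain ⟨Ω, hΩdef⟩ : ∃ Ω : ℝ, Ω = plusPeriod f := ⟨_, rfl⟩
  have hre : realPeriods f = AddSubgroup.zmultiples (Ω / 2) := by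
    rw [hΩdef]; exact realPeriods_eq_zmultiples_of_plusPeriod_pos f hΩf
  rw [← hΩdef] at hΩf
  have hΩ2 : (Ω / 2 : ℝ) ≠ 0 := by positivity
  have hΩK : 0 < V.realPeriodRat := V.realPeriodRat_pos_holds
  have hΩK0 : (V.realPeriodRat : ℂ) ≠ 0 := by exact_mod_cast hΩK.ne'
  have hϖC : ((ϖ : ℚ) : ℂ) * (V.realPeriodRat : ℂ) = (Ω : ℂ) := by
    rw [hΩdef, ← hϖ]; push_cast; ring
  have hreal : ∀ n, (cuspCoeff f n).im = 0 := cuspCoeff_im_eq_zero_of_coeffField_eq_bot hf.coeffField_eq_bot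
  have him0 : (modularSymbol f 0).im = 0 := by
    have := modularSymbol_neg_eq_conj_holds f hreal 0
    rw [neg_zero] at this
    exact Complex.conj_eq_iff_im.mp this.symm
  have hM0 : (((modularSymbol f 0).re : ℝ) : ℂ) = modularSymbol f 0 :=
    Complex.ext (by simp) (by simp [him0])
  -- the integer-valued additive functional `m`: `Re{∞, γ∞}_f = m(γ)·Ω/2`
  have hmex : ∀ γ : Gamma0 N, ∃ k : ℤ, (cuspSymbol f γ).re = k * (Ω / 2) := by
    intro γ
    have h : (cuspSymbol f γ).re ∈ realPeriods f :=
      AddSubgroup.mem_map_of_mem _ (cuspSymbol_mem_periodLattice f γ)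
    rw [hre, AddSubgroup.mem_zmultiples_iff] at h
    obtain ⟨k, hk⟩ := h
    exact ⟨k, by rw [← hk, zsmul_eq_mul]⟩
  choose m hm using hmex
  have hm_mul : ∀ γ δ : Gamma0 N, m (γ * δ) = m γ + m δ := by
    intro γ δ
    have h := hm (γ * δ)
    rw [cuspSymbol_mul_holds f γ δ, Complex.add_re, hm γ, hm δ] at h
    have h' : ((m γ : ℝ) + m δ) * (Ω / 2) = (m (γ * δ) : ℝ) * (Ω / 2) := by rw [← h]; ring
    exact_mod_cast (mul_right_cancel₀ hΩ2 h').symm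
  have hm_pow : ∀ (γ : Gamma0 N) (n : ℕ), m (γ ^ n) = n * m γ := by
    intro γ n
    induction n with
    | zero =>
      have h1 := hm_mul 1 1
      rw [mul_one] at h1
      have : m 1 = 0 := by linarith
      rw [pow_zero, this, Nat.cast_zero, zero_mul]
    | succ n ih => rw [pow_succ, hm_mul, ih]; push_cast; ring
  -- (E1) and Mazur's relation: `(q + 1 − a_q)·Re{∞, 0} = t₀·Ω/2`
  obtain ⟨q, hq, hqN, hnq⟩ := hE1
  obtain ⟨nq, hnqdef⟩ : ∃ nq : ℤ, nq = (q : ℤ) + 1 - V.LFunction q := ⟨_, rfl⟩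
  have hnqp : ((nq : ℤ) : ZMod p) ≠ 0 := by rw [hnqdef]; push_cast; exact hnq
  obtain ⟨t₀, ht₀⟩ := exists_int_sub_cuspCoeff_mul_re_modularSymbol_zero f hf.1 hq hqN (hf.2 q) hre
  rw [← hnqdef] at ht₀
  have ht₀C : ((nq : ℤ) : ℂ) * (((modularSymbol f 0).re : ℝ) : ℂ) = (t₀ : ℂ) * ((Ω : ℂ) / 2) := by
    have := congrArg (fun x : ℝ ↦ (x : ℂ)) ht₀
    push_cast at this ⊢
    linear_combination this
  -- the auxiliary level `N'`: `Γ₀(N') ≤ Γ₀(N)`, the functional and the reductions restricted to it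
  let ι : Gamma0 N' →* Gamma0 N := Subgroup.inclusion (Gamma0_le_of_dvd hNN')
  have hι : ∀ γ : Gamma0 N', ((ι γ : Gamma0 N) : SL(2, ℤ)) = (γ : SL(2, ℤ)) := fun _ ↦ rfl
  let m' : Gamma0 N' → ℤ := fun γ ↦ m (ι γ)
  have hm' : ∀ γ : Gamma0 N', (cuspSymbol f (ι γ)).re = m' γ * (Ω / 2) := fun γ ↦ hm (ι γ)
  have hm'_mul : ∀ γ δ : Gamma0 N', m' (γ * δ) = m' γ + m' δ := fun γ δ ↦ by
    show m (ι (γ * δ)) = m (ι γ) + m (ι δ)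
    rw [map_mul, hm_mul]
  let ψp : Gamma0 N →* ZMod p := (ZMod.castHom hpN1 (ZMod p)).toMonoidHom.comp (Gamma0Map N)
  have hψp : ∀ γ : Gamma0 N, ψp γ = ((((γ : SL(2, ℤ)) 1 1 : ℤ)) : ZMod p) := fun γ ↦
    map_intCast (ZMod.castHom hpN1 (ZMod p)) _
  let ψp' : Gamma0 N' →* ZMod p := ψp.comp ι
  have hψp' : ∀ γ : Gamma0 N', ψp' γ = ((((γ : SL(2, ℤ)) 1 1 : ℤ)) : ZMod p) := fun γ ↦ by
    show ψp (ι γ) = _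
    rw [hψp, hι]
  let ψM : Gamma0 N' →* ZMod M := (ZMod.castHom hMN' (ZMod M)).toMonoidHom.comp (Gamma0Map N')
  have hψM : ∀ γ : Gamma0 N', ψM γ = ((((γ : SL(2, ℤ)) 1 1 : ℤ)) : ZMod M) := fun γ ↦
    map_intCast (ZMod.castHom hMN' (ZMod M)) _
  have hψp_unit : ∀ γ : Gamma0 N, ψp γ ≠ 0 := by
    intro γ h
    rw [hψp, ZMod.intCast_zmod_eq_zero_iff_dvd] at h
    have hc : (p : ℤ) ∣ (γ : SL(2, ℤ)) 1 0 := (Int.natCast_dvd_natCast.mpr hpN1).trans (natCast_dvd_entry10 γ)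
    have hdet := entry_det γ
    have h1 : (p : ℤ) ∣ 1 := by
      rw [← hdet]; exact dvd_sub (dvd_mul_of_dvd_right h _) (dvd_mul_of_dvd_right hc _)
    exact hpP.one_lt.ne' (by exact_mod_cast Int.eq_one_of_dvd_one (by positivity) h1)
  have hψp'_unit : ∀ γ : Gamma0 N', ψp' γ ≠ 0 := fun γ ↦ hψp_unit (ι γ)
  have hΦ_unit : ∀ γ : Gamma0 N', φ (ψM γ) ≠ 0 := by
    intro γ
    have hcM : (M : ℤ) ∣ (γ : SL(2, ℤ)) 1 0 :=
      (Int.natCast_dvd_natCast.mpr hMN').trans (natCast_dvd_entry10 γ)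
    obtain ⟨c', hc'⟩ := hcM
    have hu : IsUnit (ψM γ) := by
      rw [hψM, ZMod.coe_int_isUnit_iff_isCoprime]
      refine ⟨-((γ : SL(2, ℤ)) 0 1 * c'), (γ : SL(2, ℤ)) 0 0, ?_⟩
      have hdet := entry_det γ
      rw [hc'] at hdet
      linear_combination hdet
    exact (hu.map φ).ne_zero
  -- (H) the congruence at one admissible `γ ∈ Γ₀(N')`
  have hH : ∀ γ : Gamma0 N', EvenAdmissible p γ →
      ((m' γ : ℤ) : ZMod p) * ((ψp' γ - 1) * ((nq : ℤ) : ZMod p) * φ (ψM γ)) =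
        -((t₀ : ℤ) : ZMod p) * ((1 - φ (ψM γ)) * (φ (ψM γ) - ψp' γ)) := by
    intro γ hγ
    obtain ⟨k, d', hd', hN'd', hd'eq, hpd', hrd', h4d', hsq⟩ := exists_admissiblePrime hpP hp2 hpN1' γ hγ
    have hNd' : N < d' := lt_of_le_of_lt hNN'le hN'd'
    have hd'eqι : (d' : ℤ) = ((ι γ : Gamma0 N) : SL(2, ℤ)) 1 1 + k * ((ι γ : Gamma0 N) : SL(2, ℤ)) 1 0 := by
      rw [hι]; exact hd'eq
    have hP := pint_evenCombination f hf hp5 hpN hNR htors hcl hϖ (ι γ) hd' hNd' hd'eqι hpd' hrd' h4d' hsq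
    -- the integer `B`
    obtain ⟨B, hBdef⟩ : ∃ B : ℤ, B = ((d' : ℤ) - 1) * m' γ * nq + ((d' : ℤ) + 1 - V.LFunction d') * t₀ :=
      ⟨_, rfl⟩
    have hnum : ((nq : ℤ) : ℂ) * ((((d' : ℂ) - 1) * (((cuspSymbol f (ι γ)).re : ℝ) : ℂ) +
        ((d' : ℂ) + 1 - (V.LFunction d' : ℂ)) * modularSymbol f 0)) =
        ((B : ℤ) : ℂ) * (((ϖ : ℚ) : ℂ) / 2) * (V.realPeriodRat : ℂ) := by
      rw [hm' γ, ← hM0, hBdef]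
      push_cast
      linear_combination ((d' : ℂ) + 1 - (V.LFunction d' : ℂ)) * ht₀C -
        ((((d' : ℂ) - 1) * (m' γ : ℂ) * (nq : ℂ) + ((d' : ℂ) + 1 - (V.LFunction d' : ℂ)) * (t₀ : ℂ)) / 2) * hϖC
    have hZ : ((nq : ℤ) : ℂ) * (((((d' : ℂ) - 1) * (((cuspSymbol f (ι γ)).re : ℝ) : ℂ) +
        ((d' : ℂ) + 1 - (V.LFunction d' : ℂ)) * modularSymbol f 0)) / (V.realPeriodRat : ℂ)) =
        ((B : ℤ) : ℂ) * (((ϖ : ℚ) : ℂ) / 2) := by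
      rw [← mul_div_assoc, hnum, mul_div_cancel_right₀ _ hΩK0]
    have hpint : ∃ s : ℕ, ¬ p ∣ s ∧ _root_.IsIntegral ℤ ((s : ℂ) * (((B : ℤ) : ℂ) * (((ϖ : ℚ) : ℂ) / 2))) := by
      rw [← hZ]
      exact pint_mul hpP (pint_of_isIntegral hpP isIntegral_algebraMap) hP
    -- hence `p ∣ B` (else `ϖ/2`, so `ϖ`, would be `p`-integral)
    have hpB : (p : ℤ) ∣ B := by
      by_contra hB
      have h1 : ∃ s : ℕ, ¬ p ∣ s ∧ _root_.IsIntegral ℤ ((s : ℂ) * (((ϖ : ℚ) : ℂ) / 2)) :=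
        pint_of_pint_mul_of_mul_eq hpP isIntegral_one (by rw [mul_one]) hB hpint
      have h2 : ∃ s : ℕ, ¬ p ∣ s ∧ _root_.IsIntegral ℤ ((s : ℂ) * ((ϖ : ℚ) : ℂ)) := by
        have h3 : ((ϖ : ℚ) : ℂ) = ((2 : ℤ) : ℂ) * (((ϖ : ℚ) : ℂ) / 2) := by push_cast; ring
        rw [h3]
        exact pint_mul hpP (pint_of_isIntegral hpP isIntegral_algebraMap) h1
      exact absurd (padicValRat_nonneg_of_pint h2) (not_le.mpr hneg)
    -- reduce mod `p`
    have hB0 : ((B : ℤ) : ZMod p) = 0 := (ZMod.intCast_zmod_eq_zero_iff_dvd B p).mpr hpB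
    have hc : (p : ℤ) ∣ (γ : SL(2, ℤ)) 1 0 := (Int.natCast_dvd_natCast.mpr hpN1').trans (natCast_dvd_entry10 γ)
    have hcM : (M : ℤ) ∣ (γ : SL(2, ℤ)) 1 0 := (Int.natCast_dvd_natCast.mpr hMN').trans (natCast_dvd_entry10 γ)
    have hd'p : ((d' : ℕ) : ZMod p) = ψp' γ := by
      rw [hψp', ← Int.cast_natCast, hd'eq]; push_cast
      rw [(ZMod.intCast_zmod_eq_zero_iff_dvd _ p).mpr hc]; ring
    have hd'M : ((d' : ℕ) : ZMod M) = ψM γ := by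
      rw [hψM, ← Int.cast_natCast, hd'eq]; push_cast
      rw [(ZMod.intCast_zmod_eq_zero_iff_dvd _ M).mpr hcM]; ring
    have haφ := hφ d' hd' hN'd'
    rw [hd'M, hd'p] at haφ
    have hΦ0 := hΦ_unit γ
    rw [hBdef] at hB0
    push_cast at hB0
    rw [haφ, hd'p] at hB0
    linear_combination (φ (ψM γ)) * hB0 + (ψp' γ) * ((t₀ : ℤ) : ZMod p) * inv_mul_cancel₀ hΦ0
  -- vanishing of `m mod p` on `Γ₀(N')`
  have h4p : ((4 * ((p : ℤ) - 1) : ℤ) : ZMod p) ≠ 0 := by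
    push_cast
    rw [ZMod.natCast_self, zero_sub, mul_neg_one, neg_ne_zero]
    have : ((4 : ℕ) : ZMod p) ≠ 0 := by
      rw [Ne, ZMod.natCast_eq_zero_iff]
      intro h; have := Nat.le_of_dvd four_pos h; omega
    exact_mod_cast this
  have hzero' : ∀ κ : Gamma0 N', ((m' κ : ℤ) : ZMod p) = 0 := by
    intro κ
    have hD1 : ψp' κ ^ (p - 1) = 1 := ZMod.pow_card_sub_one_eq_one (hψp'_unit κ)
    have hΦ1 : φ (ψM κ) ^ (p - 1) = 1 := ZMod.pow_card_sub_one_eq_one (hΦ_unit κ)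
    obtain ⟨g4, hg4def⟩ : ∃ g4 : Gamma0 N', g4 = (κ ^ (p - 1)) ^ 4 := ⟨_, rfl⟩
    have hmg4 : m' g4 = (4 * ((p : ℤ) - 1)) * m' κ := by
      show m (ι g4) = (4 * ((p : ℤ) - 1)) * m (ι κ)
      rw [hg4def, map_pow, map_pow, hm_pow, hm_pow]; push_cast; rw [Nat.cast_sub hpP.one_le]; push_cast; ring
    have hDg4 : ψp' g4 = 1 := by rw [hg4def, map_pow, map_pow, hD1, one_pow]
    have hΦg4 : φ (ψM g4) = 1 := by rw [hg4def, map_pow, map_pow, map_pow, map_pow, hΦ1, one_pow]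
    suffices hg40 : ((m' g4 : ℤ) : ZMod p) = 0 by
      rw [hmg4, Int.cast_mul] at hg40
      rcases mul_eq_zero.mp hg40 with h | h
      · exact absurd h h4p
      · exact h
    by_cases hcg4 : ((g4 : Gamma0 N') : SL(2, ℤ)) 1 0 = 0
    · -- `c_g4 = 0`: the symbol vanishes, so `m' g4 = 0`
      have hcg4' : ((ι g4 : Gamma0 N) : SL(2, ℤ)) 1 0 = 0 := by rw [hι]; exact hcg4
      have h0 : cuspSymbol f (ι g4) = 0 := by simp only [cuspSymbol, hcg4', if_true]
      have h1 := hm' g4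
      rw [h0, Complex.zero_re] at h1
      have h2 : (m' g4 : ℝ) = 0 := by
        rcases mul_eq_zero.mp h1.symm with h | h
        · exact h
        · exact absurd h hΩ2
      have h3 : m' g4 = 0 := by exact_mod_cast h2
      rw [h3, Int.cast_zero]
    · -- split `g4 = γ₁ γ₂` into admissible factors (bsd-wall splitting at level `N'`, `B = ∅`)
      have hcoe : ((g4 : Gamma0 N') : SL(2, ℤ)) = ((κ ^ (p - 1) : Gamma0 N') : SL(2, ℤ)) ^ 4 := by
        rw [hg4def]; rfl
      have h3 : 3 ∣ p - 1 → (3 : ℤ) ∣ ((g4 : Gamma0 N') : SL(2, ℤ)) 1 0 →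
          (3 : ℤ) ∣ ((g4 : Gamma0 N') : SL(2, ℤ)) 1 1 - 1 := fun _ h ↦ by
        rw [hcoe] at h ⊢; exact three_dvd_pow_four_entry _ h
      have h4' : (4 : ℤ) ∣ ((g4 : Gamma0 N') : SL(2, ℤ)) 1 0 →
          (4 : ℤ) ∣ ((g4 : Gamma0 N') : SL(2, ℤ)) 1 1 - 1 := fun h ↦ by
        rw [hcoe] at h ⊢; exact four_dvd_pow_four_entry _ h
      have hBe : ∀ ℓ ∈ (∅ : Finset ℕ), ℓ.Prime ∧ p < ℓ ∧ (ℓ : ℤ) ∣ ((g4 : Gamma0 N') : SL(2, ℤ)) 1 0 :=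
        fun ℓ hℓ ↦ absurd hℓ (Finset.notMem_empty ℓ)
      have hγBe : ∀ ℓ ∈ (∅ : Finset ℕ), IsSquare (((((g4 : Gamma0 N') : SL(2, ℤ)) 1 1 : ℤ)) : ZMod ℓ) ∧
          ((((g4 : Gamma0 N') : SL(2, ℤ)) 1 1 : ℤ) : ZMod ℓ) ≠ 0 :=
        fun ℓ hℓ ↦ absurd hℓ (Finset.notMem_empty ℓ)
      obtain ⟨γ₁, γ₂, hmul, hA₁, hA₂⟩ : ∃ γ₁ γ₂ : Gamma0 N', g4 = γ₁ * γ₂ ∧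
          EvenAdmissible p γ₁ ∧ EvenAdmissible p γ₂ := by
        rcases Nat.lt_or_ge 7 p with h7 | h7
        · obtain ⟨γ₁, γ₂, hmul, ⟨hc₁, hd₁, hr₁, h4₁⟩, ⟨hc₂, hd₂, hr₂, h4₂⟩, -⟩ :=
            exists_eq_mul_adjustableL hpP hp5 hpN1' g4 hcg4 h3 h4' ∅ (fun _ ↦ True) hBe hγBe
          exact ⟨γ₁, γ₂, hmul, ⟨hc₁, hd₁, Or.inl h7, hr₁, h4₁⟩, ⟨hc₂, hd₂, Or.inl h7, hr₂, h4₂⟩⟩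
        · have hp57 : p = 5 ∨ p = 7 := by
            rcases (show p = 5 ∨ p = 6 ∨ p = 7 by omega) with h | h | h
            · exact Or.inl h
            · exfalso; rw [h] at hpP; norm_num at hpP
            · exact Or.inr h
          have hpc : (p : ℤ) ∣ ((κ ^ (p - 1) : Gamma0 N') : SL(2, ℤ)) 1 0 :=
            (Int.natCast_dvd_natCast.mpr hpN1').trans (natCast_dvd_entry10 _)
          have hd4p : ∃ d0 : ZMod p, d0 ≠ 0 ∧
              ((((g4 : Gamma0 N') : SL(2, ℤ)) 1 1 : ℤ) : ZMod p) = d0 ^ 4 := by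
            rw [hg4def]; exact pow_four_entry_eq_pow_four (κ ^ (p - 1)) hpP hpc
          obtain ⟨γ₁, γ₂, hmul, ⟨hc₁, hd₁, hr₁, h4₁⟩, ⟨hc₂, hd₂, hr₂, h4₂⟩, -, hsq₁, hsq₂⟩ :=
            exists_eq_mul_adjustable57 hpP hp57 hpN1' g4 hcg4 hd4p h3 h4' ∅ (fun _ ↦ True) hBe hγBe
          exact ⟨γ₁, γ₂, hmul, ⟨hc₁, hd₁, Or.inr hsq₁, hr₁, h4₁⟩, ⟨hc₂, hd₂, Or.inr hsq₂, hr₂, h4₂⟩⟩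
      -- the two congruences at inverse data
      have h₁ := hH γ₁ hA₁
      have h₂ := hH γ₂ hA₂
      have hDD : ψp' γ₁ * ψp' γ₂ = 1 := by rw [← map_mul, ← hmul, hDg4]
      have hΦΦ : φ (ψM γ₁) * φ (ψM γ₂) = 1 := by rw [← map_mul, ← map_mul, ← hmul, hΦg4]
      have hD1' : ψp' γ₁ ≠ 1 := by
        intro h1
        apply hA₁.2.1
        rw [hψp'] at h1
        exact (ZMod.intCast_eq_intCast_iff_dvd_sub 1 _ p).mp (by rw [Int.cast_one]; exact h1.symm)
      have hsum0 := add_eq_zero_of_congr_pair h₁ h₂ hDD hΦΦ hD1' hnqp (hΦ_unit γ₁)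
      rw [hmul, hm'_mul, Int.cast_add]
      exact hsum0
  -- TRANSFER to all of `Γ₀(N)`: `κ^k ∈ Γ₀(N')` with `p ∤ k`, and `m(κ^k) = k·m(κ)`
  have hzero : ∀ κ : Gamma0 N, ((m κ : ℤ) : ZMod p) = 0 := by
    intro κ
    obtain ⟨k, hpk, hk⟩ := htr κ
    have hmem : ((κ ^ k : Gamma0 N) : SL(2, ℤ)) ∈ Gamma0 N' := by
      rw [Gamma0_mem]
      exact_mod_cast (ZMod.intCast_zmod_eq_zero_iff_dvd _ N').mpr hk
    let κ' : Gamma0 N' := ⟨((κ ^ k : Gamma0 N) : SL(2, ℤ)), hmem⟩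
    have hκ' : ι κ' = κ ^ k := Subtype.ext rfl
    have h0 : ((m (κ ^ k) : ℤ) : ZMod p) = 0 := by rw [← hκ']; exact hzero' κ'
    rw [hm_pow, Int.cast_mul, Int.cast_natCast] at h0
    rcases mul_eq_zero.mp h0 with h | h
    · exfalso; rw [ZMod.natCast_eq_zero_iff] at h; exact hpk h
    · exact h
  -- contradiction with `re Λ_f = ℤ·Ω/2`: every period has real part in `ℤ·pΩ/2`
  have hpm : ∀ κ : Gamma0 N, (p : ℤ) ∣ m κ := fun κ ↦ (ZMod.intCast_zmod_eq_zero_iff_dvd _ p).mp (hzero κ)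
  let T : AddSubgroup ℂ :=
    (AddSubgroup.zmultiples ((p : ℝ) * (Ω / 2))).comap Complex.reLm.toAddMonoidHom
  have hΛ : periodLattice f ≤ T := by
    rw [periodLattice, AddSubgroup.closure_le]
    rintro _ ⟨γ, rfl⟩
    obtain ⟨k, hk⟩ := hpm γ
    show (cuspSymbol f γ).re ∈ AddSubgroup.zmultiples ((p : ℝ) * (Ω / 2))
    rw [hm γ, hk, AddSubgroup.mem_zmultiples_iff]
    exact ⟨k, by push_cast; rw [zsmul_eq_mul]; ring⟩
  have hhalf : (Ω / 2 : ℝ) ∈ realPeriods f := by rw [hre]; exact AddSubgroup.mem_zmultiples _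
  obtain ⟨z, hz, hzre⟩ := AddSubgroup.mem_map.mp hhalf
  have hzT : z.re ∈ AddSubgroup.zmultiples ((p : ℝ) * (Ω / 2)) := hΛ hz
  rw [AddSubgroup.mem_zmultiples_iff] at hzT
  obtain ⟨k, hk⟩ := hzT
  have hzre' : z.re = Ω / 2 := hzre
  rw [hzre', zsmul_eq_mul] at hk
  have hkp : (k : ℝ) * p = 1 :=
    mul_right_cancel₀ hΩ2 (by rw [one_mul, mul_assoc, hk])
  have hkp' : k * (p : ℤ) = 1 := by exact_mod_cast hkp
  have hp1 := Int.eq_one_of_mul_eq_one_left (by positivity : (0 : ℤ) ≤ p) hkp'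
  exact hpP.one_lt.ne' (by exact_mod_cast hp1)

/-- **The even member lever at one curve** (the member `V` with its newform `f`): (E0) + (E1) + the
one wall `ℓ ≢ a_ℓ` + the KP torsion clause + `MemberEvenClause V f p` ⟹ `v_p(Ω⁺_f/Ω⁺(V)) ≥ 0` — the case
`N' = N`, `k = 1` of `evenMemberLever_coreT` (statement unchanged since rev 3).
[cite: Manin1972, Thm. 1.6] [cite: Mazur1977, §II.18] [cite: Kato2004Asterisque, Thm. 9.7 (p. 189)] -/
theorem evenMemberLever_core (V : WeierstrassCurve ℚ) [V.IsElliptic] {N : ℕ} [NeZero N]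
    (f : CuspForm (Gamma0 N) 2) (p : ℕ) [hp : Fact p.Prime]
    (hf : IsNewformOf V f) (hp5 : 5 ≤ p) (hpN : p ^ 2 ∣ N)
    (hE0 : EisensteinCongruence V p N) (hE1 : NonAnomalousPrime V p N) (hNR : EvenNonResonant V p N)
    (htors : p ≤ 7 → ∀ P : (V.baseChange ℚ_[p]).toAffine.Point, p • P = 0 → P = 0)
    (hcl : MemberEvenClause V f p) (ϖ : ℚ) (hϖ : (ϖ : ℝ) * V.realPeriodRat = plusPeriod f) :
    0 ≤ padicValRat p ϖ := by
  obtain ⟨M, φ, hMN, hφ⟩ := hE0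
  refine evenMemberLever_coreT V f p hf hp5 hpN (N' := N) φ dvd_rfl hMN
    (fun κ ↦ ⟨1, hp.out.not_dvd_one, ?_⟩) (fun q hq hNq ↦ hφ q hq ?_) hE1 hNR htors hcl ϖ hϖ
  · rw [pow_one]; exact natCast_dvd_entry10 κ
  · exact fun h ↦ absurd (Nat.le_of_dvd (NeZero.pos N) h) (not_le.mpr hNq)


/-- **`EvenMemberLever` holds.**  The isogeny-invariance of `a_ℓ` (`IsIsogenous.LFunction_eq`) moves
(E0), (E1) and the wall to the member `W_K`, and `evenMemberLever_core` applies. -/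
theorem evenMemberLever_holds : EvenMemberLever := by
  intro W W_K _ _ _ N _ f p _ hf hiso hp5 hpN hE0 hE1 hNR htors hcl ϖ hϖ
  have hL : W.LFunction = W_K.LFunction := hiso.LFunction_eq
  have hfK : IsNewformOf W_K f := ⟨hf.1, fun n ↦ by rw [hf.2 n, hL]⟩
  refine evenMemberLever_core W_K f p hfK hp5 hpN ?_ ?_ ?_ htors hcl ϖ hϖ
  · simpa only [EisensteinCongruence, hL] using hE0
  · simpa only [NonAnomalousPrime, hL] using hE1
  · simpa only [EvenNonResonant, hL] using hNR

/-- (E0) ⇒ (E0-T): `N' = N`, `k = 1`. -/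
theorem eisensteinCongruenceT_of_eisensteinCongruence {W : WeierstrassCurve ℚ} {p N : ℕ} [NeZero N]
    [hp : Fact p.Prime] (h : EisensteinCongruence W p N) : EisensteinCongruenceT W p N := by
  obtain ⟨M, φ, hMN, hφ⟩ := h
  refine ⟨N, M, inferInstance, φ, dvd_rfl, hMN, fun κ ↦ ⟨1, hp.out.not_dvd_one, ?_⟩,
    fun q hq hNq ↦ hφ q hq ?_⟩
  · rw [pow_one]; exact natCast_dvd_entry10 κ
  · exact fun h ↦ absurd (Nat.le_of_dvd (NeZero.pos N) h) (not_le.mpr hNq)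

/-- **`EvenMemberLeverT` holds** (rev 8): isogeny-invariance of `a_ℓ` moves (E0-T), (E1) and the wall to the member
`W_K` (the transfer clause does not mention the curve), and `evenMemberLever_coreT` applies. -/
theorem evenMemberLeverT_holds : EvenMemberLeverT := by
  intro W W_K _ _ _ N _ f p _ hf hiso hp5 hpN hE0 hE1 hNR htors hcl ϖ hϖ
  have hL : W.LFunction = W_K.LFunction := hiso.LFunction_eq
  have hfK : IsNewformOf W_K f := ⟨hf.1, fun n ↦ by rw [hf.2 n, hL]⟩
  obtain ⟨N', M, hN', φ, hNN', hMN', htr, hφ⟩ := hE0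
  refine evenMemberLever_coreT W_K f p hfK hp5 hpN φ hNN' hMN' htr (fun q hq hNq ↦ ?_) ?_ ?_ htors hcl ϖ hϖ
  · rw [← hL]; exact hφ q hq hNq
  · simpa only [NonAnomalousPrime, hL] using hE1
  · simpa only [EvenNonResonant, hL] using hNR

/-- (E0-T)-lever ⇒ (E0)-lever. -/
theorem evenMemberLever_of_evenMemberLeverT (h : EvenMemberLeverT) : EvenMemberLever :=
  fun W W_K _ _ _ _ _ f p _ hf hiso hp5 hpN hE0 hE1 hNR htors hcl ϖ hϖ ↦
    h W W_K f p hf hiso hp5 hpN (eisensteinCongruenceT_of_eisensteinCongruence hE0) hE1 hNR htors hcl ϖ hϖ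

end Core

open Complex

/-! ## §8  The odd member lever, PROVED (bsd-wall's odd machine at the member, `a_ℓ ∈ {0, ±1}` modularity-free)

V#21i open content (i).  bsd-wall's `pint_twistedSymbolSum_div57` / `pint_im_cuspSymbol_of_adjustable57` /
`pint_im_cuspSymbol57` / `pint_im_cuspSymbolL` are re-run at ONE curve `V` (the member, with its newform `f`)
with the F″ fact `hK` + `Addv` + `Irr` replaced by the member clause `MemberOddClause V f p`, and the input
`a_ℓ = ±1 (ℓ ∥ N)` replaced by the modularity-free trichotomy `a_ℓ ∈ {0, ±1}` for `ℓ ∣ N`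
(`lFunction_trichotomy_of_dvd_level`: `ℓ ∣ N ⇔ ℓ ∣ N_V` by `IsNewformOf.dvd_level_iff_dvd_conductorNorm`, then
Kraus–Oesterlé at multiplicative `ℓ`, `a_ℓ = 0` at additive `ℓ`) — bsd-wall used `a_ℓ = ±1` only for `ℓ ≠ a_ℓ`
and for "resonant `ℓ ⇒ ℓ > p`", both of which survive `a_ℓ = 0`.  Then the lattice step
`im Λ_f = ℤ·Ω⁻_f/2` gives `oddMemberLever_core`, and `oddMemberLever_holds : OddMemberLever`. -/

section OddLever

variable {p : ℕ} [hp : Fact p.Prime]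

/-- `a_ℓ ∈ {0, 1, −1}` for every prime `ℓ` of the level of a newform of `V` (no modularity input:
`ℓ ∣ N ⇔ ℓ ∣ N_V`, so `ℓ` is bad; multiplicative ⇒ `±1` (Kraus–Oesterlé), additive ⇒ `0`).
[cite: DiamondShurman2005, Prop. 5.8.5 and (8.44)] [cite: KrausOesterle1992, §1] -/
theorem lFunction_trichotomy_of_dvd_level (V : WeierstrassCurve ℚ) [V.IsElliptic] {N : ℕ} [NeZero N]
    {f : CuspForm (Gamma0 N) 2} (hf : IsNewformOf V f) {ℓ : ℕ} (hℓ : ℓ ∈ N.primeFactors) :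
    V.LFunction ℓ = 0 ∨ V.LFunction ℓ = 1 ∨ V.LFunction ℓ = -1 := by
  have hℓp := Nat.prime_of_mem_primeFactors hℓ
  haveI : Fact ℓ.Prime := ⟨hℓp⟩
  have hℓc : ℓ ∣ V.conductorNorm ℤ :=
    (hf.dvd_level_iff_dvd_conductorNorm hℓp).mp (Nat.dvd_of_mem_primeFactors hℓ)
  have hng : ¬ V.HasGoodReductionAtPrime ℓ := fun hg ↦
    not_dvd_conductorNorm_of_hasGoodReductionAtPrime V hg hℓc
  by_cases hmul : V.HasMultiplicativeReductionAtPrime ℓ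
  · exact Or.inr (KrausOesterle1992.lFunction_apply_prime_eq_one_or_eq_neg_one_of_mult V ℓ hmul)
  · exact Or.inl (V.LFunction_apply_eq_zero_of_not_good_of_not_mult ℓ hng hmul (dvd_refl ℓ))

/-- **One odd character at the member** (bsd-wall `pint_twistedSymbolSum_div57` with `hK, Addv, Irr ↦
MemberOddClause V f p` and `a_ℓ = ±1 ↦ a_ℓ ∈ {0, ±1}`): for an ODD character `χ (mod d′)` on an admissible
prime `d′`, `Σ_a χ(a){∞, a/d′}_f / (Ω⁻(V) i)` is `p`-integral.
[cite: Kato2004Asterisque, Thm. 9.7 (p. 189)] [cite: KostersPannekoek2017, Thm. 1] -/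
theorem pint_twistedSymbolSum_div_odd (V : WeierstrassCurve ℚ) [V.IsElliptic] {N : ℕ} [NeZero N]
    (f : CuspForm (Gamma0 N) 2) (hf : IsNewformOf V f) (hp5 : 5 ≤ p) (hpN : p ^ 2 ∣ N)
    (htors : p ≤ 7 → ∀ P : (V.baseChange ℚ_[p]).toAffine.Point, p • P = 0 → P = 0)
    (hcl : MemberOddClause V f p)
    {d' : ℕ} (hd' : d'.Prime) (hNd' : N < d') (hpd' : ¬ p ∣ d' - 1)
    (hrd' : ∀ r : ℕ, r.Prime → r ≠ 2 → r ∣ p - 1 → ¬ r ∣ d' - 1) (h4d' : ¬ 4 ∣ d' - 1)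
    (hsq : 7 < p ∨ IsSquare ((p : ZMod d')))
    (hL : ∀ ℓ ∈ N.primeFactors, ¬ ℓ ^ 2 ∣ N →
      (((ℓ : ZMod p) / (V.LFunction ℓ : ZMod p) = 1 → IsSquare (-((ℓ : ZMod d')))) ∧
        ((ℓ : ZMod p) / (V.LFunction ℓ : ZMod p) = -1 → IsSquare ((ℓ : ZMod d')))))
    {ϖ : ℚ} (hϖ : (ϖ : ℝ) * V.imaginaryPeriodRat = minusPeriod f)
    (χ : DirichletCharacter ℂ d') (hχ : χ.Odd) :
    haveI : NeZero d' := ⟨hd'.ne_zero⟩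
    ∃ s : ℕ, ¬ p ∣ s ∧ _root_.IsIntegral ℤ ((s : ℂ) *
      (twistedSymbolSum f χ / ((V.imaginaryPeriodRat : ℂ) * I))) := by
  haveI : NeZero d' := ⟨hd'.ne_zero⟩
  haveI : Fact d'.Prime := ⟨hd'⟩
  have hpP : p.Prime := hp.out
  have hN0 : N ≠ 0 := NeZero.ne N
  -- `χ ≠ 1`, primitive, of order prime to `p`
  have hχ1 : χ ≠ 1 := by
    intro h
    have h1 : χ (-1) = -1 := hχ
    rw [h, MulChar.one_apply (isUnit_one.neg)] at h1
    norm_num at h1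
  have hprim : χ.IsPrimitive := by
    rw [DirichletCharacter.isPrimitive_def]
    rcases (Nat.dvd_prime hd').mp (DirichletCharacter.conductor_dvd_level χ) with h | h
    · exact absurd (DirichletCharacter.eq_one_iff_conductor_eq_one.mpr h) hχ1
    · exact h
  have hord : ¬ p ∣ orderOf χ := by
    intro h
    have h1 : orderOf χ ∣ Fintype.card (DirichletCharacter ℂ d') := orderOf_dvd_card
    have h2 : Fintype.card (DirichletCharacter ℂ d') = d'.totient := by
      rw [← Nat.card_eq_fintype_card]
      exact DirichletCharacter.card_eq_totient_of_hasEnoughRootsOfUnity ℂ d'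
    rw [h2, Nat.totient_prime hd'] at h1
    exact hpd' (h.trans h1)
  have hpd'ne : p ≠ d' := by
    rintro rfl
    exact absurd (Nat.le_of_dvd (Nat.pos_of_ne_zero hN0) ((dvd_pow_self p two_ne_zero).trans hpN))
      (not_le.mpr hNd')
  have hm : d'.Coprime (p * N) := Nat.Coprime.mul_right ((Nat.coprime_primes hd' hpP).mpr hpd'ne.symm)
    ((hd'.coprime_iff_not_dvd).mpr fun h ↦ absurd (Nat.le_of_dvd (Nat.pos_of_ne_zero hN0) h)
      (not_le.mpr hNd'))
  have hd'2 : d' ≠ 2 := by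
    rintro rfl
    have := Nat.le_of_dvd (Nat.pos_of_ne_zero hN0) ((dvd_pow_self p two_ne_zero).trans hpN)
    have h25 : 25 ≤ p ^ 2 := by nlinarith
    omega
  have hex : 7 < p ∨ (Nat.Coprime (orderOf ((p : ZMod d'))) (p - 1) ∧
      ∀ P : (V.baseChange ℚ_[p]).toAffine.Point, p • P = 0 → P = 0) := by
    rcases lt_or_ge 7 p with h7 | h7
    · exact Or.inl h7
    · refine Or.inr ⟨?_, htors h7⟩
      rcases hsq with h | h
      · omega
      · exact coprime_orderOf_sub_one hpP hd' hd'2 hpd'ne h4d' hrd' h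
  -- the value `r` and the clause
  have hΩf : 0 < minusPeriod f := IsNewform0.minusPeriod_pos_holds hf.1 hf.coeffField_eq_bot
  have hΩ : 0 < V.imaginaryPeriodRat := V.imaginaryPeriodRat_pos
  have hϖ0 : (ϖ : ℂ) ≠ 0 := by
    have : (ϖ : ℝ) ≠ 0 := by
      rintro h; rw [h, zero_mul] at hϖ; exact hΩf.ne' hϖ.symm
    exact_mod_cast this
  have hΩfC : ((minusPeriod f : ℝ) : ℂ) = (ϖ : ℂ) * (V.imaginaryPeriodRat : ℂ) := by
    rw [← hϖ]; push_cast; ring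
  set E : ℂ := ∏ ℓ ∈ N.primeFactors with ¬ ℓ ^ 2 ∣ N,
      (((ℓ : ℂ) - (V.LFunction ℓ : ℂ) * χ (ℓ : ZMod d')) *
        ((ℓ : ℂ) - (V.LFunction ℓ : ℂ) * (χ (ℓ : ZMod d'))⁻¹)) with hEdef
  set T : ℂ := twistedSymbolSum f χ with hTdef
  set r : ℂ := E * T / (((minusPeriod f : ℝ) : ℂ) * I) with hrdef
  have hden : ((minusPeriod f : ℝ) : ℂ) * I ≠ 0 :=
    mul_ne_zero (by exact_mod_cast hΩf.ne') I_ne_zero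
  have hval : E * T = r * ((minusPeriod f : ℝ) : ℂ) * I := by
    rw [hrdef, mul_assoc, div_mul_cancel₀ _ hden]
  obtain ⟨s, hs, hint⟩ := hcl d' hm hex χ hprim hχ1 hord ϖ r hχ hϖ hval
  -- `ϖ r = E · (T / (Ω i))`
  have hre : (ϖ : ℂ) * r = E * (T / ((V.imaginaryPeriodRat : ℂ) * I)) := by
    rw [hrdef, hΩfC]
    have hΩ0 : (V.imaginaryPeriodRat : ℂ) ≠ 0 := by exact_mod_cast hΩ.ne'
    field_simp
  have hpint : ∃ s : ℕ, ¬ p ∣ s ∧ _root_.IsIntegral ℤ ((s : ℂ) * (E * (T / ((V.imaginaryPeriodRat : ℂ) * I)))) :=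
    ⟨s, hs, by rw [← hre, ← mul_assoc]; exact hint⟩
  -- cancel the `p`-unit `E`
  have hEwt : ∃ (w : ℂ) (t : ℤ), _root_.IsIntegral ℤ w ∧ E * w = t ∧ ¬ (p : ℤ) ∣ t := by
    rw [hEdef]
    refine exists_prod_mul_eq hpP _ _ fun ℓ hℓ ↦ ?_
    obtain ⟨hℓN, hℓ2⟩ := Finset.mem_filter.mp hℓ
    have hℓprime := Nat.prime_of_mem_primeFactors hℓN
    have hℓne : ℓ ≠ p := by
      rintro rfl; exact hℓ2 hpN
    have hℓ0 : ((ℓ : ZMod p)) ≠ 0 := by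
      rw [Ne, ZMod.natCast_eq_zero_iff]
      exact fun h ↦ hℓne ((Nat.prime_dvd_prime_iff_eq hpP hℓprime).mp h).symm
    have hℓd' : ((ℓ : ZMod d')) ≠ 0 := by
      rw [Ne, ZMod.natCast_eq_zero_iff]
      exact fun h ↦ absurd (Nat.le_of_dvd hℓprime.pos h)
        (not_le.mpr ((Nat.le_of_dvd (Nat.pos_of_ne_zero hN0) (Nat.dvd_of_mem_primeFactors hℓN)).trans_lt hNd'))
    have hζ : (χ (ℓ : ZMod d')) ^ (d' - 1) = 1 := by
      rw [← map_pow, ZMod.pow_card_sub_one_eq_one hℓd', map_one]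
    have hd'odd : d' % 2 = 1 := (Nat.Prime.mod_two_eq_one_iff_ne_two hd').mpr (by
      rintro rfl; exact absurd hNd' (by have := Nat.le_of_dvd (Nat.pos_of_ne_zero hN0) ((dvd_pow_self p two_ne_zero).trans hpN); omega))
    have hhalf : (d' - 1) / 2 % 2 = 1 ∧ 2 * ((d' - 1) / 2) = d' - 1 := by
      rcases Nat.odd_mod_four_iff.mp hd'odd with h1 | h3
      · exfalso; apply h4d'; have := Nat.div_add_mod d' 4; omega
      · have := Nat.div_add_mod d' 4; have := Nat.div_add_mod (d' - 1) 2; omega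
    set u : ZMod p := (ℓ : ZMod p) / (V.LFunction ℓ : ZMod p) with hudef
    have hyne : ∀ y : ZMod d', (χ y) ^ 2 = -1 → False := by
      intro y hy2
      by_cases hy0 : y = 0
      · rw [hy0, χ.map_nonunit not_isUnit_zero] at hy2; norm_num at hy2
      have h1 : (χ y) ^ (d' - 1) = 1 := by rw [← map_pow, ZMod.pow_card_sub_one_eq_one hy0, map_one]
      rw [← hhalf.2, pow_mul, hy2] at h1
      have hodd : Odd ((d' - 1) / 2) := Nat.odd_iff.mpr hhalf.1
      rw [hodd.neg_one_pow] at h1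
      norm_num at h1
    by_cases hu1 : u = 1
    · -- resonant case `ℓ ≡ a (mod p)`: `ζ ≠ 1` because `−ℓ` is a square and `χ` is odd
      obtain ⟨y, hy⟩ := (hL ℓ hℓN hℓ2).1 hu1
      have ha0 : ((V.LFunction ℓ : ℤ) : ZMod p) ≠ 0 := by
        intro h0; rw [hudef, h0, div_zero] at hu1; exact zero_ne_one hu1
      have hℓa : (p : ℤ) ∣ (ℓ : ℤ) - V.LFunction ℓ := by
        have : ((ℓ : ZMod p)) = (V.LFunction ℓ : ZMod p) := by
          rw [hudef, div_eq_one_iff_eq ha0] at hu1; exact hu1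
        exact (ZMod.intCast_eq_intCast_iff_dvd_sub (V.LFunction ℓ) (ℓ : ℤ) p).mp (by simpa using this.symm)
      have hne : (ℓ : ℤ) ≠ V.LFunction ℓ := by
        have := hℓprime.two_le
        rcases lFunction_trichotomy_of_dvd_level V hf hℓN with h | h | h <;> rw [h] <;> omega
      have hζ1 : χ (ℓ : ZMod d') ≠ 1 := by
        intro h1
        apply hyne y
        have : χ (-(ℓ : ZMod d')) = χ y * χ y := by rw [hy, map_mul]
        rw [hχ.eval_neg, h1] at this
        rw [sq, ← this]
      have hpn : ¬ (p : ℤ) ∣ ((d' - 1 : ℕ) : ℤ) := fun h ↦ hpd' (by exact_mod_cast h)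
      exact exists_symmEulerFactor_mul_eq_of_modEq ℓ (V.LFunction ℓ) hℓa
        (fun h ↦ ha0 ((ZMod.intCast_zmod_eq_zero_iff_dvd _ p).mpr h)) hne
        (Nat.sub_pos_of_lt hd'.one_lt) hpn hζ hζ1
    · by_cases hu2 : u = -1
      · -- resonant case `ℓ ≡ −a (mod p)`: `ℓ` is a square, so `ζ^{(d′−1)/2} = 1` with `(d′−1)/2` odd
        obtain ⟨y, hy⟩ := (hL ℓ hℓN hℓ2).2 hu2
        have hy0 : y ≠ 0 := by rintro rfl; exact hℓd' (by rw [hy]; ring)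
        have hζ2 : (χ (ℓ : ZMod d')) ^ ((d' - 1) / 2) = 1 := by
          rw [hy, map_mul, ← sq, ← pow_mul, hhalf.2, ← map_pow, ZMod.pow_card_sub_one_eq_one hy0, map_one]
        exact exists_symmEulerFactor_mul_eq_of_oddOrder ℓ (V.LFunction ℓ) hℓ0 hu1
          (by omega) (by omega) (fun r hr hr2 hrp h ↦ hrd' r hr hr2 hrp (h.trans ⟨2, by omega⟩)) hζ2
      · -- generic case `u² ≠ 1`
        have hA : u ^ 2 ≠ 1 := by
          intro h
          have : (u - 1) * (u + 1) = 0 := by linear_combination h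
          rcases mul_eq_zero.mp this with h | h
          · exact hu1 (sub_eq_zero.mp h)
          · exact hu2 (eq_neg_of_add_eq_zero_left h)
        exact exists_symmEulerFactor_mul_eq_of_sq_ne_one ℓ (V.LFunction ℓ) hℓ0 hA
          (Nat.sub_pos_of_lt hd'.one_lt) hrd' h4d' hζ
  obtain ⟨w, t, hw, hEw, ht⟩ := hEwt
  exact pint_of_pint_mul_of_mul_eq hpP hw hEw ht hpint

/-- **One L-adjustable `γ` at the member** (bsd-wall `pint_im_cuspSymbol_of_adjustable57` with the same
substitutions): `Im {∞, γ∞}_f / Ω⁻(V)` is `p`-integral. [cite: Manin1972, Thm. 1.6] -/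
theorem pint_im_cuspSymbol_of_adjustable_odd (V : WeierstrassCurve ℚ) [V.IsElliptic] {N : ℕ} [NeZero N]
    (f : CuspForm (Gamma0 N) 2) (hf : IsNewformOf V f) (hp5 : 5 ≤ p) (hpN : p ^ 2 ∣ N)
    (htors : p ≤ 7 → ∀ P : (V.baseChange ℚ_[p]).toAffine.Point, p • P = 0 → P = 0)
    (hcl : MemberOddClause V f p)
    {ϖ : ℚ} (hϖ : (ϖ : ℝ) * V.imaginaryPeriodRat = minusPeriod f)
    (γ : Gamma0 N) (hc : (γ : SL(2, ℤ)) 1 0 ≠ 0) (hdp : ¬ (p : ℤ) ∣ (γ : SL(2, ℤ)) 1 1 - 1)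
    (hdr : ∀ r : ℕ, r.Prime → r ≠ 2 → r ∣ p - 1 → (r : ℤ) ∣ (γ : SL(2, ℤ)) 1 0 →
      ¬ (r : ℤ) ∣ (γ : SL(2, ℤ)) 1 1 - 1)
    (h4γ : (4 : ℤ) ∣ (γ : SL(2, ℤ)) 1 0 → (4 : ℤ) ∣ (γ : SL(2, ℤ)) 1 1 - 3)
    (hγp : 7 < p ∨ IsSquare (-((((γ : SL(2, ℤ)) 1 1 : ℤ)) : ZMod p)))
    (hγB : ∀ ℓ ∈ N.primeFactors, ¬ ℓ ^ 2 ∣ N → ℓ ≠ 2 →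
      (((ℓ : ZMod p) / (V.LFunction ℓ : ZMod p) = 1 → ¬ IsSquare (-((((γ : SL(2, ℤ)) 1 1 : ℤ)) : ZMod ℓ))) ∧
        ((ℓ : ZMod p) / (V.LFunction ℓ : ZMod p) = -1 → IsSquare (-((((γ : SL(2, ℤ)) 1 1 : ℤ)) : ZMod ℓ))))) :
    ∃ s : ℕ, ¬ p ∣ s ∧ _root_.IsIntegral ℤ ((s : ℂ) *
      ((((cuspSymbol f γ).im : ℝ) : ℂ) / (V.imaginaryPeriodRat : ℂ))) := by
  have hpP : p.Prime := hp.out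
  have hpN1 : p ∣ N := (dvd_pow_self p two_ne_zero).trans hpN
  have hreal : ∀ n, (cuspCoeff f n).im = 0 := cuspCoeff_im_eq_zero_of_coeffField_eq_bot hf.coeffField_eq_bot
  set B : Finset ℕ := N.primeFactors.filter (fun ℓ ↦ ¬ ℓ ^ 2 ∣ N ∧ ℓ ≠ 2) with hBdef
  have hB : ∀ ℓ ∈ insert p B, ℓ.Prime ∧ ℓ ≠ 2 ∧ ℓ ∣ N := fun ℓ hℓ ↦ by
    rcases Finset.mem_insert.mp hℓ with rfl | hℓ
    · exact ⟨hpP, by omega, hpN1⟩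
    · obtain ⟨hℓN, -, hℓ2⟩ := Finset.mem_filter.mp hℓ
      exact ⟨Nat.prime_of_mem_primeFactors hℓN, hℓ2, Nat.dvd_of_mem_primeFactors hℓN⟩
  obtain ⟨k, d', hd', hNd', hd'eq, hpd', hrd', h4d', hsq⟩ :=
    exists_prime_eq_add_mul_of_adjustableL hpP hpN1 γ hc hdp hdr h4γ (insert p B) hB
  haveI : NeZero d' := ⟨hd'.ne_zero⟩
  have hsqp : 7 < p ∨ IsSquare ((p : ZMod d')) := by
    rcases hγp with h | h
    · exact Or.inl h
    · exact Or.inr ((hsq p (Finset.mem_insert_self p B)).1 h)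
  have hL : ∀ ℓ ∈ N.primeFactors, ¬ ℓ ^ 2 ∣ N →
      (((ℓ : ZMod p) / (V.LFunction ℓ : ZMod p) = 1 → IsSquare (-((ℓ : ZMod d')))) ∧
        ((ℓ : ZMod p) / (V.LFunction ℓ : ZMod p) = -1 → IsSquare ((ℓ : ZMod d')))) := by
    intro ℓ hℓN hℓ2
    by_cases hℓtwo : ℓ = 2
    · -- `ℓ = 2` is never resonant for `p ≥ 5` (`a_2 ∈ {0, ±1}`)
      subst hℓtwo
      have h3 : ((3 : ℕ) : ZMod p) ≠ 0 := by
        rw [Ne, ZMod.natCast_eq_zero_iff]; intro h; have := Nat.le_of_dvd (by norm_num) h; omega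
      have h1 : ((1 : ℕ) : ZMod p) ≠ 0 := by
        rw [Ne, ZMod.natCast_eq_zero_iff]; intro h; have := Nat.le_of_dvd (by norm_num) h; omega
      push_cast at h3 h1
      rcases lFunction_trichotomy_of_dvd_level V hf hℓN with h | h | h <;> rw [h] <;> push_cast
      · refine ⟨fun hu ↦ absurd hu ?_, fun hu ↦ absurd hu ?_⟩
        · rw [div_zero]; exact zero_ne_one
        · rw [div_zero]; intro e; apply h1; linear_combination e
      · refine ⟨fun hu ↦ absurd hu ?_, fun hu ↦ absurd hu ?_⟩
        · rw [div_one]; intro e; apply h1; linear_combination e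
        · rw [div_one]; intro e; apply h3; linear_combination e
      · refine ⟨fun hu ↦ absurd hu ?_, fun hu ↦ absurd hu ?_⟩
        · rw [div_neg, div_one]; intro e; apply h3; linear_combination -e
        · rw [div_neg, div_one]; intro e; apply h1; linear_combination -e
    · have hℓB : ℓ ∈ B := Finset.mem_filter.mpr ⟨hℓN, hℓ2, hℓtwo⟩
      obtain ⟨hsq1, hsq2⟩ := hsq ℓ (Finset.mem_insert_of_mem hℓB)
      obtain ⟨hγ1, hγ2⟩ := hγB ℓ hℓN hℓ2 hℓtwo
      exact ⟨fun hu ↦ hsq2 (hγ1 hu), fun hu ↦ hsq1 (hγ2 hu)⟩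
  -- `δ = γ T^k`: same first column, lower-right entry `d′`
  set δ : Gamma0 N := γ * ⟨ModularGroup.T ^ k, Literature.NumberTheory.Automorphic.T_zpow_mem_Gamma0 k⟩
    with hδdef
  obtain ⟨h00, h10, h01, h11⟩ := entries_mul_T_zpow (γ : SL(2, ℤ)) k
  have hδ : (δ : SL(2, ℤ)) = (γ : SL(2, ℤ)) * ModularGroup.T ^ k := rfl
  have hd11 : ((δ : SL(2, ℤ)) 1 1 : ℤ) = d' := by rw [hδ, h11, hd'eq]; ring
  have hcs : cuspSymbol f δ = cuspSymbol f γ := by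
    simp only [cuspSymbol, hδ, h00, h10]
  obtain ⟨b', hb'def⟩ : ∃ b' : ℤ, b' = (δ : SL(2, ℤ)) 0 1 := ⟨_, rfl⟩
  have hne : (((δ : SL(2, ℤ)) 1 0 : ℤ) : ℚ) * 0 + (((δ : SL(2, ℤ)) 1 1 : ℤ) : ℚ) ≠ 0 := by
    rw [mul_zero, zero_add, hd11]; exact_mod_cast hd'.ne_zero
  have hM := modularSymbol_gamma0_smul_holds f δ 0 hne
  rw [mul_zero, zero_add, mul_zero, zero_add, hd11, hcs, ← hb'def, Int.cast_natCast] at hM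
  have hbu : IsUnit ((b' : ZMod d')) := by
    rw [ZMod.coe_int_isUnit_iff_isCoprime]
    refine ⟨(δ : SL(2, ℤ)) 0 0, -(δ : SL(2, ℤ)) 1 0, ?_⟩
    have hdet := entry_det δ
    rw [hd11, ← hb'def] at hdet
    linear_combination hdet
  have hid := two_mul_sum_odd_twistedSymbolSum hd' f hreal b' hbu
  rw [hM, Complex.sub_conj] at hid
  have hΩ : 0 < V.imaginaryPeriodRat := V.imaginaryPeriodRat_pos
  have hΩ0 : (V.imaginaryPeriodRat : ℂ) ≠ 0 := by exact_mod_cast hΩ.ne'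
  have hsum : ∃ s : ℕ, ¬ p ∣ s ∧ _root_.IsIntegral ℤ ((s : ℂ) *
      ∑ χ ∈ (Finset.univ : Finset (DirichletCharacter ℂ d')) with χ.Odd,
        χ ((b' : ZMod d'))⁻¹ * (twistedSymbolSum f χ / ((V.imaginaryPeriodRat : ℂ) * I))) := by
    refine pint_sum hpP _ _ fun χ hχ ↦ pint_mul hpP (pint_of_isIntegral hpP (isIntegral_apply hd' χ _)) ?_
    exact pint_twistedSymbolSum_div_odd V f hf hp5 hpN htors hcl hd' hNd' hpd' hrd' h4d' hsqp hL hϖ χ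
      (Finset.mem_filter.mp hχ).2
  have hsum_eq : ∑ χ ∈ (Finset.univ : Finset (DirichletCharacter ℂ d')) with χ.Odd,
      χ ((b' : ZMod d'))⁻¹ * (twistedSymbolSum f χ / ((V.imaginaryPeriodRat : ℂ) * I)) =
      ((d' - 1 : ℕ) : ℂ) * ((((cuspSymbol f γ + modularSymbol f 0).im : ℝ) : ℂ) /
        (V.imaginaryPeriodRat : ℂ)) := by
    have h2 : (2 : ℂ) ≠ 0 := two_ne_zero
    simp_rw [← mul_div_assoc, ← Finset.sum_div]
    rw [show ∑ χ ∈ (Finset.univ : Finset (DirichletCharacter ℂ d')) with χ.Odd,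
        χ ((b' : ZMod d'))⁻¹ * twistedSymbolSum f χ =
        ((d' - 1 : ℕ) : ℂ) * ((2 * (cuspSymbol f γ + modularSymbol f 0).im : ℝ) : ℂ) * I / 2 by
      rw [eq_div_iff h2, mul_comm _ (2 : ℂ), hid]; ring]
    push_cast
    field_simp
  rw [hsum_eq] at hsum
  have him0 : (modularSymbol f 0).im = 0 := by
    have := modularSymbol_neg_eq_conj_holds f hreal 0
    rw [neg_zero] at this
    exact Complex.conj_eq_iff_im.mp this.symm
  rw [Complex.add_im, him0, add_zero] at hsum
  exact pint_of_pint_natCast_mul hpP hpd' hsum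

/-- **Every `γ ∈ Γ₀(N)` at the member** (bsd-wall `pint_im_cuspSymbol57` / `pint_im_cuspSymbolL` merged, same
substitutions): `Im {∞, γ∞}_f / Ω⁻(V)` is `p`-integral — `γ⁴ = γ₁γ₂` with L- or 57-adjustable `γᵢ` (residues
prescribed at the resonant `ℓ ≡ ±a_ℓ (mod p)`, which are `> p`; `−d_{γᵢ}` a square mod `p` when `p ≤ 7`).
[cite: Manin1972, Prop. 1.4 / Thm. 1.6] -/
theorem pint_im_cuspSymbol_odd (V : WeierstrassCurve ℚ) [V.IsElliptic] {N : ℕ} [NeZero N]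
    (f : CuspForm (Gamma0 N) 2) (hf : IsNewformOf V f) (hp5 : 5 ≤ p) (hpN : p ^ 2 ∣ N)
    (htors : p ≤ 7 → ∀ P : (V.baseChange ℚ_[p]).toAffine.Point, p • P = 0 → P = 0)
    (hcl : MemberOddClause V f p)
    {ϖ : ℚ} (hϖ : (ϖ : ℝ) * V.imaginaryPeriodRat = minusPeriod f) (γ : Gamma0 N) :
    ∃ s : ℕ, ¬ p ∣ s ∧ _root_.IsIntegral ℤ ((s : ℂ) *
      ((((cuspSymbol f γ).im : ℝ) : ℂ) / (V.imaginaryPeriodRat : ℂ))) := by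
  have hpP : p.Prime := hp.out
  have hp4 : ¬ p ∣ 4 := fun h ↦ by have := Nat.le_of_dvd four_pos h; omega
  have hpN1 : p ∣ N := (dvd_pow_self p two_ne_zero).trans hpN
  have hN0 : N ≠ 0 := NeZero.ne N
  -- `{∞, γ⁴∞} = 4 {∞, γ∞}`
  have h4 : cuspSymbol f (γ ^ 4) = 4 * cuspSymbol f γ := by
    have := map_pow (cuspSymbolHom f) γ 4
    simp only [cuspSymbolHom_apply] at this
    have h := congrArg Multiplicative.toAdd this
    rw [toAdd_ofAdd, toAdd_pow, toAdd_ofAdd, nsmul_eq_mul, Nat.cast_ofNat] at h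
    exact h
  have hcoe : ((γ ^ 4 : Gamma0 N) : SL(2, ℤ)) = (γ : SL(2, ℤ)) ^ 4 := rfl
  by_cases hc4 : ((γ ^ 4 : Gamma0 N) : SL(2, ℤ)) 1 0 = 0
  · have h0 : cuspSymbol f (γ ^ 4) = 0 := by simp only [cuspSymbol, hc4, if_true]
    rw [h4] at h0
    have : cuspSymbol f γ = 0 := by
      rcases mul_eq_zero.mp h0 with h | h
      · norm_num at h
      · exact h
    rw [this, Complex.zero_im, Complex.ofReal_zero, zero_div]
    exact pint_of_isIntegral hpP isIntegral_zero
  · have h3 : 3 ∣ p - 1 → (3 : ℤ) ∣ ((γ ^ 4 : Gamma0 N) : SL(2, ℤ)) 1 0 →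
        (3 : ℤ) ∣ ((γ ^ 4 : Gamma0 N) : SL(2, ℤ)) 1 1 - 1 := fun _ h ↦ by
      rw [hcoe] at h ⊢; exact three_dvd_pow_four_entry _ h
    have h4' : (4 : ℤ) ∣ ((γ ^ 4 : Gamma0 N) : SL(2, ℤ)) 1 0 →
        (4 : ℤ) ∣ ((γ ^ 4 : Gamma0 N) : SL(2, ℤ)) 1 1 - 1 := fun h ↦ by
      rw [hcoe] at h ⊢; exact four_dvd_pow_four_entry _ h
    -- the resonant primes and the residue prescription `Q ℓ := (ℓ ≡ −a_ℓ mod p)`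
    set B : Finset ℕ := N.primeFactors.filter (fun ℓ ↦ ¬ ℓ ^ 2 ∣ N ∧ ℓ ≠ 2 ∧
      ((ℓ : ZMod p) / (V.LFunction ℓ : ZMod p) = 1 ∨ (ℓ : ZMod p) / (V.LFunction ℓ : ZMod p) = -1)) with hBdef
    have hγc : ∀ ℓ ∈ N.primeFactors, (ℓ : ℤ) ∣ (γ : SL(2, ℤ)) 1 0 := fun ℓ hℓ ↦
      (Int.natCast_dvd_natCast.mpr (Nat.dvd_of_mem_primeFactors hℓ)).trans (natCast_dvd_entry10 γ)
    have hγ4c : ∀ ℓ ∈ N.primeFactors, (ℓ : ℤ) ∣ ((γ ^ 4 : Gamma0 N) : SL(2, ℤ)) 1 0 := fun ℓ hℓ ↦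
      (Int.natCast_dvd_natCast.mpr (Nat.dvd_of_mem_primeFactors hℓ)).trans (natCast_dvd_entry10 _)
    have hB : ∀ ℓ ∈ B, ℓ.Prime ∧ p < ℓ ∧ (ℓ : ℤ) ∣ ((γ ^ 4 : Gamma0 N) : SL(2, ℤ)) 1 0 := by
      intro ℓ hℓ
      obtain ⟨hℓN, hℓ2, hℓtwo, hu⟩ := Finset.mem_filter.mp hℓ
      have hℓp := Nat.prime_of_mem_primeFactors hℓN
      refine ⟨hℓp, ?_, hγ4c ℓ hℓN⟩
      -- `ℓ ≡ ±a_ℓ (mod p)` with `a_ℓ ∈ {0, ±1}` forces `a_ℓ = ±1` and `ℓ > p`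
      have hℓne : ℓ ≠ p := by rintro rfl; exact hℓ2 hpN
      by_contra hle
      have hlt : ℓ < p := lt_of_le_of_ne (not_lt.mp hle) hℓne
      have hval : ((ℓ : ZMod p)) = 1 ∨ ((ℓ : ZMod p)) = -1 := by
        rcases lFunction_trichotomy_of_dvd_level V hf hℓN with h | h | h <;> rw [h] at hu <;> push_cast at hu
        · rw [div_zero] at hu
          rcases hu with h1 | h1
          · exact absurd h1 zero_ne_one
          · exfalso
            have h2 : ((1 : ℕ) : ZMod p) = 0 := by push_cast; linear_combination h1
            rw [ZMod.natCast_eq_zero_iff] at h2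
            have := Nat.le_of_dvd one_pos h2; omega
        · simpa using hu
        · rw [div_neg, div_one] at hu
          rcases hu with h1 | h1
          · right; linear_combination -h1
          · left; linear_combination -h1
      rcases hval with h1 | h1
      · have : ((ℓ : ZMod p)).val = 1 := by rw [h1, ZMod.val_one]
        rw [ZMod.val_natCast_of_lt hlt] at this
        exact hℓp.one_lt.ne' this
      · have h2 : (((ℓ + 1 : ℕ)) : ZMod p) = 0 := by push_cast; rw [h1]; ring
        rw [ZMod.natCast_eq_zero_iff] at h2
        have := Nat.le_of_dvd (Nat.succ_pos ℓ) h2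
        have hodd := hℓp.odd_of_ne_two hℓtwo
        have hpodd := hpP.odd_of_ne_two (by omega)
        rcases hodd with ⟨m, hm⟩; rcases hpodd with ⟨m', hm'⟩; omega
    have hγB4 : ∀ ℓ ∈ B, IsSquare (((((γ ^ 4 : Gamma0 N) : SL(2, ℤ)) 1 1 : ℤ)) : ZMod ℓ) ∧
        (((((γ ^ 4 : Gamma0 N) : SL(2, ℤ)) 1 1 : ℤ)) : ZMod ℓ) ≠ 0 := fun ℓ hℓ ↦
      pow_four_entry_isSquare γ (hB ℓ hℓ).1 (hγc ℓ (Finset.mem_filter.mp hℓ).1)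
    have hm1 : (1 : ZMod p) ≠ -1 := by
      intro h
      have : ((2 : ℕ) : ZMod p) = 0 := by push_cast; linear_combination h
      rw [ZMod.natCast_eq_zero_iff] at this
      have := Nat.le_of_dvd two_pos this; omega
    -- the split, by cases on `p ≤ 7`
    obtain ⟨γ₁, γ₂, hmul, hP₁, hP₂⟩ : ∃ γ₁ γ₂ : Gamma0 N, γ ^ 4 = γ₁ * γ₂ ∧
        (∃ s : ℕ, ¬ p ∣ s ∧ _root_.IsIntegral ℤ ((s : ℂ) *
          ((((cuspSymbol f γ₁).im : ℝ) : ℂ) / (V.imaginaryPeriodRat : ℂ)))) ∧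
        (∃ s : ℕ, ¬ p ∣ s ∧ _root_.IsIntegral ℤ ((s : ℂ) *
          ((((cuspSymbol f γ₂).im : ℝ) : ℂ) / (V.imaginaryPeriodRat : ℂ)))) := by
      -- from a split with the bsd-wall output shape
      have key : ∀ γ₁ : Gamma0 N,
          ((γ₁ : SL(2, ℤ)) 1 0 ≠ 0 ∧ ¬ (p : ℤ) ∣ (γ₁ : SL(2, ℤ)) 1 1 - 1 ∧
            (∀ r : ℕ, r.Prime → r ≠ 2 → r ∣ p - 1 → (r : ℤ) ∣ (γ₁ : SL(2, ℤ)) 1 0 →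
              ¬ (r : ℤ) ∣ (γ₁ : SL(2, ℤ)) 1 1 - 1) ∧
            ((4 : ℤ) ∣ (γ₁ : SL(2, ℤ)) 1 0 → (4 : ℤ) ∣ (γ₁ : SL(2, ℤ)) 1 1 - 3)) →
          (∀ ℓ ∈ B, ((((ℓ : ZMod p) / (V.LFunction ℓ : ZMod p) = -1) →
              IsSquare (-((((γ₁ : SL(2, ℤ)) 1 1 : ℤ)) : ZMod ℓ))) ∧
            (¬ ((ℓ : ZMod p) / (V.LFunction ℓ : ZMod p) = -1) →
              ¬ IsSquare (-((((γ₁ : SL(2, ℤ)) 1 1 : ℤ)) : ZMod ℓ))))) →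
          (7 < p ∨ IsSquare (-((((γ₁ : SL(2, ℤ)) 1 1 : ℤ)) : ZMod p))) →
          ∃ s : ℕ, ¬ p ∣ s ∧ _root_.IsIntegral ℤ ((s : ℂ) *
            ((((cuspSymbol f γ₁).im : ℝ) : ℂ) / (V.imaginaryPeriodRat : ℂ))) := by
        intro γ₁ ⟨hc₁, hd₁, hr₁, h4₁⟩ hBout hsq₁
        have hγB₁ : ∀ ℓ ∈ N.primeFactors, ¬ ℓ ^ 2 ∣ N → ℓ ≠ 2 →
            (((ℓ : ZMod p) / (V.LFunction ℓ : ZMod p) = 1 →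
                ¬ IsSquare (-((((γ₁ : SL(2, ℤ)) 1 1 : ℤ)) : ZMod ℓ))) ∧
              ((ℓ : ZMod p) / (V.LFunction ℓ : ZMod p) = -1 →
                IsSquare (-((((γ₁ : SL(2, ℤ)) 1 1 : ℤ)) : ZMod ℓ)))) := by
          intro ℓ hℓN hℓ2 hℓtwo
          refine ⟨fun hu ↦ ?_, fun hu ↦ ?_⟩
          · have hℓB : ℓ ∈ B := Finset.mem_filter.mpr ⟨hℓN, hℓ2, hℓtwo, Or.inl hu⟩
            exact (hBout ℓ hℓB).2 (by rw [hu]; exact hm1)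
          · have hℓB : ℓ ∈ B := Finset.mem_filter.mpr ⟨hℓN, hℓ2, hℓtwo, Or.inr hu⟩
            exact (hBout ℓ hℓB).1 hu
        exact pint_im_cuspSymbol_of_adjustable_odd V f hf hp5 hpN htors hcl hϖ γ₁ hc₁ hd₁ hr₁ h4₁ hsq₁ hγB₁
      rcases Nat.lt_or_ge 7 p with h7 | h7
      · obtain ⟨γ₁, γ₂, hmul, hA₁, hA₂, hBout⟩ :=
          exists_eq_mul_adjustableL hpP hp5 hpN1 (γ ^ 4) hc4 h3 h4' B
            (fun ℓ ↦ (ℓ : ZMod p) / (V.LFunction ℓ : ZMod p) = -1) hB hγB4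
        exact ⟨γ₁, γ₂, hmul, key γ₁ hA₁ (fun ℓ hℓ ↦ (hBout ℓ hℓ).1) (Or.inl h7),
          key γ₂ hA₂ (fun ℓ hℓ ↦ (hBout ℓ hℓ).2) (Or.inl h7)⟩
      · have hp57 : p = 5 ∨ p = 7 := by
          rcases (show p = 5 ∨ p = 6 ∨ p = 7 by omega) with h | h | h
          · exact Or.inl h
          · exfalso; rw [h] at hpP; norm_num at hpP
          · exact Or.inr h
        have hd4p : ∃ d0 : ZMod p, d0 ≠ 0 ∧
            ((((γ ^ 4 : Gamma0 N) : SL(2, ℤ)) 1 1 : ℤ) : ZMod p) = d0 ^ 4 :=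
          pow_four_entry_eq_pow_four γ hpP (hγc p (Nat.mem_primeFactors.mpr ⟨hpP, hpN1, hN0⟩))
        obtain ⟨γ₁, γ₂, hmul, hA₁, hA₂, hBout, hsq₁, hsq₂⟩ :=
          exists_eq_mul_adjustable57 hpP hp57 hpN1 (γ ^ 4) hc4 hd4p h3 h4' B
            (fun ℓ ↦ (ℓ : ZMod p) / (V.LFunction ℓ : ZMod p) = -1) hB hγB4
        exact ⟨γ₁, γ₂, hmul, key γ₁ hA₁ (fun ℓ hℓ ↦ (hBout ℓ hℓ).1) (Or.inr hsq₁),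
          key γ₂ hA₂ (fun ℓ hℓ ↦ (hBout ℓ hℓ).2) (Or.inr hsq₂)⟩
    have hsum : cuspSymbol f γ₁ + cuspSymbol f γ₂ = 4 * cuspSymbol f γ := by
      rw [← h4, hmul, cuspSymbol_mul_holds f]
    have him : (((cuspSymbol f γ₁).im : ℝ) : ℂ) / (V.imaginaryPeriodRat : ℂ) +
        (((cuspSymbol f γ₂).im : ℝ) : ℂ) / (V.imaginaryPeriodRat : ℂ) =
        ((4 : ℕ) : ℂ) * ((((cuspSymbol f γ).im : ℝ) : ℂ) / (V.imaginaryPeriodRat : ℂ)) := by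
      have := congrArg Complex.im hsum
      rw [Complex.add_im] at this
      rw [← add_div, ← Complex.ofReal_add, this]
      simp [Complex.mul_im]
      ring
    refine pint_of_pint_natCast_mul hpP hp4 ?_
    rw [← him]
    exact pint_add hpP hP₁ hP₂

/-- **The odd member lever, core form**: for ONE curve `V` with newform `f` at a level `N` with `p² ∣ N`
(`p ≥ 5`), the member clause `MemberOddClause V f p` (+ no `p`-torsion over `ℚ_p` when `p ≤ 7`) forces
`ord_p(Ω⁻_f / Ω⁻(V)) ≥ 0`: every `Im {∞, γ∞}_f / Ω⁻(V)` is `p`-integral (`pint_im_cuspSymbol_odd`) and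
`im Λ_f = ℤ · Ω⁻_f/2` (Cremona §2.8). [cite: Manin1972, Thm. 1.6] [cite: CremonaAlgorithms1997, §2.8 (p. 26)] -/
theorem oddMemberLever_core (V : WeierstrassCurve ℚ) [V.IsElliptic] {N : ℕ} [NeZero N]
    (f : CuspForm (Gamma0 N) 2) (hf : IsNewformOf V f) (hp5 : 5 ≤ p) (hpN : p ^ 2 ∣ N)
    (htors : p ≤ 7 → ∀ P : (V.baseChange ℚ_[p]).toAffine.Point, p • P = 0 → P = 0)
    (hcl : MemberOddClause V f p)
    (ϖ : ℚ) (hϖ : (ϖ : ℝ) * V.imaginaryPeriodRat = minusPeriod f) : 0 ≤ padicValRat p ϖ := by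
  have hpP : p.Prime := hp.out
  have hp2 : p ≠ 2 := by omega
  have hΩf : 0 < minusPeriod f := IsNewform0.minusPeriod_pos_holds hf.1 hf.coeffField_eq_bot
  have hΩ : 0 < V.imaginaryPeriodRat := V.imaginaryPeriodRat_pos
  -- `Ω⁻_f/2 = Im {∞, γ∞}_f` for some `γ`
  have hmem : minusPeriod f / 2 ∈ imagPeriods f := by
    rw [SkinnerUrban2014.imagPeriods_eq_zmultiples_of_minusPeriod_pos f hΩf]
    exact AddSubgroup.mem_zmultiples _
  obtain ⟨z, hz, hzim⟩ := AddSubgroup.mem_map.mp hmem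
  have hz' : z ∈ (periodLattice f : Set ℂ) := hz
  rw [coe_periodLattice_eq_range] at hz'
  obtain ⟨γ, hγ⟩ := hz'
  have hP := pint_im_cuspSymbol_odd V f hf hp5 hpN htors hcl hϖ γ
  rw [hγ] at hP
  have hzim' : z.im = minusPeriod f / 2 := hzim
  -- `Im z / Ω⁻(V) = ϖ/2`
  have hq : (((z.im : ℝ) : ℂ) / (V.imaginaryPeriodRat : ℂ)) = ((ϖ / 2 : ℚ) : ℂ) := by
    rw [hzim', ← hϖ]
    have hΩ0 : (V.imaginaryPeriodRat : ℂ) ≠ 0 := by exact_mod_cast hΩ.ne'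
    push_cast
    field_simp
  rw [hq] at hP
  have hval := padicValRat_nonneg_of_pint hP
  have hϖ2 : padicValRat p (ϖ / 2) = padicValRat p ϖ := by
    have hϖ0 : ϖ ≠ 0 := by
      rintro h; rw [h, Rat.cast_zero, zero_mul] at hϖ; exact hΩf.ne' hϖ.symm
    rw [padicValRat.div hϖ0 two_ne_zero, show (2 : ℚ) = ((2 : ℕ) : ℚ) by norm_num, padicValRat.of_nat,
      padicValNat.eq_zero_of_not_dvd (fun h ↦ hp2 ((Nat.prime_dvd_prime_iff_eq hpP Nat.prime_two).mp h))]
    simp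
  rwa [hϖ2] at hval

end OddLever

/-- **`OddMemberLever` holds** (V#21i open content (i), PAID): bsd-wall's odd machine runs at the member `W_K`
(newform `f` transported along the isogeny `W ~ W_K`, `a_ℓ ∈ {0, ±1}` modularity-free), so the member's odd
Kato–Néron clause alone gives `ord_p(Ω⁻_f/Ω⁻(W_K)) ≥ 0`.  No `Irr`, no reduction-type input, no F″. -/
theorem oddMemberLever_holds : OddMemberLever := by
  intro W W_K _ _ _ N _ f p _ hf hiso hp5 hpN htors hcl ϖ hϖ
  have hL : W.LFunction = W_K.LFunction := hiso.LFunction_eq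
  have hfK : IsNewformOf W_K f := ⟨hf.1, fun n ↦ by rw [hf.2 n, hL]⟩
  exact oddMemberLever_core W_K f hfK hp5 hpN htors hcl ϖ hϖ

/-! ## §9  (E1) from Katz 1981 Thm. 2 (PROVED in the tree) + Mazur's torsion theorem (named fact) + the receptacle -/

/-- **(E1) `NonAnomalousOfReceptacle` holds, granted Mazur's torsion theorem** (tree named fact
`mazur_torsion`, Mazur 1977 Thm. (8)).  If every prime `q ∤ N` were anomalous (`p ∣ q + 1 − a_q`), Katz 1981
Thm. 2 at level `p` off the finite set `N.primeFactors` — PROVED in the tree,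
`exists_isIsogenous_addOrderOf_eq_prime_pow_of_forall_dvd_lFunction_sub` — gives a `ℚ`-isogenous curve with a
rational point of order `p`; impossible for `p ≥ 11` (Mazur, `not_exists_addOrderOf_eq_of_mazur_torsion`) and,
for `p ∈ {5, 7}`, on a global minimal model of that curve (`hasGlobalMinimalModel_rat_holds`, `isIsogenous_smul`,
`VariableChange.pointEquiv`) it is a `ℚ_p`-point of order `p` (`Affine.Point.map_injective`) excluded by the
member receptacle.  [cite: Katz1980, Thm. 2] [cite: Mazur1977, Thm. (8)] [cite: KimNakamura, Cor. 2.4] -/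
theorem nonAnomalousOfReceptacle_of_no_prime_torsion
    (hno11 : ∀ (p : ℕ), p.Prime → 11 ≤ p → ∀ (V : WeierstrassCurve ℚ) [V.IsElliptic],
      ¬ ∃ Q : V.toAffine.Point, addOrderOf Q = p) :
    NonAnomalousOfReceptacle := by
  intro W _ p _ N hN0 hp5 hrec
  have hpP : p.Prime := Fact.out
  by_contra hno
  simp only [NonAnomalousPrime, not_exists, not_and, ne_eq, not_not] at hno
  -- Katz at level `p¹` off `S := N.primeFactors`
  have hS : ((N.primeFactors : Finset ℕ) : Set ℕ).Finite := N.primeFactors.finite_toSet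
  have hK := exists_isIsogenous_addOrderOf_eq_prime_pow_of_forall_dvd_lFunction_sub W p 1
    ((N.primeFactors : Finset ℕ) : Set ℕ) hS (by
      intro r hr hrp hrS _
      have hrN : ¬ r ∣ N := fun h ↦ hrS (Finset.mem_coe.mpr (Nat.mem_primeFactors.mpr ⟨hr, h, hN0⟩))
      have h0 := hno r hr hrN
      have h1 : ((W.LFunction r - (r + 1) : ℤ) : ZMod p) = 0 := by
        push_cast; linear_combination -h0
      rw [ZMod.intCast_zmod_eq_zero_iff_dvd] at h1
      simpa using h1)
  obtain ⟨a, b, hab, ⟨W', hW', hiso, Q, hQ⟩, ⟨W'', hW'', hiso', Q', hQ'⟩⟩ := hK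
  -- one of the two points has order exactly `p`
  obtain ⟨V, hV, hisoV, R, hR⟩ : ∃ (V : WeierstrassCurve ℚ) (_ : V.IsElliptic), IsIsogenous W V ∧
      ∃ R : V.toAffine.Point, addOrderOf R = p := by
    rcases Nat.eq_zero_or_pos a with ha | ha
    · exact ⟨W'', hW'', hiso', Q', by rw [hQ', show b = 1 by omega, pow_one]⟩
    · exact ⟨W', hW', hiso, Q, by rw [hQ, show a = 1 by omega, pow_one]⟩
  haveI := hV
  rcases hrec with h7 | h57
  · -- `p ≥ 11`: Mazur's torsion theorem
    have h11 : 11 ≤ p := by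
      by_contra h
      have h8 : p = 8 ∨ p = 9 ∨ p = 10 := by omega
      rcases h8 with rfl | rfl | rfl <;> norm_num at hpP
    exact hno11 p hpP h11 V ⟨R, hR⟩
  · -- `p ∈ {5, 7}`: a global minimal model of `V` carries a `ℚ_p`-point of order `p`
    obtain ⟨C, hC⟩ := hasGlobalMinimalModel_rat_holds V
    haveI := hC
    have hisoC : IsIsogenous W (C • V) := hisoV.trans' (isIsogenous_smul V C)
    set R' : (C • V).toAffine.Point := VariableChange.pointEquiv V C R with hR'def
    have hR' : addOrderOf R' = p := by
      rw [hR'def, AddEquiv.addOrderOf_eq]; exact hR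
    set R'' := Affine.Point.map (W' := (C • V).toAffine) (S := ℚ) (Algebra.ofId ℚ ℚ_[p]) R'
      with hR''def
    have hR'' : addOrderOf R'' = p := by
      rw [hR''def, addOrderOf_injective _ (Affine.Point.map_injective (W' := (C • V).toAffine)
        (f := Algebra.ofId ℚ ℚ_[p])) R']
      exact hR'
    have hp0 : p • R'' = 0 := by
      have := addOrderOf_nsmul_eq_zero R''
      rwa [hR''] at this
    have h0 : R'' = 0 := h57 (C • V) hisoC R'' hp0
    rw [h0, addOrderOf_zero] at hR''
    exact hpP.one_lt.ne hR''

/-- **(E1) granted Mazur's torsion theorem** in the tree's group form `mazur_torsion` (Mazur 1977, Thm. (8)).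
[cite: Mazur1977, Thm. (8)] [cite: Katz1980, Thm. 2] -/
theorem nonAnomalousOfReceptacle_of_mazur (hMT : ∀ V : WeierstrassCurve ℚ, mazur_torsion V) :
    NonAnomalousOfReceptacle :=
  nonAnomalousOfReceptacle_of_no_prime_torsion fun _ hp h11 V _ ↦
    not_exists_addOrderOf_eq_of_mazur_torsion V (hMT V) hp h11

/-- **(E1) granted the printed leaves of Mazur's theorem** (`Mazur1977_no_prime_torsion`: no rational point of
prime order `∉ {2,3,5,7,13}`, Mazur 1977 Ch. III §5; `MazurTate1973_no_torsion_thirteen`).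
[cite: Mazur1977, Ch. III §5, pp. 156–160] [cite: MazurTate1973, main theorem] [cite: Katz1980, Thm. 2] -/
theorem nonAnomalousOfReceptacle_of_mazur_leaves
    (h5 : ∀ V : WeierstrassCurve ℚ, Mazur1977_no_prime_torsion V)
    (h13 : ∀ V : WeierstrassCurve ℚ, MazurTate1973_no_torsion_thirteen V) :
    NonAnomalousOfReceptacle := by
  refine nonAnomalousOfReceptacle_of_no_prime_torsion fun p hp h11 V _ ↦ ?_
  by_cases hp13 : p = 13
  · subst hp13
    exact h13 V
  · refine h5 V p hp ?_
    simp only [Finset.mem_insert, Finset.mem_singleton, not_or]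
    omega

/-! ## §10  (E0-min): the restricted (E0) Props of record (the rev-7 scaffolding (E0a)/(E0b)/(E0b′) that lived here is
superseded by §12–§13 and was removed in rev 8; git rev 7 @7a4368ad6190) -/

open Field IsDedekindDomain.HeightOneSpectrum

/-- **(E0-min)** — (E0) restricted to what the assembly consumes: globally minimal members at a newform level `N` with
`p² ∣ N`. -/
def EisensteinCongruenceOfReducibleMin : Prop :=
  ∀ (W : WeierstrassCurve ℚ) [W.IsElliptic] [W.IsGloballyMinimal] {N : ℕ} [NeZero N]
    (f : CuspForm (Gamma0 N) 2) (p : ℕ) [Fact p.Prime], IsNewformOf W f → 5 ≤ p → p ^ 2 ∣ N →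
    ¬ W.HasIrreducibleModPGaloisRep p → EisensteinCongruence W p N

/-- (E0) ⇒ (E0-min) (the rev-3 cite-level Prop implies the restricted one). -/
theorem eisensteinCongruenceOfReducibleMin_of_reducible (hC : EisensteinCongruenceOfReducible) :
    EisensteinCongruenceOfReducibleMin :=
  fun W _ _ _ _ f p _ hf hp5 _ hred ↦ hC W f p hf hp5 hred

/-! ## §11  Support control: ramification of a primitive Dirichlet character is read off its level; THE isogeny
character of a stable line of `E[p]` as a primitive Dirichlet character (E0a′) -/

section SupportControl

/-- A Dirichlet character (any value ring) whose composite with the mod-`m` cyclotomic character is trivial on the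
inertia group of a prime of `ℤ̄` above `p` factors through the prime-to-`p` part of its level (verbatim the tree's
`factorsThrough_of_forall_mem_inertia`, there for `ℂ`-valued characters). [cite: Washington1997, Ch. 3 (p. 21)] -/
theorem factorsThrough_of_forall_mem_inertia' {R : Type*} [CommMonoidWithZero R] {m : ℕ} [NeZero m]
    (χ : DirichletCharacter R m) {p k d : ℕ} [Fact p.Prime] (hm : m = p ^ (k + 1) * d) (hd : ¬ p ∣ d)
    {v : HeightOneSpectrum (𝓞 ℚ)} (hv : Rat.HeightOneSpectrum.natGenerator v = p)
    {𝔓 : Ideal (absIntegers (𝓞 ℚ) ℚ)} (h𝔓 : 𝔓 ∈ v.primesAbove)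
    (hψ : ∀ τ ∈ 𝔓.inertia (absoluteGaloisGroup ℚ),
      χ ((modNCyclotomicCharacter ℚ m τ : (ZMod m)ˣ) : ZMod m) = 1) :
    χ.FactorsThrough d := by
  rw [DirichletCharacter.factorsThrough_iff_ker_unitsMap (Dvd.intro_left _ hm.symm)]
  intro a ha
  rw [MonoidHom.mem_ker] at ha ⊢
  obtain ⟨τ, hτ, hτa⟩ := exists_mem_inertia_modNCyclotomicCharacter_eq hm hd hv h𝔓 ha
  have h := hψ τ hτ
  rw [hτa] at h
  ext
  rw [MulChar.coe_toUnitHom, h, Units.val_one]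

/-- Ramification is read off the level of a PRIMITIVE character (verbatim the tree's
`not_dvd_level_of_isPrimitive_of_forall_mem_inertia`, any value ring). [cite: Washington1997, Ch. 3 (pp. 19–21)] -/
theorem not_dvd_level_of_forall_mem_inertia' {R : Type*} [CommMonoidWithZero R] {m : ℕ} [NeZero m]
    {χ : DirichletCharacter R m} (hχ : χ.IsPrimitive) {p : ℕ} (hp : p.Prime)
    {v : HeightOneSpectrum (𝓞 ℚ)} (hv : (p : 𝓞 ℚ) ∈ v.asIdeal)
    {𝔓 : Ideal (absIntegers (𝓞 ℚ) ℚ)} (h𝔓 : 𝔓 ∈ v.primesAbove)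
    (hψ : ∀ τ ∈ 𝔓.inertia (absoluteGaloisGroup ℚ),
      χ ((modNCyclotomicCharacter ℚ m τ : (ZMod m)ˣ) : ZMod m) = 1) :
    ¬ p ∣ m := by
  haveI : Fact p.Prime := ⟨hp⟩
  intro hpm
  obtain ⟨e, d, hd, hm⟩ := Nat.exists_eq_pow_mul_and_not_dvd (NeZero.ne m) p hp.ne_one
  have he : e ≠ 0 := by
    rintro rfl
    rw [pow_zero, one_mul] at hm
    exact hd (hm ▸ hpm)
  obtain ⟨k, rfl⟩ := Nat.exists_eq_succ_of_ne_zero he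
  have hfac := factorsThrough_of_forall_mem_inertia' χ hm hd
    (natGenerator_eq_of_natCast_mem_asIdeal hp hv) h𝔓 hψ
  have hcond : χ.conductor ∣ d := DirichletCharacter.conductor_dvd_of_mem_conductorSet χ hfac
  rw [hχ] at hcond
  exact hd (hpm.trans hcond)

/-- **The isogeny character as a primitive Dirichlet character.**  For `E/ℚ` in global minimal form with `E[p]`
reducible: a point `T ≠ 0` of `E[p]` spanning a `Γ_ℚ`-stable line, its isogeny character `r`, and a PRIMITIVE Dirichlet
character `φ : (ℤ/N)ˣ → 𝔽_pˣ` with `φ(χ_N(σ)) = r(σ)` for all `σ ∈ Γ_ℚ` (Kronecker–Weber, proved in the tree).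
[cite: Mazur1978, §5 p. 148] [cite: Washington1997, Thm. 14.1 and Ch. 3] -/
theorem exists_isogenyCharacter_dirichlet (W : WeierstrassCurve ℚ) [W.IsElliptic] [W.IsGloballyMinimal] (p : ℕ)
    [Fact p.Prime] (hred : ¬ W.HasIrreducibleModPGaloisRep p) :
    ∃ (T : geomTorsion W (p : ℤ)) (r : absoluteGaloisGroup ℚ →* (ZMod p)ˣ) (N : ℕ) (_ : NeZero N)
      (φ : DirichletCharacter (ZMod p) N), T ≠ 0 ∧
      (∀ σ : absoluteGaloisGroup ℚ, σ • T = ((r σ : (ZMod p)ˣ) : ZMod p).val • T) ∧ φ.IsPrimitive ∧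
      ∀ σ : absoluteGaloisGroup ℚ,
        φ ((modNCyclotomicCharacter ℚ N σ : (ZMod N)ˣ) : ZMod N) = ((r σ : (ZMod p)ˣ) : ZMod p) := by
  have hp : p.Prime := Fact.out
  haveI : NeZero p := ⟨hp.ne_zero⟩
  -- (1) a stable line `H ≤ E[p]` of order `p` and a generator `T`
  unfold WeierstrassCurve.HasIrreducibleModPGaloisRep at hred
  push Not at hred
  obtain ⟨H, hstab, hbot, htop⟩ := hred
  have hcardE : Nat.card (geomTorsion W (p : ℤ)) = p ^ 2 := W.natCard_geomTorsion_prime_eq_sq hp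
  haveI : Finite (geomTorsion W (p : ℤ)) :=
    Nat.finite_of_card_ne_zero (by rw [hcardE]; exact pow_ne_zero 2 hp.ne_zero)
  have hcardH : Nat.card H = p := by
    obtain ⟨k, hk, hcard⟩ :=
      (Nat.dvd_prime_pow hp).mp (hcardE ▸ AddSubgroup.card_addSubgroup_dvd_card H)
    interval_cases k
    · exact absurd (AddSubgroup.card_eq_one.mp (by simpa using hcard)) hbot
    · simpa using hcard
    · exact absurd (AddSubgroup.eq_top_of_card_eq H (by rw [hcard, hcardE])) htop
  obtain ⟨T, hTH, hT0⟩ : ∃ T : geomTorsion W (p : ℤ), T ∈ H ∧ T ≠ 0 := by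
    by_contra h
    push Not at h
    exact hbot ((AddSubgroup.eq_bot_iff_forall H).mpr h)
  obtain ⟨-, hgen⟩ := addOrderOf_eq_and_zmultiples_eq_of_card_prime H hp hcardH hTH hT0
  have hst : ∀ σ : absoluteGaloisGroup ℚ, σ • T ∈ AddSubgroup.zmultiples T := fun σ ↦ by
    rw [hgen]; exact hstab σ T hTH
  -- (2) the isogeny character `r`
  obtain ⟨r, hr⟩ := Mazur1978.exists_isogenyCharacter W p hT0 hst
  -- (3) `ker r` is open (it contains the stabiliser of `T`)
  have hker : IsOpen ((r.ker : Subgroup (absoluteGaloisGroup ℚ)) : Set (absoluteGaloisGroup ℚ)) := by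
    refine Subgroup.isOpen_mono (H₁ := MulAction.stabilizer (absoluteGaloisGroup ℚ) (T : geomPoints W))
      ?_ (W.isOpen_stabilizer_point_holds (T : geomPoints W))
    intro σ hσ
    rw [MulAction.mem_stabilizer_iff] at hσ
    rw [MonoidHom.mem_ker]
    have hfix : ((r σ : (ZMod p)ˣ) : ZMod p).val • T = T := by
      rw [← hr σ]
      exact Subtype.ext (by rw [AddSubgroup.torsionBy.coe_smul]; exact hσ)
    exact Units.ext (Mazur1978.eq_one_of_val_smul_eq W p hT0 hfix)
  -- (4) Kronecker–Weber: `r = χ₀ ∘ χ_m`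
  obtain ⟨m, hm, hfixm⟩ :=
    exists_forall_smul_eq_self_imp_eq_one_of_isKroneckerWeber KroneckerWeber_holds r hker
  haveI : NeZero m := ⟨hm.ne'⟩
  set c : absoluteGaloisGroup ℚ →* (ZMod m)ˣ := modNCyclotomicCharacter ℚ m with hcdef
  have hle : c.ker ≤ r.ker := by
    intro σ hσ
    rw [MonoidHom.mem_ker] at hσ ⊢
    refine hfixm σ fun ζ hζ => ?_
    rw [modNCyclotomicCharacter_spec ℚ m σ ζ hζ, ← hcdef, hσ, Units.val_one]
    rcases Nat.lt_or_ge 1 m with h1 | h1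
    · rw [ZMod.val_one'' h1.ne', pow_one]
    · have hm1 : m = 1 := le_antisymm h1 hm
      subst hm1
      rw [pow_one] at hζ
      rw [hζ, one_pow]
  have hsurj : Function.Surjective c := modNCyclotomicCharacter_rat_surjective m
  have hs : Function.RightInverse (Function.surjInv hsurj) c := Function.rightInverse_surjInv hsurj
  set χ₀ : (ZMod m)ˣ →* (ZMod p)ˣ :=
    MonoidHom.liftOfRightInverse c (Function.surjInv hsurj) hs ⟨r, hle⟩ with hχ₀
  have hχ₀c : ∀ σ, χ₀ (c σ) = r σ := fun σ =>
    MonoidHom.liftOfRightInverse_comp_apply c (Function.surjInv hsurj) hs ⟨r, hle⟩ σ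
  set φ : DirichletCharacter (ZMod p) m := MulChar.ofUnitHom χ₀ with hφdef
  haveI : NeZero φ.conductor := ⟨φ.conductor_ne_zero⟩
  refine ⟨T, r, φ.conductor, inferInstance, φ.primitiveCharacter, hT0, hr, φ.primitiveCharacter_isPrimitive,
    fun σ ↦ ?_⟩
  have h := φ.primitiveCharacter.changeLevel_toUnitHom φ.conductor_dvd_level
  rw [DirichletCharacter.changeLevel_primitiveCharacter] at h
  calc φ.primitiveCharacter ((modNCyclotomicCharacter ℚ φ.conductor σ : (ZMod φ.conductor)ˣ) : ZMod φ.conductor)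
      = ((φ.primitiveCharacter.toUnitHom (modNCyclotomicCharacter ℚ φ.conductor σ) : (ZMod p)ˣ) : ZMod p) :=
        (MulChar.coe_toUnitHom _ _).symm
    _ = ((φ.primitiveCharacter.toUnitHom (ZMod.unitsMap φ.conductor_dvd_level (c σ)) : (ZMod p)ˣ) : ZMod p) := by
        rw [unitsMap_modNCyclotomicCharacter ℚ φ.conductor_dvd_level σ]
    _ = ((φ.toUnitHom (c σ) : (ZMod p)ˣ) : ZMod p) := by rw [h]; rfl
    _ = φ ((c σ : (ZMod m)ˣ) : ZMod m) := MulChar.coe_toUnitHom _ _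
    _ = ((χ₀ (c σ) : (ZMod p)ˣ) : ZMod p) := MulChar.ofUnitHom_coe _ _
    _ = ((r σ : (ZMod p)ˣ) : ZMod p) := by rw [hχ₀c]

end SupportControl

/-! ## §12  (E0a″): THE isogeny character is unramified at the MULTIPLICATIVE primes too and tame at `p`;
(E0b″) `IsogenyCharacterLevelBound` stated (the rev-7 residue; OFF the proof path since rev 8, §13) -/

section LevelBound

open Literature.NumberTheory.EllipticCurves.ModularForms CongruenceSubgroup
open scoped MatrixGroups

/-- **The isogeny character is unramified at a prime `ℓ ≠ p` of MULTIPLICATIVE reduction** (global minimal model):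
the inertia at `ℓ` acts unipotently on `E[p]` (Tate curve; tree `smul_smul_sub_eq_of_mem_inertia_geomPoints`), so on
the stable line `⟨T⟩` the scalar `u = r(τ)` satisfies `(u − 1)² T = 0`, i.e. `u = 1`.
[cite: Serre1972, §5.4 proof of Prop. 21; SilvermanAEC2009, V.5 / C.14] -/
theorem isogenyCharacter_eq_one_of_mem_inertia_of_mult (W : WeierstrassCurve ℚ) [W.IsElliptic]
    [W.IsGloballyMinimal] (p : ℕ) [Fact p.Prime] {T : geomTorsion W (p : ℤ)} (hT0 : T ≠ 0)
    {r : absoluteGaloisGroup ℚ →* (ZMod p)ˣ}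
    (hr : ∀ σ : absoluteGaloisGroup ℚ, σ • T = ((r σ : (ZMod p)ˣ) : ZMod p).val • T)
    {v : HeightOneSpectrum (𝓞 ℚ)} (hmult : W.HasMultiplicativeReductionAt v) (hpv : (p : 𝓞 ℚ) ∉ v.asIdeal)
    {𝔓 : Ideal (absIntegers (𝓞 ℚ) ℚ)} (h𝔓 : 𝔓 ∈ v.primesAbove)
    {τ : absoluteGaloisGroup ℚ} (hτ : τ ∈ 𝔓.inertia (absoluteGaloisGroup ℚ)) : r τ = 1 := by
  have hp : p.Prime := Fact.out
  -- `p • T = 0`, `addOrderOf T = p`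
  have hpT : (p : ℤ) • T = 0 := Subtype.ext (by
    rw [AddSubgroupClass.coe_zsmul, ZeroMemClass.coe_zero]
    exact (mem_torsionPoints_iff _ _ (T : geomPoints W)).mp T.2)
  have hord : addOrderOf T = p := by
    have h1 : addOrderOf T ∣ p := by
      have h := addOrderOf_dvd_iff_zsmul_eq_zero.mpr hpT
      exact_mod_cast h
    rcases (Nat.dvd_prime hp).mp h1 with h | h
    · exact absurd (AddMonoid.addOrderOf_eq_one_iff.mp h) hT0
    · exact h
  -- unipotence of `τ` on `E[p]`, read on `T`
  have hQ : p ^ 1 • (T : geomPoints W) = 0 := by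
    rw [pow_one]
    have h := (mem_torsionPoints_iff _ _ (T : geomPoints W)).mp T.2
    rwa [natCast_zsmul] at h
  have hunip : τ • (τ • T - T) = τ • T - T := by
    have h := W.smul_smul_sub_eq_of_mem_inertia_geomPoints hmult hp hpv le_rfl h𝔓 hτ hQ
    exact Subtype.ext (by
      simpa only [AddSubgroup.torsionBy.coe_smul, AddSubgroupClass.coe_sub] using h)
  set k : ℤ := (((r τ : (ZMod p)ˣ) : ZMod p).val : ℤ) with hk
  have hτT : τ • T = k • T := by rw [hr τ, hk, natCast_zsmul]
  rw [hτT, smul_sub, smul_comm τ k T, hτT] at hunip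
  have h0 : ((k - 1) ^ 2) • T = 0 := by
    calc ((k - 1) ^ 2) • T = (k • k • T - k • T) - (k • T - T) := by rw [smul_smul]; module
      _ = 0 := sub_eq_zero.mpr hunip
  -- `p ∣ (k - 1)²`, so `p ∣ k - 1`, so `r τ = 1`
  have hdvd : (p : ℤ) ∣ (k - 1) ^ 2 := by
    have h := addOrderOf_dvd_iff_zsmul_eq_zero.mpr h0
    rwa [hord] at h
  have hdvd' : (p : ℤ) ∣ k - 1 := (Nat.prime_iff_prime_int.mp hp).dvd_of_dvd_pow hdvd
  have hk1 : ((k - 1 : ℤ) : ZMod p) = 0 := (ZMod.intCast_zmod_eq_zero_iff_dvd _ _).mpr hdvd'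
  rw [Int.cast_sub, Int.cast_one, sub_eq_zero, hk, Int.cast_natCast, ZMod.natCast_zmod_val] at hk1
  exact Units.val_eq_one.mp hk1


/-- **The isogeny character is TAME at `p`: `p² ∤` the level of the primitive Eisenstein character.**  On the inertia
at `p`, `r = χ̄_pᵏ` (Mazur 1978 Lemma 5.2 over `ℚ`, tree `Mazur1978.exists_eq_modNCyclotomicCharacter_pow_of_mem_inertia`);
hence `φ` kills every unit `≡ 1 (mod pd)` of `(ℤ/m)ˣ`, `m = pᵉd`, `p ∤ d` (such units are `χ_m(τ)` for inertia
elements `τ` at `p`, tree `exists_mem_inertia_modNCyclotomicCharacter_eq`), so `φ` factors through `pd` and, being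
primitive, `m ∣ pd`. [cite: Mazur1978, §5 Lemma 5.2] [cite: Serre1972, §1.11–1.12] [cite: Washington1997, Ch. 3] -/
theorem not_sq_dvd_level_of_isPrimitive (W : WeierstrassCurve ℚ) [W.IsElliptic] (p : ℕ) [Fact p.Prime]
    {T : geomTorsion W (p : ℤ)} (hT0 : T ≠ 0) {m : ℕ} [NeZero m] {φ : DirichletCharacter (ZMod p) m}
    (hprim : φ.IsPrimitive)
    (hr : ∀ σ : absoluteGaloisGroup ℚ,
      σ • T = (φ ((modNCyclotomicCharacter ℚ m σ : (ZMod m)ˣ) : ZMod m)).val • T) :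
    ¬ p ^ 2 ∣ m := by
  have hp : p.Prime := Fact.out
  haveI : NeZero p := ⟨hp.ne_zero⟩
  intro h2
  -- the Galois character `r = φ ∘ χ_m`
  set r : absoluteGaloisGroup ℚ →* (ZMod p)ˣ := φ.toUnitHom.comp (modNCyclotomicCharacter ℚ m) with hrdef
  have hr' : ∀ σ : absoluteGaloisGroup ℚ, σ • T = ((r σ : (ZMod p)ˣ) : ZMod p).val • T := fun σ ↦ by
    rw [hr σ, hrdef, MonoidHom.comp_apply, MulChar.coe_toUnitHom]
  have hker := Mazur1978.isOpen_ker_of_smul_eq W p hT0 hr'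
  obtain ⟨k, hk⟩ := Mazur1978.exists_eq_modNCyclotomicCharacter_pow_of_mem_inertia p r hker
  -- `m = p^{e'+1} d`, `p ∤ d`, `e' + 1 ≥ 2`
  obtain ⟨e, d, hd, hm⟩ := Nat.exists_eq_pow_mul_and_not_dvd (NeZero.ne m) p hp.ne_one
  haveI : NeZero d := ⟨fun h0 ↦ NeZero.ne m (by rw [hm, h0, mul_zero])⟩
  have he : 2 ≤ e := by
    have h : p ^ 2 ∣ p ^ e := by
      refine Nat.Coprime.dvd_of_dvd_mul_right ?_ (hm ▸ h2)
      exact Nat.Coprime.pow_left 2 ((Nat.Prime.coprime_iff_not_dvd hp).mpr hd)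
    exact (Nat.pow_dvd_pow_iff_le_right hp.one_lt).mp h
  obtain ⟨e', rfl⟩ : ∃ e', e = e' + 1 := ⟨e - 1, by omega⟩
  have hpd : p * d ∣ m := ⟨p ^ e', by rw [hm]; ring⟩
  have hdm : d ∣ m := Dvd.intro_left _ hm.symm
  have hpm : p ∣ m := (dvd_mul_right p d).trans hpd
  -- the place of `ℚ` at `p` and a prime of `ℤ̄` above it
  set vp : HeightOneSpectrum (𝓞 ℚ) := (Rat.HeightOneSpectrum.primesEquiv (R := 𝓞 ℚ)).symm ⟨p, hp⟩ with hvpdef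
  have hgen : Rat.HeightOneSpectrum.natGenerator vp = p := by
    change ((Rat.HeightOneSpectrum.primesEquiv vp : Nat.Primes) : ℕ) = p
    rw [hvpdef, Equiv.apply_symm_apply]
  have hvp : (p : 𝓞 ℚ) ∈ vp.asIdeal := by
    have h := Mazur1978.natCast_natGenerator_mem_asIdeal vp
    rwa [hgen] at h
  obtain ⟨𝔓, h𝔓⟩ := vp.primesAbove_nonempty
  -- `φ` factors through `p d`
  have hfac : φ.FactorsThrough (p * d) := by
    rw [DirichletCharacter.factorsThrough_iff_ker_unitsMap hpd]
    intro a ha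
    rw [MonoidHom.mem_ker] at ha ⊢
    have had : ZMod.unitsMap hdm a = 1 := by
      have h := congrArg (ZMod.unitsMap (Dvd.intro_left p rfl : d ∣ p * d)) ha
      rw [map_one, ← MonoidHom.comp_apply, ZMod.unitsMap_comp] at h
      exact h
    have hap : ZMod.unitsMap hpm a = 1 := by
      have h := congrArg (ZMod.unitsMap (dvd_mul_right p d)) ha
      rw [map_one, ← MonoidHom.comp_apply, ZMod.unitsMap_comp] at h
      exact h
    obtain ⟨τ, hτ, hτa⟩ := exists_mem_inertia_modNCyclotomicCharacter_eq hm hd hgen h𝔓 had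
    have h1 : r τ = 1 := by
      rw [hk vp hvp 𝔓 h𝔓 τ hτ, ← unitsMap_modNCyclotomicCharacter ℚ hpm τ, hτa, hap, one_pow]
    rw [hrdef, MonoidHom.comp_apply, hτa] at h1
    exact h1
  have hcond : φ.conductor ∣ p * d := DirichletCharacter.conductor_dvd_of_mem_conductorSet φ hfac
  rw [hprim, hm] at hcond
  have h3 : p ^ (e' + 1) ∣ p := Nat.dvd_of_mul_dvd_mul_right (NeZero.pos d) hcond
  have h4 : p ^ 2 ∣ p ^ 1 := (pow_dvd_pow p he).trans ((pow_one p).symm ▸ h3)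
  have h5 := (Nat.pow_dvd_pow_iff_le_right hp.one_lt).mp h4
  omega

/-- **(E0a″)** — (E0a′) sharpened: the PRIMITIVE Eisenstein character `φ` of `E[p]` (global minimal model, `E[p]`
reducible) has level divisible only by `p` and by primes of ADDITIVE reduction, and carries the congruence at the good
`q ∤ pm`; moreover it IS the isogeny character of a stable line (`σT = φ(χ_m σ)T`). -/
theorem exists_isogenyCharacter_dirichlet_additive (W : WeierstrassCurve ℚ) [W.IsElliptic]
    [W.IsGloballyMinimal] (p : ℕ) [Fact p.Prime] (hred : ¬ W.HasIrreducibleModPGaloisRep p) :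
    ∃ (T : geomTorsion W (p : ℤ)) (m : ℕ) (_ : NeZero m) (φ : DirichletCharacter (ZMod p) m), T ≠ 0 ∧
      φ.IsPrimitive ∧
      (∀ σ : absoluteGaloisGroup ℚ,
        σ • T = (φ ((modNCyclotomicCharacter ℚ m σ : (ZMod m)ˣ) : ZMod m)).val • T) ∧
      ¬ p ^ 2 ∣ m ∧
      (∀ (ℓ : ℕ) [Fact ℓ.Prime], ℓ ∣ m → ℓ ≠ p →
        ¬ W.HasGoodReductionAtPrime ℓ ∧ ¬ W.HasMultiplicativeReductionAtPrime ℓ) ∧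
      ∀ (q : ℕ) [Fact q.Prime], q ≠ p → ¬ q ∣ m → W.HasGoodReductionAtPrime q →
        (W.LFunction q : ZMod p) = φ (q : ZMod m) + (q : ZMod p) * (φ (q : ZMod m))⁻¹ := by
  have hp : p.Prime := Fact.out
  haveI : NeZero p := ⟨hp.ne_zero⟩
  obtain ⟨T, r, N, hN, φ, hT0, hr, hprim, hkey⟩ := exists_isogenyCharacter_dirichlet W p hred
  have hr' : ∀ σ : absoluteGaloisGroup ℚ,
      σ • T = (φ ((modNCyclotomicCharacter ℚ N σ : (ZMod N)ˣ) : ZMod N)).val • T := fun σ ↦ by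
    rw [hkey σ]; exact hr σ
  refine ⟨T, N, hN, φ, hT0, hprim, hr', not_sq_dvd_level_of_isPrimitive W p hT0 hprim hr',
    fun ℓ _ hℓN hℓp ↦ ?_, fun q _ hqp hqN hgood ↦ ?_⟩
  · -- support: good or multiplicative `ℓ ≠ p` cannot divide the level of the primitive `φ`
    have hℓ : ℓ.Prime := Fact.out
    obtain ⟨v, hvℓ⟩ : ∃ v : HeightOneSpectrum (𝓞 ℚ), ((Rat.HeightOneSpectrum.primesEquiv v : Nat.Primes) : ℕ) = ℓ :=
      ⟨(Rat.HeightOneSpectrum.primesEquiv (R := 𝓞 ℚ)).symm ⟨ℓ, hℓ⟩, by rw [Equiv.apply_symm_apply]⟩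
    have hv : (ℓ : 𝓞 ℚ) ∈ v.asIdeal := by
      rw [DeuringLadic.natCast_mem_asIdeal_iff v ℓ, hvℓ]
    have hpv : (p : 𝓞 ℚ) ∉ v.asIdeal := by
      intro h
      have h' := (DeuringLadic.natCast_mem_asIdeal_iff v p).mp h
      rw [hvℓ] at h'
      exact hℓp ((Nat.prime_dvd_prime_iff_eq hℓ hp).mp h')
    obtain ⟨𝔓, h𝔓⟩ := v.primesAbove_nonempty
    have key : ∀ (hI : ∀ τ ∈ 𝔓.inertia (absoluteGaloisGroup ℚ), r τ = 1), False := fun hI ↦ by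
      have hψ : ∀ τ ∈ 𝔓.inertia (absoluteGaloisGroup ℚ),
          φ ((modNCyclotomicCharacter ℚ N τ : (ZMod N)ˣ) : ZMod N) = 1 := by
        intro τ hτ
        rw [hkey τ, hI τ hτ, Units.val_one]
      exact not_dvd_level_of_forall_mem_inertia' hprim hℓ hv h𝔓 hψ hℓN
    refine ⟨fun hgoodℓ ↦ key fun τ hτ ↦ ?_, fun hmultℓ ↦ key fun τ hτ ↦ ?_⟩
    · have hgood : W.HasGoodReductionAt v :=
        (hasGoodReductionAtPrime_primesEquiv_iff_holds W v ℓ hvℓ).mp hgoodℓ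
      exact Mazur1978.isogenyCharacter_eq_one_of_mem_inertia W p hT0 hr hgood hpv h𝔓 hτ
    · subst hvℓ
      have hmult : W.HasMultiplicativeReductionAt v :=
        (WeierstrassCurve.hasMultiplicativeReductionAtPrime_iff_hasMultiplicativeReductionAt_ringOfIntegers
          W v).mp hmultℓ
      exact isogenyCharacter_eq_one_of_mem_inertia_of_mult W p hT0 hr hmult hpv h𝔓 hτ
  · -- the congruence at a good prime `q ∤ pN` (as in (E0a′))
    have hq : q.Prime := Fact.out
    set v : HeightOneSpectrum (𝓞 ℚ) :=
      (Rat.HeightOneSpectrum.primesEquiv (R := 𝓞 ℚ)).symm ⟨q, hq⟩ with hvdef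
    have hvq : (Rat.HeightOneSpectrum.primesEquiv v : ℕ) = q := by
      rw [hvdef, Equiv.apply_symm_apply]
    have hv : (q : 𝓞 ℚ) ∈ v.asIdeal := by
      rw [DeuringLadic.natCast_mem_asIdeal_iff v q, hvq]
    obtain ⟨𝔓, h𝔓⟩ := v.primesAbove_nonempty
    obtain ⟨Fr, hFr⟩ := exists_isArithFrobAt_of_mem_primesAbove_holds (v := v) h𝔓
    have hrel := Mazur1978.isogenyCharacter_sq_sub_frobeniusTrace_mul_add_eq_zero W p q hqp hgood
      hT0 hr hv h𝔓 hFr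
    have hvN : ¬ ((Rat.HeightOneSpectrum.primesEquiv v : Nat.Primes) : ℕ) ∣ N := by
      rw [hvq]; exact hqN
    have hcq : ((modNCyclotomicCharacter ℚ N Fr : (ZMod N)ˣ) : ZMod N) = q := by
      rw [modNCyclotomicCharacter_eq_residueCard_of_isArithFrobAt h𝔓
        (Rat.natCast_not_mem_of_mem_primesAbove_of_not_dvd h𝔓 hvN) hFr,
        FramedRep.residueCard_eq_coe_primesEquiv', hvq]
    have hφq : φ (q : ZMod N) = ((r Fr : (ZMod p)ˣ) : ZMod p) := by
      rw [← hcq, hkey]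
    rw [hφq, W.LFunction_apply_prime_eq_frobeniusTrace q hgood]
    have hu : ((r Fr : (ZMod p)ˣ) : ZMod p) * (((r Fr)⁻¹ : (ZMod p)ˣ) : ZMod p) = 1 := by
      rw [← Units.val_mul, mul_inv_cancel, Units.val_one]
    rw [← Units.val_inv_eq_inv_val]
    linear_combination (-((((r Fr)⁻¹ : (ZMod p)ˣ) : ZMod p))) * hrel
      - ((W.frobeniusTrace q : ZMod p) - ((r Fr : (ZMod p)ˣ) : ZMod p)) * hu

/-- **(E0b″) LEVEL BOUND FOR THE ISOGENY CHARACTER — the cite-level residue of rev 7; OFF the proof path since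
rev 8 (§13 discharges the even lever's need for it; kept as a statement of record, true by Serre 1987 / Carayol 1986).**  For `E/ℚ` in global minimal
form with a weight-2 newform `f` of level `N` (`p ≥ 5`, `p² ∣ N`) and a PRIMITIVE Dirichlet character `φ : (ℤ/m)ˣ → 𝔽_pˣ`
which IS the isogeny character of a stable line of `E[p]` (`σT = φ(χ_m σ) T`): at every prime `ℓ ≠ p` of ADDITIVE
reduction, `v_ℓ(m) ≤ v_ℓ(N)`.  (At good and multiplicative `ℓ ≠ p`, `v_ℓ(m) = 0`, and at `p`, `v_p(m) ≤ 1 < 2 ≤ v_p(N)`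
(tameness), are PROVED above — so this is exactly what is missing for `m ∣ N`.)  Truth: at additive `ℓ ≠ p`, `v_ℓ(cond φ) + v_ℓ(cond ωφ⁻¹) ≤ a_ℓ(ρ̄_{E,p}) ≤ v_ℓ(N_E) = v_ℓ(N)` (Artin exponents do not grow
under semisimplification; `N(ρ̄) ∣ N(ρ)`, Serre 1987 (4.6.3) / Carayol 1986; `N = N_E` primewise in support by
`IsNewformOf.dvd_level_iff_dvd_conductorNorm`, with exponents by Carayol's `N_f = N_E`).
[cite: Serre1987, (1.2), (4.6.3)] [cite: Carayol1986, Thm. (A)] [cite: Serre1972, §1.11–1.12] [cite: DDT1995, Lemma 2.6, Thm. 3.1] -/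
def IsogenyCharacterLevelBound : Prop :=
  ∀ (W : WeierstrassCurve ℚ) [W.IsElliptic] [W.IsGloballyMinimal] {N : ℕ} [NeZero N]
    (f : CuspForm (Gamma0 N) 2) (p : ℕ) [Fact p.Prime], IsNewformOf W f → 5 ≤ p → p ^ 2 ∣ N →
    ∀ (T : geomTorsion W (p : ℤ)) (m : ℕ) [NeZero m] (φ : DirichletCharacter (ZMod p) m), T ≠ 0 → φ.IsPrimitive →
      (∀ σ : absoluteGaloisGroup ℚ,
        σ • T = (φ ((modNCyclotomicCharacter ℚ m σ : (ZMod m)ˣ) : ZMod m)).val • T) →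
      ∀ (ℓ : ℕ) [Fact ℓ.Prime], ℓ ≠ p → ¬ W.HasGoodReductionAtPrime ℓ → ¬ W.HasMultiplicativeReductionAtPrime ℓ →
        m.factorization ℓ ≤ N.factorization ℓ

end LevelBound

/-! ## §13  (E0b″) DISCHARGED (rev 8, g13): the primitive isogeny character gives (E0-T) unconditionally

For reducible `W[p]` (global minimal `W`, newform level `N`, `p ≥ 5`, `p² ∣ N`) take THE primitive isogeny character `φ`
of level `m` from (E0a″) `exists_isogenyCharacter_dirichlet_additive` and `N' = lcm(N, m)`.  Congruence at `q > N'`: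
such `q` divides neither `N` (so is good, `IsNewformOf.dvd_level_iff_dvd_conductorNorm` +
`hasGoodReductionAtPrime_of_not_dvd_conductorNorm`, and `≠ p`) nor `m`.  Transfer: a prime `ℓ ∣ N'/N` has
`v_ℓ(m) > v_ℓ(N)`; `ℓ ≠ p` since `v_p(m) ≤ 1 < 2 ≤ v_p(N)` (tameness); `ℓ ∣ m`, so `ℓ` is additive (support control),
so `ℓ ∣ N_E`, so `ℓ ∣ N`, so `v_ℓ(m) ≥ 2`; then (L1) `ℓ ∣ p − 1`, `ℓ < p` — exactly the hypothesis of
`exists_pow_entry10_dvd_of_gamma0`.  Hence (E0-T) `EisensteinCongruenceT W p N` with NO cite-level input, and the NET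
`residualOffWalls_of_standingFacts`. -/

section NoLevelControl

open Literature.NumberTheory.EllipticCurves.ModularForms CongruenceSubgroup
open scoped MatrixGroups

/-- In `(ℤ/m)ˣ` with `m = ℓ·m₁`, `ℓ ∣ m₁`: a unit `≡ 1 (mod m₁)` has `ℓ`-th power `1`. -/
theorem units_pow_eq_one_of_unitsMap_eq_one {m m₁ ℓ : ℕ} [NeZero m] (hm : m = ℓ * m₁) (hℓ : ℓ ∣ m₁)
    (a : (ZMod m)ˣ) (ha : ZMod.unitsMap (Dvd.intro_left ℓ hm.symm : m₁ ∣ m) a = 1) : a ^ ℓ = 1 := by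
  haveI : NeZero m₁ := ⟨fun h ↦ NeZero.ne m (by rw [hm, h, mul_zero])⟩
  apply Units.ext
  rw [Units.val_pow_eq_pow_val, Units.val_one]
  have ha' : (ZMod.cast ((a : (ZMod m)ˣ) : ZMod m) : ZMod m₁) = 1 := by
    have h := congrArg (fun u : (ZMod m₁)ˣ ↦ (u : ZMod m₁)) ha
    simpa only [ZMod.unitsMap_def, Units.coe_map, MonoidHom.coe_coe, ZMod.castHom_apply,
      Units.val_one] using h
  set A : ℤ := (((a : (ZMod m)ˣ) : ZMod m).val : ℤ) with hAdef
  have hA : ((A : ℤ) : ZMod m) = ((a : (ZMod m)ˣ) : ZMod m) := by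
    rw [hAdef, Int.cast_natCast, ZMod.natCast_zmod_val]
  have hA₁ : ((A : ℤ) : ZMod m₁) = ((1 : ℤ) : ZMod m₁) := by
    rw [hAdef, Int.cast_natCast, Int.cast_one, ← ZMod.cast_eq_val, ha']
  have hdvd : (m₁ : ℤ) ∣ A - 1 := (ZMod.intCast_eq_intCast_iff_dvd_sub 1 A m₁).mp hA₁.symm
  have hpow := mul_dvd_pow_sub_pow hdvd (Int.natCast_dvd_natCast.mpr hℓ)
  rw [one_pow] at hpow
  have hm' : (m : ℤ) = (m₁ : ℤ) * ℓ := by rw [hm]; push_cast; ring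
  rw [← hm'] at hpow
  have h := (ZMod.intCast_eq_intCast_iff_dvd_sub 1 (A ^ ℓ) m).mpr hpow
  rw [Int.cast_pow, hA, Int.cast_one] at h
  exact h.symm

/-- **The order lemma (L1).**  A PRIMITIVE Dirichlet character `φ : (ℤ/m)ˣ → 𝔽_pˣ` with `ℓ² ∣ m` has
`ℓ ∣ p − 1`: the kernel of `(ℤ/m)ˣ → (ℤ/(m/ℓ))ˣ` is killed by `ℓ`, and `φ` has order dividing `p − 1`. -/
theorem prime_dvd_sub_one_of_sq_dvd_of_isPrimitive {p : ℕ} [Fact p.Prime] {m : ℕ} [NeZero m]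
    {φ : DirichletCharacter (ZMod p) m} (hprim : φ.IsPrimitive) {ℓ : ℕ} (hℓ : ℓ.Prime)
    (h2 : ℓ ^ 2 ∣ m) : ℓ ∣ p - 1 := by
  by_contra hℓp
  obtain ⟨m₁, hm₁⟩ : ℓ ∣ m := (dvd_pow_self ℓ two_ne_zero).trans h2
  have hℓm₁ : ℓ ∣ m₁ := by
    have h : ℓ * ℓ ∣ ℓ * m₁ := by rw [← pow_two, ← hm₁]; exact h2
    exact Nat.dvd_of_mul_dvd_mul_left hℓ.pos h
  have hm₁m : m₁ ∣ m := Dvd.intro_left ℓ hm₁.symm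
  haveI : NeZero m₁ := ⟨fun h ↦ NeZero.ne m (by rw [hm₁, h, mul_zero])⟩
  have hfac : φ.FactorsThrough m₁ := by
    rw [DirichletCharacter.factorsThrough_iff_ker_unitsMap hm₁m]
    intro a ha
    rw [MonoidHom.mem_ker] at ha ⊢
    have haℓ : a ^ ℓ = 1 := units_pow_eq_one_of_unitsMap_eq_one hm₁ hℓm₁ a ha
    have h1 : φ.toUnitHom a ^ ℓ = 1 := by rw [← map_pow, haℓ, map_one]
    have h2 : φ.toUnitHom a ^ (p - 1) = 1 := ZMod.units_pow_card_sub_one_eq_one p _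
    have h3 : φ.toUnitHom a ^ (Nat.gcd ℓ (p - 1)) = 1 := pow_gcd_eq_one.mpr ⟨h1, h2⟩
    rwa [Nat.coprime_iff_gcd_eq_one.mp ((Nat.Prime.coprime_iff_not_dvd hℓ).mpr hℓp), pow_one] at h3
  have hcond : φ.conductor ∣ m₁ := DirichletCharacter.conductor_dvd_of_mem_conductorSet φ hfac
  rw [hprim] at hcond
  have hle := Nat.le_of_dvd (NeZero.pos m₁) hcond
  rw [hm₁] at hle
  have := hℓ.two_le
  have := NeZero.pos m₁
  nlinarith


/-- **(E0-T) for reducible `W[p]`, PROVED** — the primitive isogeny character of (E0a″) with `N' = lcm(N, m)`: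
congruence at every prime `q > N'`, and the `p′`-transfer `Γ₀(N) ⇝ Γ₀(N')` from (L1) + support control + tameness. -/
theorem eisensteinCongruenceT_of_reducible (W : WeierstrassCurve ℚ) [W.IsElliptic] [W.IsGloballyMinimal] {N : ℕ}
    [NeZero N] (f : CuspForm (Gamma0 N) 2) (p : ℕ) [Fact p.Prime] (hf : IsNewformOf W f) (hp5 : 5 ≤ p)
    (hpN : p ^ 2 ∣ N) (hred : ¬ W.HasIrreducibleModPGaloisRep p) : EisensteinCongruenceT W p N := by
  have hp : p.Prime := Fact.out
  have hN0 : N ≠ 0 := NeZero.ne N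
  obtain ⟨T, m, hm, φ, hT0, hprim, hr, hp2, hsupp, hcong⟩ := exists_isogenyCharacter_dirichlet_additive W p hred
  have hm0 : m ≠ 0 := NeZero.ne m
  obtain ⟨L, hLdef⟩ : ∃ L : ℕ, L = Nat.lcm N m := ⟨_, rfl⟩
  have hL0 : L ≠ 0 := by rw [hLdef]; exact Nat.lcm_ne_zero hN0 hm0
  haveI : NeZero L := ⟨hL0⟩
  have hNL : N ∣ L := by rw [hLdef]; exact Nat.dvd_lcm_left N m
  have hmL : m ∣ L := by rw [hLdef]; exact Nat.dvd_lcm_right N m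
  refine ⟨L, m, inferInstance, φ, hNL, hmL, fun κ ↦ ?_, fun q hq hLq ↦ ?_⟩
  · refine exists_pow_entry10_dvd_of_gamma0 hp hNL (fun ℓ hℓ hℓD ↦ ?_) κ
    haveI : Fact ℓ.Prime := ⟨hℓ⟩
    have hD0 : L / N ≠ 0 := by
      intro h
      have := Nat.eq_mul_of_div_eq_right hNL h
      rw [mul_zero] at this
      exact hL0 this
    have hpos : 0 < (L / N).factorization ℓ := hℓ.factorization_pos_of_dvd hD0 hℓD
    rw [Nat.factorization_div hNL, Finsupp.tsub_apply, hLdef, Nat.factorization_lcm hN0 hm0,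
      Finsupp.sup_apply] at hpos
    have hlt : N.factorization ℓ < m.factorization ℓ := by
      rcases Nat.lt_or_ge (N.factorization ℓ) (m.factorization ℓ) with h | h
      · exact h
      · rw [sup_eq_left.mpr h, Nat.sub_self] at hpos
        exact absurd hpos (lt_irrefl 0)
    have hℓm : ℓ ∣ m := Nat.dvd_of_factorization_pos (by omega)
    -- `ℓ ≠ p`: tameness `p² ∤ m` against `p² ∣ N`
    have hℓp : ℓ ≠ p := by
      rintro rfl
      have h1 : m.factorization ℓ < 2 := by
        by_contra h
        exact hp2 ((hp.pow_dvd_iff_le_factorization hm0).mpr (not_lt.mp h))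
      have h2 : 2 ≤ N.factorization ℓ := (hp.pow_dvd_iff_le_factorization hN0).mp hpN
      omega
    -- `ℓ ∣ N`: `ℓ` is additive (support control), hence divides the conductor, hence the level
    obtain ⟨hng, -⟩ := hsupp ℓ hℓm hℓp
    have hℓN : ℓ ∣ N := by
      by_contra hℓN
      exact hng (hasGoodReductionAtPrime_of_not_dvd_conductorNorm W
        (fun h ↦ hℓN ((hf.dvd_level_iff_dvd_conductorNorm hℓ).mpr h)))
    have h1 : 1 ≤ N.factorization ℓ := (hℓ.dvd_iff_one_le_factorization hN0).mp hℓN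
    -- `ℓ² ∣ m`, so (L1) `ℓ ∣ p − 1`, so `ℓ < p`
    have h2 : ℓ ^ 2 ∣ m := (hℓ.pow_dvd_iff_le_factorization hm0).mpr (by omega)
    have hℓp1 : ℓ ∣ p - 1 := prime_dvd_sub_one_of_sq_dvd_of_isPrimitive hprim hℓ h2
    have h3 : ℓ ≤ p - 1 := Nat.le_of_dvd (by have := hp.two_le; omega) hℓp1
    exact ⟨hℓN, by omega⟩
  · haveI : Fact q.Prime := ⟨hq⟩
    have hqN : ¬ q ∣ N := fun h ↦
      absurd (Nat.le_of_dvd (NeZero.pos L) (h.trans hNL)) (not_le.mpr hLq)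
    have hqm : ¬ q ∣ m := fun h ↦
      absurd (Nat.le_of_dvd (NeZero.pos L) (h.trans hmL)) (not_le.mpr hLq)
    have hqp : q ≠ p := by
      rintro rfl
      exact hqN ((dvd_pow_self q two_ne_zero).trans hpN)
    have hgood : W.HasGoodReductionAtPrime q :=
      hasGoodReductionAtPrime_of_not_dvd_conductorNorm W
        (fun h ↦ hqN ((hf.dvd_level_iff_dvd_conductorNorm hq).mpr h))
    exact hcong q hqp hqm hgood

/-- **(E0-T) for reducible `W[p]`** as a Prop (the shape consumed by the assembly; PROVED next). -/
def EisensteinCongruenceTOfReducibleMin : Prop :=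
  ∀ (W : WeierstrassCurve ℚ) [W.IsElliptic] [W.IsGloballyMinimal] {N : ℕ} [NeZero N]
    (f : CuspForm (Gamma0 N) 2) (p : ℕ) [Fact p.Prime], IsNewformOf W f → 5 ≤ p → p ^ 2 ∣ N →
    ¬ W.HasIrreducibleModPGaloisRep p → EisensteinCongruenceT W p N

theorem eisensteinCongruenceTOfReducibleMin_holds : EisensteinCongruenceTOfReducibleMin :=
  fun W _ _ _ _ f p _ hf hp5 hpN hred ↦ eisensteinCongruenceT_of_reducible W f p hf hp5 hpN hred

/-- (E0-min) ⇒ (E0-T)-min (so every earlier net chain factors through the rev-8 one). -/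
theorem eisensteinCongruenceTOfReducibleMin_of_min (hC : EisensteinCongruenceOfReducibleMin) :
    EisensteinCongruenceTOfReducibleMin :=
  fun W _ _ _ _ f p _ hf hp5 hpN hred ↦ eisensteinCongruenceT_of_eisensteinCongruence (hC W f p hf hp5 hpN hred)

/-- `katoMemberTwoParity_of_levers_min` with the transfer-form even lever and (E0-T)-min (same plumbing). -/
theorem katoMemberTwoParity_of_leversT (hK : KatoNeronMemberTwistedValues) (hO : OddMemberLever)
    (hE : EvenMemberLeverT) (hC : EisensteinCongruenceTOfReducibleMin) (hA : NonAnomalousOfReceptacle) :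
    KatoMemberTwoParity := by
  intro W _ _ N _ f hf p _ hp5 hpN hgood hmult hred hrec
  obtain ⟨W_K, hKE, hKM, hiso, hcl⟩ := hK W p
  obtain ⟨heven, hodd⟩ := hcl f hf hp5 hgood hmult
  have htors : p ≤ 7 → ∀ P : (W_K.baseChange ℚ_[p]).toAffine.Point, p • P = 0 → P = 0 := by
    intro hp7
    rcases hrec with h | h
    · exact absurd h (by omega)
    · exact h W_K hiso
  refine ⟨W_K, hKE, hKM, hiso, hO W W_K f p hf hiso hp5 hpN htors hodd, fun hNR ↦ ?_⟩
  exact hE W W_K f p hf hiso hp5 hpN (hC W f p hf hp5 hpN hred) (hA W p N (NeZero.ne N) hp5 hrec) hNR htors heven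

/-- **NET of rev 8 — no cite-level input left.**  `ResidualOffWalls` (`R` off its two walls) from the four standing
facts of the Kato road (`hT₂ hP hDR hP1`) and Mazur's torsion theorem (tree named fact `mazur_torsion`) ALONE: both
member levers (the even one in transfer form), (E1), (E0a″), (L1), the `p′`-transfer, P-1, P-2 and the assembly are
theorems of this file / the tree.  BSD is not proved by any of this; `R` itself is not proved (the walls remain). -/
theorem residualOffWalls_of_standingFacts
    (hT₂ : Literature.NumberTheory.PAdicHodge.exists_smul_range_expStarCoord_tower_iff_trace_log)
    (hP : Literature.NumberTheory.PAdicHodge.cupLogInjective_and_hasDualExp_of_isDeRham)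
    (hDR : Literature.NumberTheory.PAdicHodge.isDeRham_restrictedRationalTateRep)
    (hP1 : exists_member_sl2ZetaElement_neron_values)
    (hMT : ∀ V : WeierstrassCurve ℚ, mazur_torsion V) : ResidualOffWalls :=
  residualOffWalls_of_katoMemberTwoParity
    (katoMemberTwoParity_of_leversT (katoNeronMemberTwistedValues_of_sl2NeronValues hT₂ hP hDR hP1)
      oddMemberLever_holds evenMemberLeverT_holds eisensteinCongruenceTOfReducibleMin_holds
      (nonAnomalousOfReceptacle_of_mazur hMT))

end NoLevelControl


end Summit.BirchSwinnertonDyer.BirchSwinnertonDyer.Cruxes.ManinPrimeToAdditiveFiveLe.TwoParityMemberLever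

end
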